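import Mathlib
import Summits.ResolutionOfSingularities.ResolutionOfSingularities.Theorems.RadicialJungCleanModelsLens5PRankTwoPort5
import Literature.FieldTheory.Separability.PDegreeSeparablyGenerated
import HarnessLib

/-!
# Lens 5 — THEOREMS T′_fin ⊃ T′₁: the (P2)-slice of `stub_cleanLU3DefectNonDiscrete` over IMPERFECT ground fields of FINITE `p`-rank

OURS · CANDIDATE · counted 0.  Crux workfile on `stmt-ResolutionOfSingularities-0549` (`Theses.Descent.DescentPerfectToAll`); customer =
the lead's research stub `stub_cleanLU3DefectNonDiscrete` of `Cruxes/CleanModels/Lines/Sketch.lean` (rev 28 :279/:307), whose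
residual after THEOREM T (✓ `Theorems/RadicialJungCleanModelsLens5PRankTwoPort5.lean`, slice {`PerfectField k`, `[Γ : pΓ] = p²`}) is
{`[Γ : pΓ] ≤ p`} ∪ {all IMPERFECT `k`}.  Nothing here proves resolution in char `p`; resolution in char p NOT proved.  Four levels
below the crux: T′₁ ⊂ T′_fin ⊂ :279 ⊂ :219 ⊂ `CleanModels|_{dim ≥ 4}` ⊂ 0549.

## rev 2 / rev 3 (res-B-lens-5 g13, same session as rev 1): T′₁ (p-rank one) GENERALISED to T′_fin (any FINITE p-rank); T′₁ kept as a corollary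
rev 1 proved the slice `CleanLU3DefectPRankTwoSepRkOneAt p` (`k = k^p[θ]`).  rev 2 replaces the powers `θ^i` (`i < p`) throughout by an
abstract finite `p`-SPANNING FAMILY `b : S → k` (`k = Σ_s k^p b_s`, §B′) residually `p`-independent along `v`; every port goes through
with the same proofs (the index `Fin p` of the `θ`-grading becomes `S`; the only new algebra is `[k K^p : K^p] = |S|`,
`finrank_adjoin_family_eq_card`, and the structure constants `B_s B_t = Σ_u d_u^p B_u`, `span_family_mul`, replacing the
`C[Θ]`-mod-`(X^p - Θ^p)` representation of rev 1).  New final theorem `cleanLU3DefectPRankTwoSepFin_of_cossartPiltant2019 :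
CossartPiltant2019 → F-32 → CleanLU3DefectPRankTwoSepFinAt p`; rev 1's `cleanLU3DefectPRankTwoSepRkOne_of_cossartPiltant2019` (same
statement, same name) is now the corollary `S := Fin p`, `b i := θ^i` (`cleanLU3DefectPRankTwoSepRkOne_of_sepFin`).
rev 3 (same session) adds two statement-level sanity items, both PROVED: §C′ `residuallyPIndependentFamily_of_rational` — bridge B1 in the
`k`-RATIONAL case (residue field `k`: (RPI-fam) ⟸ `k^p`-linear independence of `b`; the general «`κ_v/k` separable algebraic» bridge stays by
hand, memo §17/§18) — and §H `cleanLU3DefectPRankTwo_sep_of_sepFin` — T′_fin ⊇ T up to (SEP-K): over a PERFECT `k` the family `b = 1`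
(`S = Unit`) satisfies (FIN)+(RPI-fam), so the new slice specialises to T's slice ✓ `CleanLU3DefectPRankTwoAt p` plus the binder `SepGenerated k K`.

## The slice T′_fin (lens 5 = «arbitrary fields», CP 2019's regime)
`CleanLU3DefectPRankTwoSepFinAt p`: the binders of `CleanLU3DefectPRankTwoAt p` WITHOUT `PerfectField k`, plus
* (P2) `PRankTwoAt p O` (as in T);
* `SepGenerated k K` — `K/k` separably generated (gives `[K : k·K^p] = p³`, §A, Matsumura Thm. 26.5);
* a FINITE `p`-SPANNING FAMILY `b : S → k` (`IsPSpanningFamily p b`: `k = Σ_s k^p b_s`; exists iff `[k : k^p] < ∞` — FINITE `p`-rank: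
  every field finitely generated over a perfect field, `𝔽_q((s))`, their finite extensions …; `p`-rank one = `b = (θ^i)_{i<p}`, T′₁);
* `ResiduallyPIndependentFamily p O b`: a combination `Σ_s w_s^p b_s` with the `w_s ∈ O_v` not all in `𝔪_v` is a `v`-unit.  For `κ_v/k`
  algebraic this is «`κ_v/k` separable» (MacLane: a `p`-basis of `k` stays `p`-independent in `κ_v`); it EXCLUDES exactly the
  `RegularNotGeometricallyRegular` phenomenon in the residue field (memo §10: with `κ_v ∋ b_s^{1/p}` the base change `T ⊗_{k^p} k` of the
  `k^p`-model is singular and no lens-5 lever exists).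

## Architecture (ARCH-1 of NOTES/HANDOFF § g13; THEOREM T's ports re-used, two of them verbatim)
`M := K^p(g₀)` (✓ ImmediateValues).  The regular model `T` lives over the PERFECT-LIKE base `k₀ := k^p` INSIDE `M`
(PORT 2′ = Port 2b over the field `k^p`, F-02 applied to `↥(frobenius k p).fieldRange`, F-32 verbatim), the chart (PORT 3) is VERBATIM,
and the regular chart algebra is built over `k` from `T⁺ := T ⊗_{k^p} k = Σ_s b_s T` (base-change lemma §F: `𝔪_{T⁺} = 𝔪_T T⁺` by the
RESIDUAL GRADEDNESS RG) by PORT 4′ = Port 4b with one new tail: the regular parameter `ψ ∈ T⁺[u] = Σ_s b_s T[u]` has graded components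
`ψ_s ∈ S ∩ M`, `v(ψ) = max_s v(ψ_s)` (RG), so some `ψ_s ∈ M ∩ (𝔪_S ∖ 𝔪_S²)`; exit ✓ `cleanLUConcl_of_parameter` verbatim.
The single new valuation-theoretic input is RG: `v(Σ_s c_s b_s) = max_s v(c_s)` for `c_s ∈ M` — from the IMMEDIATE RESIDUES of
`M = K^p(g₀)` (IR, a consequence of `hdefect`: `K(g₀^{1/p})/K` is immediate) and `ResiduallyPIndependentFamily`.

## Status of this file (rev 3, res-B-lens-5 g13): SORRY-FREE (`lean check` rc 0, 0 sorries, 0 warnings; axioms = Lean's three)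
Every section is PROVED: §A `[K : k K^p] = p³` (copy of ✓ `Lens5_PDegreeSep.lean`); §B/§B′ the slice definitions; §C residual
`p`-independence from a non-`p`-th-power residue (residue field + ✓ `ImmediateValues.minpoly_eq_X_pow_sub_C`), RG (power and family forms),
and IR = immediate RESIDUES of `K^p(g₀)` (the residue-field twin of ✓ `ImmediateValues.exists_valuation_eq_pthPower_of_noBestApprox`, same
best-approximation contradiction); §D PORT 1′ (double grading `{B_s x^a y^b}`, degree count `[k K^p : K^p] = |S|`); §E PORT 2′ (Port 2b core
copied verbatim WITHOUT `PerfectField`, applied over `k₀ = k^p`; consumes `hLU3` = F-02 at the field `k^p` and `hEmb` = F-32, and ONLY here);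
§F base change `T⁺ = Σ_s B_s T`; §G PORT 4′; §H composition + the T′₁ corollary.
Hence `cleanLU3DefectPRankTwoSepFin_of_cossartPiltant2019 : CossartPiltant2019 → F-32 → CleanLU3DefectPRankTwoSepFinAt p` (and the
`p`-rank-one corollary `cleanLU3DefectPRankTwoSepRkOne_of_cossartPiltant2019`) are THEOREMS of the tree's library plus this file.  NOT counted
(crux workfile, four levels below 0549); resolution in char p NOT proved.

## Residual of the lead's stub after T ∪ T′_fin (honest)
{`[Γ : pΓ] ≤ p`} (no grading — memo §11; not a lens-5 regime) ∪ {imperfect `k` of INFINITE `p`-rank} (needs `p`-bases, absent from Mathlib;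
the argument itself is finitary only through `hdeg`) ∪ {`K/k` not separably generated} ∪ {`κ_v/k` with a residually `p`-DEPENDENT `p`-basis}
(base change singular, memo §10 — outside the lever).
-/

set_option linter.dupNamespace false
set_option linter.unusedVariables false
set_option linter.unusedSectionVars false

/-! ## §A `[K : k·K^p] = p³` for `K/k` separably generated of transcendence degree 3 (copy of the crux workfile
`Lens5_PDegreeSep.lean`, ✓ there; crux workfiles are not importable modules, hence the verbatim copy) -/

namespace Summit.ResolutionOfSingularities.ResolutionOfSingularities.Cruxes.DescentPerfectToAll.CpSibling.TPrime.PDegreeSep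

open IntermediateField Module Literature.FieldTheory.Separability Literature.AlgebraicGeometry.Resolution

variable {k : Type} {K : Type} [Field k] [Field K] [Algebra k K] (p : ℕ) [Fact p.Prime] [CharP K p]

/-- A `k`-derivation of `K` that kills the subfield `F` and the set `t` kills `F(t)`. [folklore] -/
theorem derivation_eq_zero_of_mem_adjoin (F : Subfield K) (hFD : ∀ (D : Derivation k K K) (x : K), x ∈ F → D x = 0)
    (D : Derivation k K K) {t : Set K} (ht : ∀ b ∈ t, D b = 0) {x : K} (hx : x ∈ adjoin F t) : D x = 0 := by
  have hx' : x ∈ Subfield.closure (Set.range (algebraMap F K) ∪ t) := by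
    rwa [← adjoin_toSubfield]
  have h := Derivation.eqOn_subfieldClosure (D₁ := D.restrictScalars ℤ) (D₂ := 0)
    (s := Set.range (algebraMap F K) ∪ t) ?_ hx'
  · simpa using h
  · rintro y (⟨c, rfl⟩ | hy)
    · change D (c : K) = (0 : Derivation ℤ K K) _
      rw [Derivation.zero_apply]
      exact hFD D c c.2
    · change D y = (0 : Derivation ℤ K K) y
      rw [Derivation.zero_apply]
      exact ht y hy

/-- A separating transcendence basis of `K/k` is `p`-independent over any subfield `F ⊇ K^p` killed by all `k`-derivations.
[cite: Matsumura1987, §26 p. 202 and Thm. 26.5] -/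
theorem isPIndependent_of_sepTrBasis (F : Subfield K) (hFp : ∀ x : K, x ^ p ∈ F)
    (hFD : ∀ (D : Derivation k K K) (x : K), x ∈ F → D x = 0) (s : Finset K)
    (hs : AlgebraicIndependent k ((↑) : s → K)) (hsep : Algebra.IsSeparable (adjoin k (s : Set K)) K) :
    IsPIndependent (F := F) p (s : Set K) := by
  classical
  suffices h : ∀ t : Finset K, t ⊆ s → IsPIndependent (F := F) p (t : Set K) from
    fun t ht => (h t (fun x hx => ht hx)) t subset_rfl
  intro t
  induction t using Finset.induction_on with
  | empty =>
    intro _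
    rw [Finset.coe_empty]
    exact isPIndependent_empty _ p
  | insert a t hat ih =>
    intro hts
    have hts' : t ⊆ s := fun x hx => hts (Finset.mem_insert_of_mem hx)
    have has : a ∈ s := hts (Finset.mem_insert_self a t)
    rw [Finset.coe_insert]
    refine isPIndependent_insert (ih hts') ?_ ⟨⟨a ^ p, hFp a⟩, rfl⟩
    intro hmem
    obtain ⟨D, hDa, hDb⟩ := exists_derivation_dual s hs hsep ⟨a, has⟩
    have hDt : ∀ b ∈ (t : Set K), D b = 0 := fun b hb => by
      have hbs : b ∈ s := hts' hb
      have hba : (⟨b, hbs⟩ : s) ≠ ⟨a, has⟩ := fun h => hat (by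
        rw [← show b = a from congrArg Subtype.val h]; exact hb)
      exact hDb ⟨b, hbs⟩ hba
    have := derivation_eq_zero_of_mem_adjoin F hFD D hDt hmem
    rw [hDa] at this
    exact one_ne_zero this

/-- `K = F(s)` for a separating transcendence basis `s` of `K/k` and any subfield `F` containing (the image of) `k` and `K^p`.
[cite: Matsumura1987, §26 p. 202 and Thm. 26.5] -/
theorem adjoin_eq_top_of_sepTrBasis (F : Subfield K) (hFk : ∀ c : k, algebraMap k K c ∈ F) (hFp : ∀ x : K, x ^ p ∈ F)
    (s : Finset K) (hsep : Algebra.IsSeparable (adjoin k (s : Set K)) K) :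
    adjoin F (s : Set K) = ⊤ := by
  classical
  set M : IntermediateField F K := adjoin F (s : Set K) with hM
  have hle : ∀ y : adjoin k (s : Set K), (y : K) ∈ M := by
    intro y
    have hy : (y : K) ∈ Subfield.closure (Set.range (algebraMap k K) ∪ (s : Set K)) := by
      rw [← adjoin_toSubfield]; exact y.2
    have hsub : Set.range (algebraMap k K) ∪ (s : Set K) ⊆ (M.toSubfield : Set K) := by
      rintro z (⟨c, rfl⟩ | hz)
      · exact M.algebraMap_mem ⟨algebraMap k K c, hFk c⟩
      · exact subset_adjoin F (s : Set K) hz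
    exact Subfield.closure_le.mpr hsub hy
  let f : adjoin k (s : Set K) →+* M := (algebraMap (adjoin k (s : Set K)) K).codRestrict M hle
  have hf : (algebraMap M K).comp f = algebraMap (adjoin k (s : Set K)) K := RingHom.ext fun _ => rfl
  haveI : ExpChar M p := by
    haveI : CharP M p := (algebraMap M K).charP (algebraMap M K).injective p
    exact ExpChar.prime Fact.out
  rw [eq_top_iff]
  intro x _
  have hxsep : IsSeparable M x :=
    isSeparable_of_ringHom_comp_eq f hf (Algebra.IsSeparable.isSeparable (adjoin k (s : Set K)) x)
  have hxperf : x ∈ perfectClosure M K := by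
    rw [mem_perfectClosure_iff_pow_mem p]
    refine ⟨1, ⟨⟨x ^ p, M.algebraMap_mem ⟨x ^ p, hFp x⟩⟩, ?_⟩⟩
    rw [pow_one]
    rfl
  have hxbot : x ∈ (⊥ : IntermediateField M K) := by
    rw [← separableClosure_inf_perfectClosure M K]
    exact ⟨mem_separableClosure_iff.mpr hxsep, hxperf⟩
  obtain ⟨y, hy⟩ := IntermediateField.mem_bot.mp hxbot
  rw [← hy]
  exact y.2

/-- `[K : F] = p^{#s}` for a separating transcendence basis `s` of `K/k` and a subfield `F` with `k ⊆ F`, `K^p ⊆ F`, killed by every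
`k`-derivation. [cite: Matsumura1987, §26 p. 202 and Thm. 26.5] -/
theorem finrank_eq_pow_card_of_sepTrBasis (F : Subfield K) (hFk : ∀ c : k, algebraMap k K c ∈ F) (hFp : ∀ x : K, x ^ p ∈ F)
    (hFD : ∀ (D : Derivation k K K) (x : K), x ∈ F → D x = 0) (s : Finset K)
    (hs : AlgebraicIndependent k ((↑) : s → K)) (hsep : Algebra.IsSeparable (adjoin k (s : Set K)) K) :
    finrank F K = p ^ s.card := by
  have h1 := (isPIndependent_of_sepTrBasis p F hFp hFD s hs hsep).finrank_eq s subset_rfl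
  rwa [adjoin_eq_top_of_sepTrBasis p F hFk hFp s hsep, finrank_top'] at h1

/-- `k ⊆ k·K^p`. -/
theorem composite_algebraMap_mem (c : k) :
    algebraMap k K c ∈ Subfield.closure (Set.range (algebraMap k K) ∪ Set.range (frobenius K p)) :=
  Subfield.subset_closure (Or.inl ⟨c, rfl⟩)

/-- `K^p ⊆ k·K^p`. -/
theorem composite_pow_mem (x : K) :
    x ^ p ∈ Subfield.closure (Set.range (algebraMap k K) ∪ Set.range (frobenius K p)) :=
  Subfield.subset_closure (Or.inr ⟨x, frobenius_def ..⟩)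

/-- Every `k`-derivation of `K` kills `k·K^p`. [folklore] -/
theorem composite_derivation_eq_zero (D : Derivation k K K) (x : K)
    (hx : x ∈ Subfield.closure (Set.range (algebraMap k K) ∪ Set.range (frobenius K p))) : D x = 0 := by
  have h := Derivation.eqOn_subfieldClosure (D₁ := D.restrictScalars ℤ) (D₂ := 0)
    (s := Set.range (algebraMap k K) ∪ Set.range (frobenius K p)) ?_ hx
  · simpa using h
  · rintro y (⟨c, rfl⟩ | ⟨z, rfl⟩)
    · change D (algebraMap k K c) = (0 : Derivation ℤ K K) _
      rw [Derivation.zero_apply, Derivation.map_algebraMap]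
    · change D (frobenius K p z) = (0 : Derivation ℤ K K) _
      rw [Derivation.zero_apply, frobenius_def]
      exact Derivation.apply_pow_char (p := p) (D.restrictScalars ℤ) z

/-- `[K : k·K^p] = p^{#s}` for a finite separating transcendence basis `s` of `K/k`, ANY ground field `k` of characteristic `p`.
[cite: Matsumura1987, §26 p. 202 and Thm. 26.5] -/
theorem finrank_composite_eq_pow_card (s : Finset K) (hs : AlgebraicIndependent k ((↑) : s → K))
    (hsep : Algebra.IsSeparable (adjoin k (s : Set K)) K) :
    finrank (Subfield.closure (Set.range (algebraMap k K) ∪ Set.range (frobenius K p))) K = p ^ s.card :=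
  finrank_eq_pow_card_of_sepTrBasis p _ (composite_algebraMap_mem p) (composite_pow_mem p)
    (composite_derivation_eq_zero p) s hs hsep

omit [CharP K p] in
/-- `[K : k·K^p] = p³` for `K = Frac A`, `A` a finitely generated `k`-algebra of Krull dimension `3` over ANY field `k` of
characteristic `p`, `K/k` separably generated. [cite: Matsumura1987, Thm. 26.5] -/
theorem pDegreeThreeOfSepGenerated :
    ∀ (k : Type) [Field k] [CharP k p] (K : Type) [Field K] [Algebra k K] [CharP K p] (A : Subalgebra k K),
      A.FG → IsFractionRing A K → ringKrullDim A = 3 →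
        (∃ (n : ℕ) (s : Fin n → K), AlgebraicIndependent k s ∧ Algebra.IsSeparable (IntermediateField.adjoin k (Set.range s)) K) →
        Module.finrank (Subfield.closure (Set.range (algebraMap k K) ∪ Set.range (frobenius K p))) K = p ^ 3 := by
  intro k _ _ K _ _ _ A hAfg hfrac hdim hsg
  classical
  obtain ⟨n, s, hs, hsep⟩ := hsg
  haveI : Algebra.FiniteType k A := A.fg_iff_finiteType.mp hAfg
  haveI : Algebra.EssFiniteType A K := Algebra.EssFiniteType.of_isLocalization K (nonZeroDivisors A)
  haveI : Algebra.EssFiniteType k K := Algebra.EssFiniteType.comp k A K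
  obtain ⟨d, hd, htr⟩ := Literature.RingTheory.KrullDimension.exists_ringKrullDim_eq_and_trdeg_eq k A
  have hd3 : d = 3 := by
    rw [hd] at hdim
    exact_mod_cast hdim
  haveI : FaithfulSMul k A := (faithfulSMul_iff_algebraMap_injective k A).mpr (algebraMap k A).injective
  haveI : FaithfulSMul A K := (faithfulSMul_iff_algebraMap_injective A K).mpr (IsFractionRing.injective A K)
  haveI : Algebra.IsAlgebraic A K := IsLocalization.isAlgebraic K (nonZeroDivisors A)
  have htrK : Algebra.trdeg k K = (3 : ℕ) := by
    rw [← trdeg_add_eq k A (A := K), trdeg_eq_zero (R := A) (A := K), add_zero, htr, hd3]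
  haveI := hsep
  have halg : Algebra.IsAlgebraic (IntermediateField.adjoin k (Set.range s)) K := inferInstance
  have htb : IsTranscendenceBasis k s :=
    hs.isTranscendenceBasis_iff_isAlgebraic.mpr (IntermediateField.isAlgebraic_adjoin_iff_top.mp halg)
  have hn : n = 3 := by
    have h := htb.cardinalMk_eq_trdeg
    rw [Cardinal.mk_fin, htrK] at h
    exact_mod_cast h
  set s' : Finset K := Finset.univ.image s with hs'
  have hcoe : (s' : Set K) = Set.range s := by
    rw [hs', Finset.coe_image, Finset.coe_univ, Set.image_univ]
  have hs'' : AlgebraicIndependent k ((↑) : s' → K) := by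
    have := hs.to_subtype_range' hcoe.symm
    exact this
  have hsep' : Algebra.IsSeparable (adjoin k (s' : Set K)) K := by
    rw [hcoe]; exact hsep
  have hcard : s'.card = 3 := by
    rw [hs', Finset.card_image_of_injective _ hs.injective, Finset.card_univ, Fintype.card_fin, hn]
  rw [finrank_composite_eq_pow_card p s' hs'' hsep', hcard]

end Summit.ResolutionOfSingularities.ResolutionOfSingularities.Cruxes.DescentPerfectToAll.CpSibling.TPrime.PDegreeSep

section

open IsLocalRing
open Literature.AlgebraicGeometry.Resolution
open Summit.ResolutionOfSingularities.ResolutionOfSingularities.Theorems.RadicialJung.CleanModels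
open Summit.ResolutionOfSingularities.ResolutionOfSingularities.Theorems.RadicialJung.CleanModels.Lens5
open Summit.ResolutionOfSingularities.ResolutionOfSingularities.Theorems.RadicialJung.CleanModels.Lens5.PRankTwoCurrency
open Summit.ResolutionOfSingularities.ResolutionOfSingularities.Theorems.RadicialJung.CleanModels.Lens5.PRankTwoAssembly
open Summit.ResolutionOfSingularities.ResolutionOfSingularities.Theorems.RadicialJungCleanModels.Lens5RegularityCriterion
open Summit.ResolutionOfSingularities.ResolutionOfSingularities.Theorems.RadicialJungCleanModels.Lens5ChartSurjection

namespace Summit.ResolutionOfSingularities.ResolutionOfSingularities.Cruxes.DescentPerfectToAll.CpSibling.TPrime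

/-! ## §B Currency of T′₁ (`p`-rank one; kept — T′₁ is the corollary `S := Fin p`, `b i := θ^i` of T′_fin, §H) -/

/-- `K/k` separably generated (census `Census_lens5_pRankTwo.lean` def, verbatim). [folklore] -/
def SepGenerated (k K : Type) [Field k] [Field K] [Algebra k K] : Prop :=
    ∃ (n : ℕ) (s : Fin n → K), AlgebraicIndependent k s ∧ Algebra.IsSeparable (IntermediateField.adjoin k (Set.range s)) K

/-- **`θ` is a `p`-generator of `k`**: `k = k^p[θ] = Σ_{i<p} k^p θ^i`, i.e. `[k : k^p] ≤ p` (`p`-rank ≤ 1). [folklore] -/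
def IsPGenerator (p : ℕ) {k : Type} [Field k] (θ : k) : Prop :=
    ∀ c : k, ∃ d : Fin p → k, c = ∑ i : Fin p, d i ^ p * θ ^ (i : ℕ)

/-- **Residual `p`-independence of `1, Θ, …, Θ^{p-1}`** along `v` (in-`K` form): a combination `Σ_{i<p} w_i^p Θ^i` with integral
coefficients one of which is a unit is a unit.  For `Θ ∈ k` and `κ_v/k` algebraic this says that the `p`-basis `{θ}` of `k` stays
`p`-independent in `κ_v`, i.e. `κ_v/k` is separable. [folklore] -/
def ResiduallyPIndependent (p : ℕ) {K : Type} [Field K] (O : ValuationSubring K) (Θ : K) : Prop :=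
    ∀ w : Fin p → K, (∀ i, w i ∈ O) → (∃ i, O.valuation (w i) = 1) →
      O.valuation (∑ i : Fin p, w i ^ p * Θ ^ (i : ℕ)) = 1

/-- **THEOREM T′₁'s slice**: `stub_cleanLU3DefectNonDiscrete` at `p` on {`[Γ : pΓ] = p²`, `K/k` separably generated, `k` of
`p`-rank ≤ 1 with `p`-generator `θ` residually `p`-independent along `v`} — NO `PerfectField k`. [folklore] -/
def CleanLU3DefectPRankTwoSepRkOneAt (p : ℕ) : Prop :=
    ∀ (k : Type) [Field k] [CharP k p] (K : Type) [Field K] [Algebra k K]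
    (O : ValuationSubring K) (A : Subalgebra k K), A.toSubring ≤ O.toSubring → A.FG → IsFractionRing A K →
    ringKrullDim A ≤ 3 → IsRegularLocalRing (locAtCentre A.toSubring O) →
    ringKrullDim (locAtCentre A.toSubring O) = 3 →
    (∀ (T : Subring K) (hT : T ≤ O.toSubring), A.toSubring ≤ T → (subringCentre T O hT).IsMaximal) →
    ∀ g₀ : K, (∀ c : K, c ^ p ≠ g₀) →
    (∀ f₀ : K, ∃ f₁ : K, O.valuation (g₀ - f₁ ^ p) < O.valuation (g₀ - f₀ ^ p)) →
    (∀ hk : ∀ c : k, algebraMap k K c ∈ O, transcendenceDefect k O hk ≠ 0) →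
    ¬ (∃ π : K, π ≠ 0 ∧ (∀ x : K, O.valuation x < 1 → O.valuation x ≤ O.valuation π) ∧
      (∀ x : K, x ≠ 0 → ∃ n : ℕ, O.valuation π ^ n ≤ O.valuation x)) →
    PRankTwoAt p O → SepGenerated k K →
    ∀ θ : k, IsPGenerator p θ → ResiduallyPIndependent p O (algebraMap k K θ) →
    CleanLUConcl p k K O A g₀

/-! ### §B′ Currency of T′_fin (finite `p`-rank): a finite `p`-spanning family of `k`, residually `p`-independent along `v` -/

/-- **A finite `p`-spanning family of `k`**: `k = Σ_{s ∈ S} k^p · b_s` (`S` finite).  Any field of FINITE `p`-rank `e` has one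
(the `p^e` monomials in a `p`-basis); `p`-rank one = the family `1, θ, …, θ^{p-1}`. [folklore] -/
def IsPSpanningFamily (p : ℕ) {k : Type} [Field k] {S : Type} [Fintype S] (b : S → k) : Prop :=
    ∀ c : k, ∃ d : S → k, c = ∑ s : S, d s ^ p * b s

/-- **Residual `p`-independence of a finite family** `B : S → K` along `v` (in-`K` form): `Σ_s w_s^p B_s` is a `v`-unit whenever the
`w_s ∈ O` are not all in `𝔪_v`.  For `B = b` a `p`-spanning family of `k ⊆ O` and `κ_v/k` algebraic this says that the `p`-basis of `k`
extracted from `b` stays `p`-independent in `κ_v`, i.e. (MacLane) `κ_v/k` is SEPARABLE. [folklore] -/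
def ResiduallyPIndependentFamily (p : ℕ) {K : Type} [Field K] (O : ValuationSubring K) {S : Type} [Fintype S]
    (B : S → K) : Prop :=
    ∀ w : S → K, (∀ s, w s ∈ O) → (∃ s, O.valuation (w s) = 1) → O.valuation (∑ s : S, w s ^ p * B s) = 1

/-- **THEOREM T′_fin's slice**: `stub_cleanLU3DefectNonDiscrete` at `p` on {`[Γ : pΓ] = p²`, `K/k` separably generated, `k` with a
FINITE `p`-spanning family (finite `p`-rank) residually `p`-independent along `v`} — NO `PerfectField k`. [folklore] -/
def CleanLU3DefectPRankTwoSepFinAt (p : ℕ) : Prop :=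
    ∀ (k : Type) [Field k] [CharP k p] (K : Type) [Field K] [Algebra k K]
    (O : ValuationSubring K) (A : Subalgebra k K), A.toSubring ≤ O.toSubring → A.FG → IsFractionRing A K →
    ringKrullDim A ≤ 3 → IsRegularLocalRing (locAtCentre A.toSubring O) →
    ringKrullDim (locAtCentre A.toSubring O) = 3 →
    (∀ (T : Subring K) (hT : T ≤ O.toSubring), A.toSubring ≤ T → (subringCentre T O hT).IsMaximal) →
    ∀ g₀ : K, (∀ c : K, c ^ p ≠ g₀) →
    (∀ f₀ : K, ∃ f₁ : K, O.valuation (g₀ - f₁ ^ p) < O.valuation (g₀ - f₀ ^ p)) →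
    (∀ hk : ∀ c : k, algebraMap k K c ∈ O, transcendenceDefect k O hk ≠ 0) →
    ¬ (∃ π : K, π ≠ 0 ∧ (∀ x : K, O.valuation x < 1 → O.valuation x ≤ O.valuation π) ∧
      (∀ x : K, x ≠ 0 → ∃ n : ℕ, O.valuation π ^ n ≤ O.valuation x)) →
    PRankTwoAt p O → SepGenerated k K →
    ∀ (S : Type) [Fintype S] (b : S → k), IsPSpanningFamily p b →
    ResiduallyPIndependentFamily p O (fun s => algebraMap k K (b s)) →
    CleanLUConcl p k K O A g₀

/-! ## §C The new valuation input: residual gradedness RG from immediate residues IR -/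

/-- Residual `p`-independence makes `Θ` a unit of `v` (take `w = e₁`; `p ≥ 2`). [folklore] -/
theorem valuation_eq_one_of_residuallyPIndependent {p : ℕ} [Fact p.Prime] {K : Type} [Field K] (O : ValuationSubring K)
    (Θ : K) (hPI : ResiduallyPIndependent p O Θ) : O.valuation Θ = 1 := by
  classical
  have hp : p.Prime := Fact.out
  have h1 : (1 : ℕ) < p := hp.one_lt
  have h := hPI (Pi.single (⟨1, h1⟩ : Fin p) 1) (fun i => by
    by_cases hi : i = ⟨1, h1⟩
    · subst hi; simp [O.one_mem]
    · simp [Pi.single_eq_of_ne hi, O.zero_mem]) ⟨⟨1, h1⟩, by simp⟩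
  rw [Finset.sum_eq_single (⟨1, h1⟩ : Fin p)] at h
  · simpa using h
  · intro i _ hi; simp [Pi.single_eq_of_ne hi, zero_pow hp.ne_zero]
  · intro h0; exact absurd (Finset.mem_univ _) h0

/-- **RG (residual gradedness).**  If every unit of the subfield `M` is residually a `p`-th power (IR) and `1, Θ, …, Θ^{p-1}` are
residually `p`-independent, then `v(Σ_{i<p} c_i Θ^i) = max_i v(c_i)` for `c_i ∈ M`.  PROVED (normalise by the
maximal coefficient, replace each `c_i/c_{i₀}` by a `p`-th power modulo `𝔪_v`, apply residual `p`-independence). [folklore] -/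
theorem valuation_sum_mul_pow_eq_sup {p : ℕ} [Fact p.Prime] {K : Type} [Field K] (O : ValuationSubring K) (M : Subfield K)
    (hIR : ∀ m : K, m ∈ M → O.valuation m = 1 → ∃ w : K, O.valuation (m - w ^ p) < 1)
    (Θ : K) (hPI : ResiduallyPIndependent p O Θ) (c : Fin p → K) (hc : ∀ i, c i ∈ M) :
    O.valuation (∑ i : Fin p, c i * Θ ^ (i : ℕ)) = Finset.univ.sup (fun i => O.valuation (c i)) := by
  classical
  have hp : p.Prime := Fact.out
  haveI : NeZero p := ⟨hp.ne_zero⟩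
  have hΘv := valuation_eq_one_of_residuallyPIndependent O Θ hPI
  by_cases h0 : ∀ i, c i = 0
  · have hf : (fun i => O.valuation (c i)) = fun _ : Fin p => (0 : O.ValueGroup) := by
      funext i; rw [h0 i, map_zero]
    rw [hf, Finset.sup_const Finset.univ_nonempty]
    simp [h0]
  push Not at h0
  obtain ⟨i₁, hi₁⟩ := h0
  obtain ⟨i₀, -, hi₀⟩ := Finset.exists_max_image Finset.univ (fun i => O.valuation (c i)) ⟨i₁, Finset.mem_univ _⟩
  have hsup : Finset.univ.sup (fun i => O.valuation (c i)) = O.valuation (c i₀) :=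
    le_antisymm (Finset.sup_le fun i hi => hi₀ i hi) (Finset.le_sup (f := fun i => O.valuation (c i)) (Finset.mem_univ i₀))
  have hc0 : c i₀ ≠ 0 := by
    intro h
    have h1 := hi₀ i₁ (Finset.mem_univ _)
    rw [h, map_zero, le_zero_iff, map_eq_zero] at h1
    exact hi₁ h1
  set d : Fin p → K := fun i => c i / c i₀ with hd
  have hdM : ∀ i, d i ∈ M := fun i => div_mem (hc i) (hc i₀)
  have hvc0 : O.valuation (c i₀) ≠ 0 := by rwa [ne_eq, map_eq_zero]
  have hdv : ∀ i, O.valuation (d i) ≤ 1 := fun i => by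
    simp only [hd, map_div₀]
    exact div_le_one_of_le₀ (hi₀ i (Finset.mem_univ _)) zero_le
  have hdi₀ : d i₀ = 1 := div_self hc0
  -- each `d_i` is a `p`-th power modulo `𝔪_v` (IR for the units, `0` for the others)
  have hw : ∀ i, ∃ w : K, O.valuation (d i - w ^ p) < 1 := by
    intro i
    rcases (hdv i).lt_or_eq with hlt | heq
    · exact ⟨0, by rw [zero_pow hp.ne_zero, sub_zero]; exact hlt⟩
    · exact hIR (d i) (hdM i) heq
  choose w hw using hw
  have hwO : ∀ i, w i ∈ O := by
    intro i
    rw [← O.valuation_le_one_iff]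
    by_contra hgt
    push Not at hgt
    have hwp : 1 < O.valuation (w i ^ p) := by rw [map_pow]; exact one_lt_pow₀ hgt hp.ne_zero
    have hlt : O.valuation (d i) < O.valuation (w i ^ p) := lt_of_le_of_lt (hdv i) hwp
    have heq : O.valuation (d i - w i ^ p) = O.valuation (w i ^ p) := Valuation.map_sub_eq_of_lt_right _ hlt
    exact lt_irrefl _ ((heq ▸ hw i).trans hwp)
  have hwi₀ : O.valuation (w i₀) = 1 := by
    have h := hw i₀
    rw [hdi₀] at h
    have h' : O.valuation (w i₀ ^ p - 1) < O.valuation (1 : K) := by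
      rw [← Valuation.map_neg, neg_sub, map_one]; exact h
    have h1 : O.valuation (w i₀ ^ p) = 1 := by
      have := Valuation.map_eq_of_sub_lt _ h'
      rwa [map_one] at this
    rw [map_pow] at h1
    rcases pow_eq_one_iff.mp h1 with h | h
    · exact h
    · exact absurd h hp.ne_zero
  -- the decomposition `Σ d_i Θ^i = Σ w_i^p Θ^i + Σ (d_i - w_i^p) Θ^i`: a unit plus an element of `𝔪_v`
  have hsplit : ∑ i : Fin p, d i * Θ ^ (i : ℕ) =
      ∑ i : Fin p, w i ^ p * Θ ^ (i : ℕ) + ∑ i : Fin p, (d i - w i ^ p) * Θ ^ (i : ℕ) := by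
    rw [← Finset.sum_add_distrib]; exact Finset.sum_congr rfl fun i _ => by ring
  have h1 : O.valuation (∑ i : Fin p, w i ^ p * Θ ^ (i : ℕ)) = 1 := hPI w hwO ⟨i₀, hwi₀⟩
  have h2 : O.valuation (∑ i : Fin p, (d i - w i ^ p) * Θ ^ (i : ℕ)) < 1 := by
    refine Valuation.map_sum_lt _ one_ne_zero fun i _ => ?_
    rw [map_mul, map_pow, hΘv, one_pow, mul_one]; exact hw i
  have hdsum : O.valuation (∑ i : Fin p, d i * Θ ^ (i : ℕ)) = 1 := by
    rw [hsplit, Valuation.map_add_eq_of_lt_left]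
    · exact h1
    · rw [h1]; exact h2
  have hcsum : ∑ i : Fin p, c i * Θ ^ (i : ℕ) = c i₀ * ∑ i : Fin p, d i * Θ ^ (i : ℕ) := by
    rw [Finset.mul_sum]
    exact Finset.sum_congr rfl fun i _ => by simp only [hd]; rw [← mul_assoc, mul_div_cancel₀ _ hc0]
  rw [hcsum, map_mul, hdsum, mul_one, hsup]

/-- Residual `p`-independence of a family makes each member a `v`-unit (take `w = e_s`). [folklore] -/
theorem valuation_eq_one_of_residuallyPIndependentFamily {p : ℕ} [Fact p.Prime] {K : Type} [Field K] (O : ValuationSubring K)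
    {S : Type} [Fintype S] (B : S → K) (hPI : ResiduallyPIndependentFamily p O B) (s : S) : O.valuation (B s) = 1 := by
  classical
  have hp : p.Prime := Fact.out
  have h := hPI (Pi.single s 1) (fun t => by
    by_cases ht : t = s
    · subst ht; simp [O.one_mem]
    · simp [Pi.single_eq_of_ne ht, O.zero_mem]) ⟨s, by simp⟩
  rw [Finset.sum_eq_single s] at h
  · simpa using h
  · intro t _ ht; simp [Pi.single_eq_of_ne ht, zero_pow hp.ne_zero]
  · intro h0; exact absurd (Finset.mem_univ _) h0

/-- **RG for a family (residual gradedness).**  If every unit of the subfield `M` is residually a `p`-th power (IR) and the finite family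
`B` is residually `p`-independent, then `v(Σ_s c_s B_s) = max_s v(c_s)` for `c_s ∈ M`.  PROVED (as the power version). [folklore] -/
theorem valuation_sum_mul_family_eq_sup {p : ℕ} [Fact p.Prime] {K : Type} [Field K] (O : ValuationSubring K) (M : Subfield K)
    (hIR : ∀ m : K, m ∈ M → O.valuation m = 1 → ∃ w : K, O.valuation (m - w ^ p) < 1)
    {S : Type} [Fintype S] (B : S → K) (hPI : ResiduallyPIndependentFamily p O B) (c : S → K) (hc : ∀ i, c i ∈ M) :
    O.valuation (∑ i : S, c i * B i) = Finset.univ.sup (fun i => O.valuation (c i)) := by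
  classical
  have hp : p.Prime := Fact.out
  have hBv := valuation_eq_one_of_residuallyPIndependentFamily O B hPI
  by_cases h0 : ∀ i, c i = 0
  · have hsup0 : Finset.univ.sup (fun i => O.valuation (c i)) = 0 :=
      le_antisymm (Finset.sup_le fun i _ => by rw [h0 i, map_zero]) zero_le
    rw [hsup0]
    have : ∑ i : S, c i * B i = 0 := Finset.sum_eq_zero fun i _ => by rw [h0 i, zero_mul]
    rw [this, map_zero]
  push Not at h0
  obtain ⟨i₁, hi₁⟩ := h0
  obtain ⟨i₀, -, hi₀⟩ := Finset.exists_max_image Finset.univ (fun i => O.valuation (c i)) ⟨i₁, Finset.mem_univ _⟩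
  have hsup : Finset.univ.sup (fun i => O.valuation (c i)) = O.valuation (c i₀) :=
    le_antisymm (Finset.sup_le fun i hi => hi₀ i hi) (Finset.le_sup (f := fun i => O.valuation (c i)) (Finset.mem_univ i₀))
  have hc0 : c i₀ ≠ 0 := by
    intro h
    have h1 := hi₀ i₁ (Finset.mem_univ _)
    rw [h, map_zero, le_zero_iff, map_eq_zero] at h1
    exact hi₁ h1
  set d : S → K := fun i => c i / c i₀ with hd
  have hdM : ∀ i, d i ∈ M := fun i => div_mem (hc i) (hc i₀)
  have hvc0 : O.valuation (c i₀) ≠ 0 := by rwa [ne_eq, map_eq_zero]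
  have hdv : ∀ i, O.valuation (d i) ≤ 1 := fun i => by
    simp only [hd, map_div₀]
    exact div_le_one_of_le₀ (hi₀ i (Finset.mem_univ _)) zero_le
  have hdi₀ : d i₀ = 1 := div_self hc0
  have hw : ∀ i, ∃ w : K, O.valuation (d i - w ^ p) < 1 := by
    intro i
    rcases (hdv i).lt_or_eq with hlt | heq
    · exact ⟨0, by rw [zero_pow hp.ne_zero, sub_zero]; exact hlt⟩
    · exact hIR (d i) (hdM i) heq
  choose w hw using hw
  have hwO : ∀ i, w i ∈ O := by
    intro i
    rw [← O.valuation_le_one_iff]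
    by_contra hgt
    push Not at hgt
    have hwp : 1 < O.valuation (w i ^ p) := by rw [map_pow]; exact one_lt_pow₀ hgt hp.ne_zero
    have hlt : O.valuation (d i) < O.valuation (w i ^ p) := lt_of_le_of_lt (hdv i) hwp
    have heq : O.valuation (d i - w i ^ p) = O.valuation (w i ^ p) := Valuation.map_sub_eq_of_lt_right _ hlt
    exact lt_irrefl _ ((heq ▸ hw i).trans hwp)
  have hwi₀ : O.valuation (w i₀) = 1 := by
    have h := hw i₀
    rw [hdi₀] at h
    have h' : O.valuation (w i₀ ^ p - 1) < O.valuation (1 : K) := by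
      rw [← Valuation.map_neg, neg_sub, map_one]; exact h
    have h1 : O.valuation (w i₀ ^ p) = 1 := by
      have := Valuation.map_eq_of_sub_lt _ h'
      rwa [map_one] at this
    rw [map_pow] at h1
    rcases pow_eq_one_iff.mp h1 with h | h
    · exact h
    · exact absurd h hp.ne_zero
  have hsplit : ∑ i : S, d i * B i = ∑ i : S, w i ^ p * B i + ∑ i : S, (d i - w i ^ p) * B i := by
    rw [← Finset.sum_add_distrib]; exact Finset.sum_congr rfl fun i _ => by ring
  have h1 : O.valuation (∑ i : S, w i ^ p * B i) = 1 := hPI w hwO ⟨i₀, hwi₀⟩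
  have h2 : O.valuation (∑ i : S, (d i - w i ^ p) * B i) < 1 := by
    refine Valuation.map_sum_lt _ one_ne_zero fun i _ => ?_
    rw [map_mul, hBv i, mul_one]; exact hw i
  have hdsum : O.valuation (∑ i : S, d i * B i) = 1 := by
    rw [hsplit, Valuation.map_add_eq_of_lt_left]
    · exact h1
    · rw [h1]; exact h2
  have hcsum : ∑ i : S, c i * B i = c i₀ * ∑ i : S, d i * B i := by
    rw [Finset.mul_sum]
    exact Finset.sum_congr rfl fun i _ => by simp only [hd]; rw [← mul_assoc, mul_div_cancel₀ _ hc0]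
  rw [hcsum, map_mul, hdsum, mul_one, hsup]

/-- **Residual `p`-independence from a non-`p`-th-power residue.**  If the `v`-unit `m` is NOT congruent to a `p`-th power modulo
`𝔪_v`, then `1, m, …, m^{p-1}` are residually `p`-independent: in the residue field `κ` the class `m̄ ∉ κ^p` has minimal polynomial
`X^p - m̄^p` over `κ^p` (✓ `ImmediateValues.minpoly_eq_X_pow_sub_C` applied to the field `κ`), so no non-trivial `κ^p`-relation of
degree `< p` exists. [folklore] -/
theorem residuallyPIndependent_of_not_residue_pthPower {p : ℕ} [Fact p.Prime] {K : Type} [Field K] [CharP K p]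
    (O : ValuationSubring K) (m : K) (hvm : O.valuation m = 1) (H : ∀ w : K, 1 ≤ O.valuation (m - w ^ p)) :
    ResiduallyPIndependent p O m := by
  classical
  have hp : p.Prime := Fact.out
  intro w hwO hunit
  obtain ⟨i₁, hi₁⟩ := hunit
  -- the residue field `κ` of `O`, of characteristic `p`
  haveI hOchar : CharP O p := (O.subtype).charP Subtype.val_injective p
  haveI : CharP (IsLocalRing.ResidueField O) p :=
    (RingHom.charP_iff_charP ((IsLocalRing.residue O).comp (ZMod.castHom (dvd_refl p) O)) p).mp (ZMod.charP p)
  have hmO : m ∈ O := (O.valuation_le_one_iff m).mp hvm.le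
  set mO : O := ⟨m, hmO⟩ with hmOdef
  set wO : Fin p → O := fun i => ⟨w i, hwO i⟩ with hwOdef
  set mbar : IsLocalRing.ResidueField O := IsLocalRing.residue O mO with hmbar
  -- `m̄` is not a `p`-th power in `κ`
  have hmnp : ∀ c : IsLocalRing.ResidueField O, c ^ p ≠ mbar := by
    intro c hc
    obtain ⟨cO, rfl⟩ := IsLocalRing.residue_surjective c
    have h0 : IsLocalRing.residue O (mO - cO ^ p) = 0 := by rw [map_sub, map_pow, hc, hmbar, sub_self]
    rw [IsLocalRing.residue_eq_zero_iff] at h0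
    have hlt : O.valuation (((mO - cO ^ p : O)) : K) < 1 := (O.valuation_lt_one_iff _).mp h0
    have hlt' : O.valuation (m - (cO : K) ^ p) < 1 := by
      have : (((mO - cO ^ p : O)) : K) = m - (cO : K) ^ p := by rw [hmOdef]; push_cast; rfl
      rw [← this]; exact hlt
    exact absurd (H (cO : K)) (not_le.mpr hlt')
  -- the element `S = Σ w_i^p m^i ∈ O`; suppose `v S < 1`
  set SO : O := ∑ i : Fin p, wO i ^ p * mO ^ (i : ℕ) with hSOdef
  have hS : ((SO : O) : K) = ∑ i : Fin p, w i ^ p * m ^ (i : ℕ) := by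
    rw [hSOdef]; push_cast; rfl
  have hle : O.valuation (∑ i : Fin p, w i ^ p * m ^ (i : ℕ)) ≤ 1 := by
    rw [← hS]; exact (O.valuation_le_one_iff _).mpr SO.2
  by_contra hne
  have hlt : O.valuation (∑ i : Fin p, w i ^ p * m ^ (i : ℕ)) < 1 := lt_of_le_of_ne hle hne
  rw [← hS, ← O.valuation_lt_one_iff] at hlt
  have hres : IsLocalRing.residue O SO = 0 := (IsLocalRing.residue_eq_zero_iff _).mpr hlt
  have hsum : ∑ i : Fin p, IsLocalRing.residue O (wO i) ^ p * mbar ^ (i : ℕ) = 0 := by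
    rw [← hres, hSOdef, map_sum]
    exact Finset.sum_congr rfl fun i _ => by rw [map_mul, map_pow, map_pow, hmbar]
  -- the `κ^p`-polynomial of degree `< p` killing `m̄`
  set Fκ : Subfield (IsLocalRing.ResidueField O) := (frobenius (IsLocalRing.ResidueField O) p).fieldRange with hFκ
  let coef : Fin p → Fκ := fun i =>
    ⟨IsLocalRing.residue O (wO i) ^ p, RingHom.mem_fieldRange.mpr ⟨IsLocalRing.residue O (wO i), frobenius_def _ _⟩⟩
  set P : Polynomial Fκ := ∑ i : Fin p, Polynomial.C (coef i) * Polynomial.X ^ (i : ℕ) with hPdef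
  have hPeval : Polynomial.aeval mbar P = 0 := by
    rw [hPdef, map_sum]
    rw [← hsum]
    refine Finset.sum_congr rfl fun i _ => ?_
    rw [map_mul, map_pow, Polynomial.aeval_C, Polynomial.aeval_X]
    rfl
  have hcoef : ∀ i : Fin p, P.coeff (i : ℕ) = coef i := by
    intro i
    rw [hPdef, Polynomial.finsetSum_coeff]
    rw [Finset.sum_eq_single i]
    · rw [Polynomial.coeff_C_mul_X_pow, if_pos rfl]
    · intro j _ hji
      rw [Polynomial.coeff_C_mul_X_pow, if_neg]
      exact fun h => hji (Fin.ext h).symm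
    · intro h; exact absurd (Finset.mem_univ i) h
  have hP0 : P ≠ 0 := by
    intro h
    have h1 := hcoef i₁
    rw [h, Polynomial.coeff_zero] at h1
    have h2 : IsLocalRing.residue O (wO i₁) ^ p = 0 := by
      have := congrArg Subtype.val h1.symm
      simpa [coef] using this
    have h3 : IsLocalRing.residue O (wO i₁) = 0 := (pow_eq_zero_iff hp.ne_zero).mp h2
    rw [IsLocalRing.residue_eq_zero_iff] at h3
    have h4 : O.valuation ((wO i₁ : O) : K) < 1 := (O.valuation_lt_one_iff _).mp h3
    have : ((wO i₁ : O) : K) = w i₁ := rfl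
    rw [this, hi₁] at h4
    exact lt_irrefl _ h4
  have hPdeg : P.natDegree < p := by
    have hd : P.degree < p := by rw [hPdef]; exact Polynomial.degree_sum_fin_lt coef
    exact (Polynomial.natDegree_lt_iff_degree_lt hP0).mpr hd
  -- the minimal polynomial of `m̄` over `κ^p` has degree `p` and divides `P`: contradiction
  have hmin := ImmediateValues.minpoly_eq_X_pow_sub_C (p := p) mbar hmnp
  have hdvd := minpoly.dvd Fκ mbar hPeval
  have hdeg := Polynomial.natDegree_le_of_dvd hdvd hP0
  rw [hmin, Polynomial.natDegree_X_pow_sub_C] at hdeg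
  exact absurd hPdeg (not_lt.mpr hdeg)

/-- **IR (immediate residues of `K^p(g₀)`).**  If `g₀` has no best `p`-th-power approximation (`hdefect`: the radicial extension
`K(g₀^{1/p})/K` is immediate for `v`), every `v`-unit of `M = K^p(g₀)` is congruent to a `p`-th power modulo `𝔪_v`.  PROVED:
if not, `1, m, …, m^{p-1}` are residually `p`-independent (previous lemma), hence RG holds for `m` over `K^p` (§C); then, exactly as in
✓ `ImmediateValues.exists_valuation_eq_pthPower_of_noBestApprox`, `g₀ = Σ a_i m^i` over `K^p` and `a₀ = α₀^p` is a BEST `p`-th-power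
approximation of `g₀`, contradicting `hdefect`. [folklore] -/
theorem immediateResidues_of_noBestApprox {p : ℕ} [Fact p.Prime] {K : Type} [Field K] [CharP K p] (O : ValuationSubring K)
    (g₀ : K)
    (hdefect : ∀ f₀ : K, ∃ f₁ : K, O.valuation (g₀ - f₁ ^ p) < O.valuation (g₀ - f₀ ^ p))
    (M : Subfield K) (hM : ∀ x : K, x ∈ M ↔ ∃ c : Fin p → K, ∑ j, c j ^ p * g₀ ^ (j : ℕ) = x)
    (m : K) (hm : m ∈ M) (hvm : O.valuation m = 1) : ∃ w : K, O.valuation (m - w ^ p) < 1 := by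
  classical
  have hpp : p.Prime := Fact.out
  haveI : NeZero p := ⟨hpp.ne_zero⟩
  by_contra Hn
  push Not at Hn
  have hPI := residuallyPIndependent_of_not_residue_pthPower O m hvm Hn
  have hm0 : m ≠ 0 := fun h => by rw [h, map_zero] at hvm; exact zero_ne_one hvm
  set F : Subfield K := (frobenius K p).fieldRange with hF_def
  have hpowF : ∀ x : K, x ^ p ∈ F := fun x => RingHom.mem_fieldRange.mpr ⟨x, frobenius_def p x⟩
  have hFpow : ∀ a : K, a ∈ F → ∃ α : K, α ^ p = a := fun a ha => by
    obtain ⟨α, hα⟩ := RingHom.mem_fieldRange.mp ha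
    exact ⟨α, by rw [← hα, frobenius_def]⟩
  -- RG for `m` over `K^p` (§C with IR for `K^p` trivial)
  have hIRF : ∀ a : K, a ∈ F → O.valuation a = 1 → ∃ w : K, O.valuation (a - w ^ p) < 1 := by
    intro a ha _
    obtain ⟨α, rfl⟩ := hFpow a ha
    exact ⟨α, by rw [sub_self, map_zero]; exact zero_lt_one⟩
  have hRGm : ∀ c : Fin p → K, (∀ i, c i ∈ F) →
      O.valuation (∑ i : Fin p, c i * m ^ (i : ℕ)) = Finset.univ.sup (fun i => O.valuation (c i)) :=
    fun c hc => valuation_sum_mul_pow_eq_sup O F hIRF m hPI c hc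
  have hLI : LinearIndependent F (fun i : Fin p => m ^ (i : ℕ)) := by
    rw [Fintype.linearIndependent_iff]
    intro g hg i
    have hsum : ∑ i, (g i : K) * m ^ (i : ℕ) = 0 := by
      have : ∑ i, (g i : K) * m ^ (i : ℕ) = ∑ i, g i • m ^ (i : ℕ) :=
        Finset.sum_congr rfl fun i _ => (Subfield.smul_def (g i) _).symm
      rw [this, hg]
    have hv := hRGm (fun i => (g i : K)) (fun i => (g i).2)
    rw [hsum, map_zero] at hv
    have hle : O.valuation (g i : K) ≤ Finset.univ.sup (fun i => O.valuation (g i : K)) :=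
      Finset.le_sup (f := fun i => O.valuation (g i : K)) (Finset.mem_univ i)
    rw [← hv, le_zero_iff, map_eq_zero] at hle
    exact_mod_cast hle
  -- `g₀` in the `K^p`-basis `1, m, …, m^{p-1}` of `V(g₀)` (verbatim from ✓ `exists_valuation_eq_pthPower_of_noBestApprox`)
  set V : Submodule F K := Submodule.span F (Set.range fun j : Fin p => g₀ ^ (j : ℕ)) with hV_def
  haveI : Module.Finite F V := Module.Finite.span_of_finite F (Set.finite_range _)
  have hVfin : Module.finrank F V ≤ p := ImmediateValues.finrank_span_powers_le g₀
  have hg₀V : g₀ ∈ V := ImmediateValues.self_mem_span_powers g₀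
  have hmV : m ∈ V := by
    obtain ⟨c, rfl⟩ := (hM m).mp hm
    exact (ImmediateValues.mem_span_powers_iff g₀ _).mpr ⟨c, rfl⟩
  have hmpow : ∀ n : ℕ, m ^ n ∈ V := by
    intro n
    induction n with
    | zero => simpa using ImmediateValues.one_mem_span_powers (p := p) g₀
    | succ n ih => rw [pow_succ]; exact ImmediateValues.mul_mem_span_powers g₀ ih hmV
  set b : Fin p → V := fun i => ⟨m ^ (i : ℕ), hmpow i⟩ with hb_def
  have hbLI : LinearIndependent F b := by apply LinearIndependent.of_comp V.subtype; exact hLI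
  have hcard : Fintype.card (Fin p) = Module.finrank F V :=
    le_antisymm (hbLI.fintype_card_le_finrank) (by simpa using hVfin)
  haveI : Nonempty (Fin p) := ⟨⟨0, hpp.pos⟩⟩
  have hspan : Submodule.span F (Set.range b) = ⊤ := hbLI.span_eq_top_of_card_eq_finrank hcard
  have hg₀span : (⟨g₀, hg₀V⟩ : V) ∈ Submodule.span F (Set.range b) := by rw [hspan]; exact Submodule.mem_top
  obtain ⟨a, ha⟩ := (Submodule.mem_span_range_iff_exists_fun F).mp hg₀span
  have haK : ∑ i, (a i : K) * m ^ (i : ℕ) = g₀ := by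
    have := congrArg Subtype.val ha; simpa [hb_def, Subfield.smul_def] using this
  set j0 : Fin p := ⟨0, hpp.pos⟩ with hj0_def
  obtain ⟨α₀, hα₀⟩ := hFpow (a j0) (a j0).2
  set T := ∑ i ∈ (Finset.univ : Finset (Fin p)).erase j0, (a i : K) * m ^ (i : ℕ) with hT_def
  have hgT : g₀ - α₀ ^ p = T := by
    rw [← haK, ← Finset.add_sum_erase Finset.univ (fun i => (a i : K) * m ^ (i : ℕ)) (Finset.mem_univ j0), hα₀]
    simp [hj0_def, hT_def]
  -- `α₀` is a best approximation: by RG over `K^p`, `v (g₀ - f^p) = sup (v ((α₀ - f)^p), v (a_i), i ≥ 1) ≥ v T`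
  have hbound : ∀ f : K, O.valuation T ≤ O.valuation (g₀ - f ^ p) := by
    intro f
    let a' : Fin p → K := fun i => if i = j0 then (α₀ - f) ^ p else (a i : K)
    have ha'F : ∀ i, a' i ∈ F := by
      intro i; by_cases hi : i = j0 <;> simp only [a', hi, if_true, if_false]; exact hpowF _; exact (a i).2
    let a'' : Fin p → K := fun i => if i = j0 then 0 else (a i : K)
    have ha''F : ∀ i, a'' i ∈ F := by
      intro i; by_cases hi : i = j0 <;> simp only [a'', hi, if_true, if_false]; exact F.zero_mem; exact (a i).2
    have hTsum : T = ∑ i ∈ (Finset.univ : Finset (Fin p)).erase j0, a' i * m ^ (i : ℕ) := by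
      refine Finset.sum_congr rfl fun i hi => ?_
      have hij : i ≠ j0 := Finset.ne_of_mem_erase hi
      simp only [a', hij, if_false]
    have hTsum' : T = ∑ i, a'' i * m ^ (i : ℕ) := by
      rw [← Finset.add_sum_erase Finset.univ (fun i => a'' i * m ^ (i : ℕ)) (Finset.mem_univ j0)]
      have hrest : ∑ i ∈ (Finset.univ : Finset (Fin p)).erase j0, a'' i * m ^ (i : ℕ) = T := by
        refine Finset.sum_congr rfl fun i hi => ?_
        have hij : i ≠ j0 := Finset.ne_of_mem_erase hi
        simp only [a'', hij, if_false]
      rw [hrest]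
      simp only [a'', if_true, zero_mul, zero_add]
    have hdiff : g₀ - f ^ p = ∑ i, a' i * m ^ (i : ℕ) := by
      rw [← Finset.add_sum_erase Finset.univ (fun i => a' i * m ^ (i : ℕ)) (Finset.mem_univ j0), ← hTsum, ← hgT]
      simp only [a', if_true, hj0_def]; rw [sub_pow_char]; ring
    rw [hdiff, hRGm a' ha'F, hTsum', hRGm a'' ha''F]
    refine Finset.sup_mono_fun fun i _ => ?_
    by_cases hi : i = j0
    · simp only [a', a'', hi, if_true, map_zero]; exact zero_le
    · simp only [a', a'', hi, if_false]; exact le_rfl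
  obtain ⟨f₁, hf₁⟩ := hdefect α₀
  rw [hgT] at hf₁
  exact absurd (hbound f₁) (not_le.mpr hf₁)

/-! ### §C′ Bridge B1 in the `k`-RATIONAL case: for a valuation with residue field `k` (every element of `O` is congruent to a constant),
residual `p`-independence of `b` read in `K` is just `k^p`-linear independence of `b` in `k` (so (FIN)+(RPI-fam) = «`b` is a `p`-basis-monomial
basis of `k` over `k^p`»).  The general bridge («`κ_v/k` separable algebraic», Mac Lane) is by hand in the memo (§17/§18), not formalised. -/

/-- Constants are `v`-units. [folklore] -/
theorem valuation_algebraMap_eq_one {k K : Type} [Field k] [Field K] [Algebra k K] (O : ValuationSubring K)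
    (hk : ∀ c : k, algebraMap k K c ∈ O) {c : k} (hc : c ≠ 0) : O.valuation (algebraMap k K c) = 1 := by
  have h1 : O.valuation (algebraMap k K c) ≤ 1 := (O.valuation_le_one_iff _).mpr (hk c)
  have h2 : O.valuation (algebraMap k K c⁻¹) ≤ 1 := (O.valuation_le_one_iff _).mpr (hk c⁻¹)
  have hprod : O.valuation (algebraMap k K c) * O.valuation (algebraMap k K c⁻¹) = 1 := by
    rw [← map_mul, ← map_mul, mul_inv_cancel₀ hc, map_one, map_one]
  refine le_antisymm h1 ?_
  calc (1 : _) = O.valuation (algebraMap k K c) * O.valuation (algebraMap k K c⁻¹) := hprod.symm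
    _ ≤ O.valuation (algebraMap k K c) * 1 := by gcongr
    _ = O.valuation (algebraMap k K c) := mul_one _

/-- **Bridge B1, `k`-rational case.**  If the residue field of `v` is `k` (`hrat`: every `x ∈ O` is `≡` a constant mod `𝔪_v`) and the finite
family `b` is `k^p`-linearly independent in `k` (`hbli`, in-`k` elementary form), then `b` is residually `p`-independent along `v`. [folklore] -/
theorem residuallyPIndependentFamily_of_rational (p : ℕ) [Fact p.Prime] {k K : Type} [Field k] [CharP k p] [Field K] [Algebra k K]
    (O : ValuationSubring K) (hk : ∀ c : k, algebraMap k K c ∈ O)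
    (hrat : ∀ x : K, x ∈ O → ∃ c : k, O.valuation (x - algebraMap k K c) < 1)
    {S : Type} [Fintype S] (b : S → k) (hbli : ∀ d : S → k, ∑ s, d s ^ p * b s = 0 → ∀ s, d s = 0) :
    ResiduallyPIndependentFamily p O (fun s => algebraMap k K (b s)) := by
  classical
  have hp : p.Prime := Fact.out
  haveI : CharP K p := charP_of_injective_algebraMap (algebraMap k K).injective p
  intro w hw hw1
  obtain ⟨s₀, hs₀⟩ := hw1
  choose c hc using fun s => hrat (w s) (hw s)
  -- the unit coefficient has a non-zero constant
  have hc₀ : c s₀ ≠ 0 := by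
    intro h0
    have := hc s₀
    rw [h0, map_zero, sub_zero, hs₀] at this
    exact lt_irrefl _ this
  -- hence the constant combination is a non-zero constant, a `v`-unit
  have hsum0 : ∑ s, c s ^ p * b s ≠ 0 := fun h0 => hc₀ (hbli c h0 s₀)
  have hunit : O.valuation (algebraMap k K (∑ s, c s ^ p * b s)) = 1 := valuation_algebraMap_eq_one O hk hsum0
  -- the difference lies in `𝔪_v`
  set D : K := ∑ s, (w s ^ p - algebraMap k K (c s) ^ p) * algebraMap k K (b s) with hD
  have hDlt : O.valuation D < 1 := by
    refine Valuation.map_sum_lt _ one_ne_zero fun s _ => ?_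
    rw [← sub_pow_char, map_mul, map_pow]
    have hb1 : O.valuation (algebraMap k K (b s)) ≤ 1 := (O.valuation_le_one_iff _).mpr (hk _)
    calc O.valuation (w s - algebraMap k K (c s)) ^ p * O.valuation (algebraMap k K (b s))
        ≤ O.valuation (w s - algebraMap k K (c s)) ^ p * 1 := by gcongr
      _ = O.valuation (w s - algebraMap k K (c s)) ^ p := mul_one _
      _ < 1 := pow_lt_one₀ zero_le (hc s) hp.ne_zero
  have hsplit : ∑ s, w s ^ p * algebraMap k K (b s) = algebraMap k K (∑ s, c s ^ p * b s) + D := by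
    rw [hD, map_sum, ← Finset.sum_add_distrib]
    refine Finset.sum_congr rfl fun s _ => ?_
    rw [map_mul, map_pow]; ring
  rw [hsplit, Valuation.map_add_eq_of_lt_left _ (by rw [hunit]; exact hDlt), hunit]

/-! ## §D PORT 1′ — the doubly graded data -/

/-- **DG (double grading, term ≤ sum).**  Under (V) for `M`, (P2) for `x, y`, `v (B s) = 1` and RG for the finite family `B`
over `M`, each term of `Σ_{s,(a,b)} m_{s,ab} B_s x^a y^b` (`m ∈ M`) is bounded by the sum: the inner sums `c_{ab} := Σ_s m_{s,ab} B_s`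
have `v(c_{ab}) = max_s v(m_{s,ab}) = v(m_{s₀,ab})` (RG), so the outer terms have pairwise distinct values (✓ `GradedBasis.monomial_values_ne`
with the representatives `m_{s₀,ab} ∈ M`). [folklore] -/
theorem valuation_term_le_double_sum {p : ℕ} (hp : p.Prime) {K : Type} [Field K] (O : ValuationSubring K) (M : Subfield K)
    (hV : ∀ m : K, m ∈ M → m ≠ 0 → ∃ z : K, z ≠ 0 ∧ O.valuation m = O.valuation (z ^ p))
    {S : Type} [Fintype S] (B : S → K) (hB1 : ∀ s, O.valuation (B s) = 1)
    (hRG : ∀ c : S → K, (∀ i, c i ∈ M) →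
      O.valuation (∑ i : S, c i * B i) = Finset.univ.sup (fun i => O.valuation (c i)))
    {x y : K} (hx : x ≠ 0) (hy : y ≠ 0)
    (hP : ∀ a b : ℕ, a < p → b < p → (a ≠ 0 ∨ b ≠ 0) → ∀ z : K, z ≠ 0 → O.valuation (x ^ a * y ^ b) ≠ O.valuation (z ^ p))
    (m : S × (Fin p × Fin p) → K) (hm : ∀ l, m l ∈ M) (l₀ : S × (Fin p × Fin p)) :
    O.valuation (m l₀ * (B l₀.1 * (x ^ (l₀.2.1 : ℕ) * y ^ (l₀.2.2 : ℕ)))) ≤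
      O.valuation (∑ l, m l * (B l.1 * (x ^ (l.2.1 : ℕ) * y ^ (l.2.2 : ℕ)))) := by
  classical
  haveI : NeZero p := ⟨hp.ne_zero⟩
  set mon : Fin p × Fin p → K := fun ab => x ^ (ab.1 : ℕ) * y ^ (ab.2 : ℕ) with hmon
  set c : Fin p × Fin p → K := fun ab => ∑ i : S, m (i, ab) * B i with hc
  have hsum : ∑ l, m l * (B l.1 * (x ^ (l.2.1 : ℕ) * y ^ (l.2.2 : ℕ))) = ∑ ab, c ab * mon ab := by
    rw [Fintype.sum_prod_type, Finset.sum_comm]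
    refine Finset.sum_congr rfl fun ab _ => ?_
    rw [hc, hmon]
    simp only
    rw [Finset.sum_mul]
    exact Finset.sum_congr rfl fun i _ => by ring
  have hvc : ∀ ab, O.valuation (c ab) = Finset.univ.sup (fun i => O.valuation (m (i, ab))) :=
    fun ab => hRG _ (fun i => hm (i, ab))
  -- argmax representative of each non-zero coefficient
  have hrep : ∀ ab, c ab ≠ 0 → ∃ i₀, m (i₀, ab) ≠ 0 ∧ O.valuation (c ab) = O.valuation (m (i₀, ab)) := by
    intro ab hcab
    have hne : (Finset.univ : Finset S).Nonempty := by
      rw [Finset.univ_nonempty_iff]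
      by_contra hS
      apply hcab
      rw [hc]
      exact Finset.sum_eq_zero fun i _ => (hS ⟨i⟩).elim
    obtain ⟨i₀, -, hi₀⟩ := Finset.exists_max_image Finset.univ (fun i => O.valuation (m (i, ab))) hne
    have hsup : Finset.univ.sup (fun i => O.valuation (m (i, ab))) = O.valuation (m (i₀, ab)) :=
      le_antisymm (Finset.sup_le fun i hi => hi₀ i hi) (Finset.le_sup (f := fun i => O.valuation (m (i, ab))) (Finset.mem_univ i₀))
    refine ⟨i₀, ?_, (hvc ab).trans hsup⟩
    intro h0
    apply hcab
    have : O.valuation (c ab) = 0 := by rw [hvc ab, hsup, h0, map_zero]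
    exact (map_eq_zero _).mp this
  -- pairwise distinct values of the `(a, b)`-terms
  have hpw : ∀ i ∈ (Finset.univ : Finset (Fin p × Fin p)), ∀ j ∈ (Finset.univ : Finset (Fin p × Fin p)), i ≠ j →
      c i * mon i ≠ 0 → O.valuation (c i * mon i) ≠ O.valuation (c j * mon j) := by
    intro i _ j _ hij hi0
    have hci : c i ≠ 0 := fun h0 => hi0 (by rw [h0, zero_mul])
    by_cases hcj : c j = 0
    · rw [hcj, zero_mul, map_zero]; exact (Valuation.ne_zero_iff _).mpr hi0
    obtain ⟨a₀, ha₀, hva₀⟩ := hrep i hci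
    obtain ⟨b₀, hb₀, hvb₀⟩ := hrep j hcj
    have hne := GradedBasis.monomial_values_ne hp O.valuation M hV hx hy hP i j hij (m (a₀, i)) (m (b₀, j)) (hm _) (hm _) ha₀ hb₀
    intro heq
    apply hne
    rw [Valuation.map_mul _ (m (a₀, i)), Valuation.map_mul _ (m (b₀, j)), ← hva₀, ← hvb₀, ← Valuation.map_mul,
      ← Valuation.map_mul]
    simpa only [hmon] using heq
  have houter : O.valuation (∑ ab, c ab * mon ab) = Finset.univ.sup (fun ab => O.valuation (c ab * mon ab)) :=
    GradedBasis.valuation_sum_eq_sup_of_pairwise O.valuation Finset.univ _ hpw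
  have hml₀ : m l₀ = m (l₀.1, l₀.2) := by rw [Prod.mk.eta]
  calc O.valuation (m l₀ * (B l₀.1 * (x ^ (l₀.2.1 : ℕ) * y ^ (l₀.2.2 : ℕ))))
        = O.valuation (m l₀) * O.valuation (mon l₀.2) := by
          rw [map_mul, map_mul, hB1, one_mul]
    _ ≤ O.valuation (c l₀.2) * O.valuation (mon l₀.2) := by
          apply mul_le_mul_left
          rw [hvc, hml₀]
          exact Finset.le_sup (f := fun i => O.valuation (m (i, l₀.2))) (Finset.mem_univ l₀.1)
    _ = O.valuation (c l₀.2 * mon l₀.2) := (map_mul _ _ _).symm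
    _ ≤ O.valuation (∑ ab, c ab * mon ab) := by
          rw [houter]; exact Finset.le_sup (f := fun ab => O.valuation (c ab * mon ab)) (Finset.mem_univ l₀.2)
    _ = _ := by rw [hsum]

/-- **`[k K^p : K^p] = |S|` for a `p`-spanning family which is `K^p`-linearly independent.**  `k K^p = K^p(B) = K^p`-span of `B`
(products `B_s B_t ∈ k = Σ k^p b_u` stay in the span). [folklore] -/
theorem finrank_adjoin_family_eq_card {p : ℕ} [Fact p.Prime] {k : Type} [Field k] {K : Type} [Field K] [CharP K p] [Algebra k K]
    {S : Type} [Fintype S] (b : S → k) (hb : IsPSpanningFamily p b)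
    (hli : LinearIndependent (frobenius K p).fieldRange (fun s => algebraMap k K (b s))) :
    Module.finrank (frobenius K p).fieldRange
        (IntermediateField.adjoin (frobenius K p).fieldRange (Set.range fun s => algebraMap k K (b s))) = Fintype.card S := by
  classical
  have hp : p.Prime := Fact.out
  set Kp : Subfield K := (frobenius K p).fieldRange with hKpdef
  set B : S → K := fun s => algebraMap k K (b s) with hBdef
  have hpowKp : ∀ x : K, x ^ p ∈ Kp := fun x => RingHom.mem_fieldRange.mpr ⟨x, frobenius_def p x⟩
  -- every `B s` is algebraic over `K^p` (root of `X^p - B_s^p`)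
  have halg : ∀ x ∈ Set.range B, IsAlgebraic Kp x := by
    rintro x ⟨s, rfl⟩
    refine IsIntegral.isAlgebraic ⟨Polynomial.X ^ p - Polynomial.C (⟨B s ^ p, hpowKp (B s)⟩ : Kp),
      Polynomial.monic_X_pow_sub_C _ hp.ne_zero, ?_⟩
    simp [Polynomial.eval₂_sub, Polynomial.eval₂_X_pow]
    exact sub_self (B s ^ p)
  set E := IntermediateField.adjoin Kp (Set.range B) with hEdef
  have hEalg : E.toSubalgebra = Algebra.adjoin Kp (Set.range B) :=
    IntermediateField.adjoin_toSubalgebra_of_isAlgebraic halg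
  -- the `K^p`-span of `B` is closed under multiplication
  set V : Submodule Kp K := Submodule.span Kp (Set.range B) with hVdef
  have hBV : ∀ s, B s ∈ V := fun s => Submodule.subset_span ⟨s, rfl⟩
  have hkV : ∀ c : k, algebraMap k K c ∈ V := by
    intro c
    obtain ⟨d, hd⟩ := hb c
    rw [hd, map_sum]
    refine sum_mem fun u _ => ?_
    rw [map_mul, map_pow]
    have : algebraMap k K (d u) ^ p * B u = (⟨algebraMap k K (d u) ^ p, hpowKp _⟩ : Kp) • B u := by
      rw [Subfield.smul_def, smul_eq_mul]
    rw [this]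
    exact V.smul_mem _ (hBV u)
  have hBmulV : ∀ s, ∀ y ∈ V, B s * y ∈ V := by
    intro s y hy
    induction hy using Submodule.span_induction with
    | mem x hx =>
      obtain ⟨t, rfl⟩ := hx
      have : B s * B t = algebraMap k K (b s * b t) := by rw [map_mul]
      rw [this]; exact hkV _
    | zero => rw [mul_zero]; exact V.zero_mem
    | add x y _ _ hx hy => rw [mul_add]; exact V.add_mem hx hy
    | smul a x _ hx => rw [mul_smul_comm]; exact V.smul_mem a hx
  have hmulV : ∀ x ∈ V, ∀ y ∈ V, x * y ∈ V := by
    intro x hx y hy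
    induction hx using Submodule.span_induction with
    | mem x hx' => obtain ⟨s, rfl⟩ := hx'; exact hBmulV s y hy
    | zero => rw [zero_mul]; exact V.zero_mem
    | add x₁ x₂ _ _ h₁ h₂ => rw [add_mul]; exact V.add_mem h₁ h₂
    | smul a x _ hx => rw [smul_mul_assoc]; exact V.smul_mem a hx
  have h1V : (1 : K) ∈ V := by have := hkV 1; rwa [map_one] at this
  have hclosure : (Submonoid.closure (Set.range B) : Set K) ⊆ V := by
    intro x hx
    induction hx using Submonoid.closure_induction with
    | mem x hx => exact Submodule.subset_span hx
    | one => exact h1V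
    | mul x y _ _ hx hy => exact hmulV x hx y hy
  have hspan : Subalgebra.toSubmodule (Algebra.adjoin Kp (Set.range B)) = V := by
    rw [Algebra.adjoin_eq_span]
    apply le_antisymm
    · exact Submodule.span_le.mpr hclosure
    · exact Submodule.span_mono Submonoid.subset_closure
  have hV : Module.finrank Kp V = Fintype.card S := finrank_span_eq_card hli
  calc Module.finrank Kp E = Module.finrank Kp E.toSubalgebra := (IntermediateField.finrank_eq_finrank_subalgebra _).symm
    _ = Module.finrank Kp (Subalgebra.toSubmodule E.toSubalgebra) := (Subalgebra.finrank_toSubmodule _).symm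
    _ = Module.finrank Kp V := by rw [hEalg, hspan]
    _ = Fintype.card S := hV

/-- **PORT 1′ (graded data over a ground field with a finite residually `p`-independent `p`-spanning family).**  `M := K^p(g₀)` with
its `p`-th-power values and RG; `x, y ∈ 𝔪_v` with (P2); generators `t` of `A`; and the DOUBLE grading: every `a ∈ t` is
`Σ_{s,(a,b)} m_{s,ab} B_s x^a y^b` with `m ∈ M` and every piece in `O` (`{B_s x^a y^b}` is an `M`-basis of `K`: `[K : k K^p] = p³` (hdeg),
`[k K^p : K^p] = |S|` (RG), `[K^p(g₀) : K^p] = p`).  PROVED (ingredients ✓ ImmediateValues*, ✓ GradedBasis, §C RG + IR). [folklore] -/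
theorem port_gradedData' (p : ℕ) [Fact p.Prime] {k : Type} [Field k] [CharP k p]
    {K : Type} [Field K] [CharP K p] [Algebra k K] (O : ValuationSubring K) (A : Subalgebra k K)
    (hAO : A.toSubring ≤ O.toSubring) (hAfg : A.FG)
    (g₀ : K) (hg₀ : ∀ c : K, c ^ p ≠ g₀)
    (hdefect : ∀ f₀ : K, ∃ f₁ : K, O.valuation (g₀ - f₁ ^ p) < O.valuation (g₀ - f₀ ^ p))
    (hP2 : PRankTwoAt p O)
    (hdeg : Module.finrank (Subfield.closure (Set.range (algebraMap k K) ∪ Set.range (frobenius K p))) K = p ^ 3)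
    {S : Type} [Fintype S] (b : S → k) (hb : IsPSpanningFamily p b)
    (hPI : ResiduallyPIndependentFamily p O (fun s => algebraMap k K (b s))) :
    ∃ (M : Subfield K), (∀ x : K, x ∈ M ↔ ∃ c : Fin p → K, ∑ j, c j ^ p * g₀ ^ (j : ℕ) = x) ∧ g₀ ∈ M ∧
      (∀ x : K, x ^ p ∈ M) ∧ (∀ m : K, m ∈ M → m ≠ 0 → ∃ w : K, w ≠ 0 ∧ O.valuation m = O.valuation (w ^ p)) ∧
      (∀ c : S → K, (∀ i, c i ∈ M) →
        O.valuation (∑ i : S, c i * algebraMap k K (b i)) = Finset.univ.sup (fun i => O.valuation (c i))) ∧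
      ∃ (x y : K), x ≠ 0 ∧ y ≠ 0 ∧ O.valuation x < 1 ∧ O.valuation y < 1 ∧
        (∀ a b : ℕ, a < p → b < p → (a ≠ 0 ∨ b ≠ 0) → ∀ z : K, z ≠ 0 →
          O.valuation (x ^ a * y ^ b) ≠ O.valuation (z ^ p)) ∧
        ∃ (t : Finset K), Algebra.adjoin k (t : Set K) = A ∧
          ∃ (cf : K → S × (Fin p × Fin p) → K), (∀ a ∈ t, ∀ l, cf a l ∈ M) ∧
            (∀ a ∈ t, ∑ l : S × (Fin p × Fin p),
              cf a l * (algebraMap k K (b l.1) * (x ^ (l.2.1 : ℕ) * y ^ (l.2.2 : ℕ))) = a) ∧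
            (∀ a ∈ t, ∀ l : S × (Fin p × Fin p),
              cf a l * (algebraMap k K (b l.1) * (x ^ (l.2.1 : ℕ) * y ^ (l.2.2 : ℕ))) ∈ O) := by
  classical
  have hp : p.Prime := Fact.out
  haveI : NeZero p := ⟨hp.ne_zero⟩
  set B : S → K := fun s => algebraMap k K (b s) with hBdef
  -- ## `M = K^p(g₀)` with its `p`-th-power values (✓ ImmediateValues), IR (§C) and RG (§C)
  obtain ⟨M, hM, hg₀M, hpM, hV⟩ := ImmediateValues.exists_subfield_immediate_values (p := p) O.valuation g₀ hdefect
  have hIR : ∀ m : K, m ∈ M → O.valuation m = 1 → ∃ w : K, O.valuation (m - w ^ p) < 1 :=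
    fun m hm hvm => immediateResidues_of_noBestApprox O g₀ hdefect M hM m hm hvm
  have hRG : ∀ c : S → K, (∀ i, c i ∈ M) →
      O.valuation (∑ i : S, c i * B i) = Finset.univ.sup (fun i => O.valuation (c i)) :=
    fun c hc => valuation_sum_mul_family_eq_sup O M hIR B hPI c hc
  have hB1 : ∀ s, O.valuation (B s) = 1 := valuation_eq_one_of_residuallyPIndependentFamily O B hPI
  have hB0 : ∀ s, B s ≠ 0 := fun s h => by have := hB1 s; rw [h, map_zero] at this; exact zero_ne_one this
  -- ## `S` is non-empty (`1 = Σ_s d_s^p b_s`)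
  haveI : Nonempty S := by
    by_contra hS
    obtain ⟨d, hd⟩ := hb 1
    have : (1 : k) = 0 := by rw [hd]; exact Finset.sum_eq_zero fun s _ => (hS ⟨s⟩).elim
    exact one_ne_zero this
  -- ## `B` is `K^p`-linearly independent (by RG over `M ⊇ K^p`)
  set Kp : Subfield K := (frobenius K p).fieldRange with hKpdef
  have hKpM : ∀ z : K, z ∈ Kp → z ∈ M := by
    intro z hz
    obtain ⟨u, rfl⟩ := RingHom.mem_fieldRange.mp hz
    rw [frobenius_def]; exact hpM u
  have hBli : LinearIndependent Kp B := by
    rw [Fintype.linearIndependent_iff]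
    intro g hg i
    have hsum : ∑ i, (g i : K) * B i = 0 := by
      have : ∑ i, (g i : K) * B i = ∑ i, g i • B i :=
        Finset.sum_congr rfl fun i _ => (Subfield.smul_def (g i) _).symm
      rw [this, hg]
    have hv := hRG (fun i => (g i : K)) (fun i => hKpM _ (g i).2)
    rw [hsum, map_zero] at hv
    have hle : O.valuation (g i : K) ≤ Finset.univ.sup (fun i => O.valuation (g i : K)) :=
      Finset.le_sup (f := fun i => O.valuation (g i : K)) (Finset.mem_univ i)
    rw [← hv, le_zero_iff, map_eq_zero] at hle
    exact_mod_cast hle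
  -- ## degrees: `[K : K^p] = |S|·p³` (from (hdeg) `[K : k K^p] = p³` and `[k K^p : K^p] = |S|`), `[K : M] = |S|·p²`
  have hF₀ : (IntermediateField.adjoin Kp (Set.range B)).toSubfield =
      Subfield.closure (Set.range (algebraMap k K) ∪ Set.range (frobenius K p)) := by
    rw [IntermediateField.adjoin_toSubfield]
    have hrange : Set.range (algebraMap Kp K) = Set.range (frobenius K p) := by
      ext z
      constructor
      · rintro ⟨w, rfl⟩
        obtain ⟨u, hu⟩ := RingHom.mem_fieldRange.mp w.2
        exact ⟨u, hu⟩
      · rintro ⟨u, rfl⟩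
        exact ⟨⟨frobenius K p u, RingHom.mem_fieldRange.mpr ⟨u, rfl⟩⟩, rfl⟩
    rw [hrange]
    apply le_antisymm
    · apply Subfield.closure_le.mpr
      rintro z (hz | hz)
      · exact Subfield.subset_closure (Or.inr hz)
      · obtain ⟨s, rfl⟩ := hz
        exact Subfield.subset_closure (Or.inl ⟨b s, rfl⟩)
    · apply Subfield.closure_le.mpr
      rintro z (⟨c₀, rfl⟩ | hz)
      · obtain ⟨d, hd⟩ := hb c₀
        rw [hd, map_sum]
        refine sum_mem fun i _ => ?_
        rw [map_mul, map_pow]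
        have h1 : algebraMap k K (d i) ^ p ∈ Subfield.closure (Set.range (frobenius K p) ∪ Set.range B) :=
          Subfield.subset_closure (Or.inl ⟨algebraMap k K (d i), rfl⟩)
        have h2 : B i ∈ Subfield.closure (Set.range (frobenius K p) ∪ Set.range B) :=
          Subfield.subset_closure (Or.inr ⟨i, rfl⟩)
        exact mul_mem h1 h2
      · exact Subfield.subset_closure (Or.inl hz)
  have hdegF₀ : Module.finrank (IntermediateField.adjoin Kp (Set.range B)) K = p ^ 3 := by
    have h : Module.finrank (IntermediateField.adjoin Kp (Set.range B)).toSubfield K = p ^ 3 := by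
      rw [hF₀]; exact hdeg
    exact h
  have hF₀deg : Module.finrank Kp (IntermediateField.adjoin Kp (Set.range B)) = Fintype.card S :=
    finrank_adjoin_family_eq_card b hb hBli
  have hKp : Module.finrank Kp K = Fintype.card S * p ^ 3 := by
    have htower := Module.finrank_mul_finrank Kp (IntermediateField.adjoin Kp (Set.range B)) K
    rw [hF₀deg, hdegF₀] at htower
    exact htower.symm
  have hMdeg : Module.finrank Kp (IntermediateField.adjoin Kp ({g₀} : Set K)) = p :=
    ImmediateValues.finrank_adjoin_pthPowers_eq g₀ hg₀
  have hfinM' : Module.finrank (IntermediateField.adjoin Kp ({g₀} : Set K)) K = Fintype.card S * p ^ 2 := by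
    have htower := Module.finrank_mul_finrank Kp (IntermediateField.adjoin Kp ({g₀} : Set K)) K
    rw [hMdeg, hKp] at htower
    have h' : p * Module.finrank (IntermediateField.adjoin Kp ({g₀} : Set K)) K = p * (Fintype.card S * p ^ 2) := by
      rw [htower]; ring
    exact Nat.eq_of_mul_eq_mul_left hp.pos h'
  have hMM : (IntermediateField.adjoin Kp ({g₀} : Set K)).toSubfield = M :=
    Subfield.ext fun z => (ImmediateValues.mem_adjoin_pthPowers_iff g₀ z).trans (hM z).symm
  have hfin : Module.finrank M K = Fintype.card S * p ^ 2 := by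
    have h : Module.finrank (IntermediateField.adjoin Kp ({g₀} : Set K)).toSubfield K = Fintype.card S * p ^ 2 := hfinM'
    rw [hMM] at h
    exact h
  -- ## (P2), normalised into the maximal ideal of `O` (as in Port 1)
  obtain ⟨x₀, y₀, hx₀, hy₀, hP₀⟩ := hP2
  obtain ⟨x, hx, hvx, hPx⟩ := exists_pRankTwo_lt_one_left hp O hx₀ hP₀
  obtain ⟨y, hy, hvy, hPy⟩ := exists_pRankTwo_lt_one_left hp O hy₀ (pRankTwo_swap O hPx)
  have hP := pRankTwo_swap O hPy
  -- ## generators and the doubly graded representation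
  obtain ⟨t, ht⟩ := hAfg
  have hDG := fun (m : S × (Fin p × Fin p) → K) (hm : ∀ l, m l ∈ M) =>
    valuation_term_le_double_sum hp O M hV B hB1 hRG hx hy hP m hm
  set e : S × (Fin p × Fin p) → K :=
    fun l => B l.1 * (x ^ (l.2.1 : ℕ) * y ^ (l.2.2 : ℕ)) with he
  have he0 : ∀ l, e l ≠ 0 := fun l =>
    mul_ne_zero (hB0 _) (mul_ne_zero (pow_ne_zero _ hx) (pow_ne_zero _ hy))
  have hli : LinearIndependent M e := by
    rw [Fintype.linearIndependent_iff]
    intro g hg l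
    have hsum : ∑ l, (g l : K) * e l = 0 := by
      have : ∑ l, (g l : K) * e l = ∑ l, g l • e l :=
        Finset.sum_congr rfl fun l _ => (Subfield.smul_def (g l) (e l)).symm
      rw [this, hg]
    have hle := hDG (fun l => (g l : K)) (fun l => (g l).2) l
    simp only [he] at hsum
    rw [hsum, map_zero, le_zero_iff, map_eq_zero] at hle
    rcases mul_eq_zero.mp hle with h1 | h1
    · exact_mod_cast h1
    · exact absurd h1 (he0 l)
  have hcard : Fintype.card (S × (Fin p × Fin p)) = Fintype.card S * p ^ 2 := by
    simp [Fintype.card_prod, Fintype.card_fin]; ring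
  have hNpos : 0 < Fintype.card S * p ^ 2 := Nat.mul_pos Fintype.card_pos (pow_pos hp.pos 2)
  have hrepr : ∀ a : K, ∃ c : S × (Fin p × Fin p) → M, ∑ l, (c l : K) * e l = a := by
    intro a
    obtain ⟨c, hc⟩ := ImmediateValues.exists_repr_of_linearIndependent_card_eq M hfin hNpos _ hli hcard a
    refine ⟨c, ?_⟩
    simpa only [Subfield.smul_def, smul_eq_mul] using hc
  choose c hc using hrepr
  refine ⟨M, hM, hg₀M, hpM, hV, hRG, x, y, hx, hy, hvx, hvy, hP, t, ht, fun a l => (c a l : K),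
    fun a _ l => (c a l).2, fun a _ => hc a, ?_⟩
  intro a ha l
  have haA : a ∈ A := by
    rw [← ht]
    exact Algebra.subset_adjoin (Finset.mem_coe.mpr ha)
  have haO : a ∈ O := show a ∈ O.toSubring from hAO haA
  have hva : O.valuation a ≤ 1 := (O.valuation_le_one_iff a).mpr haO
  have hterm := hDG (fun l => (c a l : K)) (fun l => (c a l).2) l
  simp only [he] at hc
  rw [hc a] at hterm
  exact (O.valuation_le_one_iff _).mp (hterm.trans hva)

/-! ## §E PORT 2′ — the monomialising regular `k^p`-model inside `M` (F-02 over the field `k^p`, F-32 verbatim) -/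

open AlgebraicGeometry CategoryTheory in
set_option linter.unusedVariables false in
set_option maxHeartbeats 800000 in
/-- **PORT 2 core (Port 2b with the perfectness of `k` replaced by the twist-field identification `htwist` it is used for).**
VERBATIM copy of ✓ `PRankTwoAssembly.port_monomialModel` (Theorems/…PRankTwoPort2b.lean, res-B-lens-5 g10 / res-B-lead-1 g5) with:
generators `t` explicit; `[PerfectField k]` dropped; the single use of ✓ `adjoin_twist_toSubfield_eq_of_perfectField` replaced by the
hypothesis `htwist`; the non-vanishing of the parameters `z` exported.  Consumes F-02 (`hLU`, via ✓ `TwistModel.exists_twist_model`) and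
F-32 (`hEmb`, via ✓ `exists_localRing_monomial_of_embeddedResolution`).
[cite: CossartPiltant2019, Thm. 1.1; CossartJannsenSaito2020, Thm. 1.6.3 (F-32)] -/
theorem port_monomialModel_core (p : ℕ) [Fact p.Prime] {k : Type} [Field k]
    {K : Type} [Field K] [CharP K p] [Algebra k K] (hLU : LocalUniformization3 k)
    (hEmb : ∀ (Z : Scheme.{0}) [IsIntegral Z] [IsNoetherian Z], Scheme.IsRegular Z →
      Scheme.IsExcellent Z → ∀ (X : Set Z), IsClosed X → X ≠ Set.univ → topologicalKrullDim X ≤ 2 →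
        ∃ (Z' : Scheme.{0}) (π : Z' ⟶ Z), IsProper π ∧ Function.Surjective π.base ∧
          (∃ U : Z.Opens, (U : Set Z) = Xᶜ ∧ IsIso (π ∣_ U)) ∧
          IsStrictNormalCrossingsDivisor Z' (π.base ⁻¹' X))
    (O : ValuationSubring K) (A : Subalgebra k K)
    (hAO : A.toSubring ≤ O.toSubring) (hAfg : A.FG) [IsFractionRing A K] (hdimA : ringKrullDim A ≤ 3)
    (hdim3 : ringKrullDim (locAtCentre A.toSubring O) = 3)
    (hzd : ∀ (T : Subring K) (hT : T ≤ O.toSubring), A.toSubring ≤ T → (subringCentre T O hT).IsMaximal)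
    (t : Finset K) (ht : Algebra.adjoin k (t : Set K) = A)
    (htwist : ∀ g₁ : K, (IntermediateField.adjoin k ((fun x : K => x ^ p) '' (t : Set K) ∪ {g₁})).toSubfield =
      Subfield.closure (Set.range (frobenius K p) ∪ {g₁}))
    (g₀ : K) (M : Subfield K) (hM : ∀ x : K, x ∈ M ↔ ∃ c : Fin p → K, ∑ j, c j ^ p * g₀ ^ (j : ℕ) = x)
    (F : Finset K) (hFM : ∀ f ∈ F, f ∈ M) (hF0 : ∀ f ∈ F, f ≠ 0) :
    ∃ (A₂ : Subalgebra k K) (hA₂O : A₂.toSubring ≤ O.toSubring), A₂.FG ∧ (∀ a ∈ A, a ^ p ∈ A₂) ∧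
      (∀ r : K, r ∈ locAtCentre A₂.toSubring O → r ∈ M) ∧
      ∃ (_ : IsRegularLocalRing (locAtCentre A₂.toSubring O)) (z : Fin 3 → locAtCentre A₂.toSubring O),
        Ideal.span (Set.range z) = IsLocalRing.maximalIdeal (locAtCentre A₂.toSubring O) ∧
        ringKrullDim (locAtCentre A₂.toSubring O) = 3 ∧ (∀ i, ((z i : K)) ≠ 0) ∧
        ∀ f ∈ F, ∃ (ε : K) (e : Fin 3 → ℤ), ε ∈ locAtCentre A₂.toSubring O ∧ O.valuation ε = 1 ∧
          f = ε * ∏ i, ((z i : K)) ^ (e i) := by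
  /- (rev 5, res-B-lens-5 g10) PORT 2 PROVED — the docstring's recipe, with two remarks: (i) F-32 is invoked directly
     (✓ `exists_localRing_monomial_of_embeddedResolution`, `R ⊆ k(S) ⊆ K` with `IsScalarTower.of_algebraMap_eq fun _ => rfl`) on
     `xR = g · ∏_f c_f d_f`; every `c_f`, `d_f` then divides the monomial `u₂ ∏ z₂^α` in the re-modelled `R₂ = locAtCentre A₂ O`, so
     ✓ `exists_eq_units_mul_prod_pow_of_dvd` factors it; (ii) the `d = 3` pinning (closed centre on `A₂ ⊇ t^p`, `dim A₂ = dim A = 3`,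
     ✓ `ringKrullDim_locAtCentre_eq_of_isMaximal`) is the separate lemma ✓ `centre_closed_and_dim_three_of_pow_mem` — kept out of
     the main context on purpose (inlined, the kernel re-check of this block does not terminate in budget). -/
  classical
  have hp : p.Prime := Fact.out
  have hdimAeq : ringKrullDim A = 3 := ringKrullDim_eq_three_of_locAtCentre O A hAO hdimA hdim3
  have hk : ∀ c : k, algebraMap k K c ∈ O := fun c => hAO (A.algebraMap_mem c)
  -- the `k`-subalgebra `O` (for `Algebra.adjoin_le` arguments)
  let Ok : Subalgebra k K := { O.toSubring with algebraMap_mem' := hk }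
  have hOk : ∀ x : K, x ∈ Ok ↔ x ∈ O := fun _ => Iff.rfl
  obtain ⟨g₁, hg₁O, hg₁⟩ := TwistModel.mem_or_inv_mem_valuationSubring O g₀
  -- ## the twist field `k(S)`, `S = t^p ∪ {g₁}`, and its regular model (F-02 via ✓ `TwistModel.exists_twist_model`)
  set S : Set K := (fun x : K => x ^ p) '' (t : Set K) ∪ {g₁} with hSdef
  obtain ⟨A', hA'O', hSA', hA'fg, hreg', hexc, hdim', hRO, hRm⟩ :=
    TwistModel.exists_twist_model p hLU O A hAO hAfg hdimAeq t ht hzd g₁ hg₁O S hSdef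
  set R : Subring (IntermediateField.adjoin k S) :=
    locAtCentre A'.toSubring (O.comap (algebraMap (IntermediateField.adjoin k S) K)) with hRdef
  haveI : IsRegularLocalRing R := hreg'
  haveI : IsScalarTower R (IntermediateField.adjoin k S) K := IsScalarTower.of_algebraMap_eq (fun _ => rfl)
  have halgR : ∀ r : R, algebraMap R K r = ((r : IntermediateField.adjoin k S) : K) := fun _ => rfl
  -- ## `k(S)` has underlying subfield `M = K^p(g₀)` (perfect `k`)
  have hM'sub : (IntermediateField.adjoin k S).toSubfield = Subfield.closure (Set.range (frobenius K p) ∪ {g₀}) := by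
    rw [hSdef, htwist g₁]
    rcases hg₁ with h | h
    · rw [h]
    · rw [h, TwistModel.subfield_closure_union_inv_eq]
  have hM'M : ∀ x : K, x ∈ IntermediateField.adjoin k S ↔ x ∈ M := by
    intro x
    rw [← IntermediateField.mem_toSubfield, hM'sub]
    constructor
    · intro hx
      refine (Subfield.closure_le (t := M)).mpr ?_ hx
      rintro y (⟨c, rfl⟩ | hy)
      · refine (hM _).mpr ⟨fun j => if (j : ℕ) = 0 then c else 0, ?_⟩
        rw [Finset.sum_eq_single (⟨0, hp.pos⟩ : Fin p)]
        · simp [frobenius_def]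
        · intro j _ hj
          have hj' : (j : ℕ) ≠ 0 := fun h => hj (Fin.ext h)
          simp [hj', hp.ne_zero]
        · intro h; exact absurd (Finset.mem_univ _) h
      · rw [Set.mem_singleton_iff.mp hy]
        refine (hM _).mpr ⟨fun j => if (j : ℕ) = 1 then 1 else 0, ?_⟩
        rw [Finset.sum_eq_single (⟨1, hp.one_lt⟩ : Fin p)]
        · simp
        · intro j _ hj
          have hj' : (j : ℕ) ≠ 1 := fun h => hj (Fin.ext h)
          simp [hj', hp.ne_zero]
        · intro h; exact absurd (Finset.mem_univ _) h
    · intro hx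
      obtain ⟨c, rfl⟩ := (hM x).mp hx
      have hg₀c : g₀ ∈ Subfield.closure (Set.range (frobenius K p) ∪ {g₀}) := Subfield.subset_closure (Or.inr rfl)
      refine sum_mem fun j _ => mul_mem ?_ (pow_mem hg₀c _)
      exact Subfield.subset_closure (Or.inl ⟨c j, frobenius_def _ _⟩)
  -- ## every `f ∈ F` is a quotient of two non-zero elements of `k[S]`, which lift to `R`
  have hFfrac : ∀ f ∈ F, ∃ c d : K, c ∈ Algebra.adjoin k S ∧ d ∈ Algebra.adjoin k S ∧ c ≠ 0 ∧ d ≠ 0 ∧ f = c / d := by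
    intro f hf
    have hfM' : f ∈ IntermediateField.adjoin k S := (hM'M f).mpr (hFM f hf)
    obtain ⟨c, hc, d, hd, hcd⟩ := IntermediateField.mem_adjoin_iff_div.mp hfM'
    have hd0 : d ≠ 0 := by
      rintro rfl
      rw [div_zero] at hcd
      exact hF0 f hf hcd
    have hc0 : c ≠ 0 := by
      rintro rfl
      rw [zero_div] at hcd
      exact hF0 f hf hcd
    exact ⟨c, d, hc, hd, hc0, hd0, hcd⟩
  choose! cF dF hcF hdF hcF0 hdF0 hFeq using hFfrac
  have hpre : ∀ c : K, c ∈ Algebra.adjoin k S → ∃ r : R, algebraMap R K r = c := by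
    intro c hc
    have hcM' : c ∈ IntermediateField.adjoin k S := IntermediateField.algebra_adjoin_le_adjoin k S hc
    have h1 : (⟨c, hcM'⟩ : IntermediateField.adjoin k S) ∈ A' :=
      hSA' ((TwistModel.mem_adjoin_preimage_iff S ⟨c, hcM'⟩).mpr hc)
    exact ⟨⟨⟨c, hcM'⟩, le_locAtCentre A'.toSubring _ h1⟩, rfl⟩
  have hcpre : ∀ f ∈ F, ∃ r : R, algebraMap R K r = cF f := fun f hf => hpre _ (hcF f hf)
  have hdpre : ∀ f ∈ F, ∃ r : R, algebraMap R K r = dF f := fun f hf => hpre _ (hdF f hf)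
  choose! rc hrc using hcpre
  choose! rd hrd using hdpre
  -- ## the element to monomialise: `xR = g · ∏_f c_f d_f`, `0 ≠ g ∈ 𝔪_R`
  have hmne : maximalIdeal R ≠ ⊥ := by
    intro h
    have hf : IsField R := (IsLocalRing.isField_iff_maximalIdeal_eq).mpr h
    have h0 := ringKrullDim_eq_zero_of_isField hf
    rw [hdim'] at h0
    norm_num at h0
  obtain ⟨g, hgm, hg0⟩ := Submodule.exists_mem_ne_zero_of_ne_bot hmne
  set xR : R := g * ∏ f ∈ F, (rc f * rd f) with hxRdef
  have hxR0 : xR ≠ 0 := by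
    refine mul_ne_zero hg0 (Finset.prod_ne_zero_iff.mpr fun f hf => mul_ne_zero ?_ ?_)
    · intro h
      exact hcF0 f hf (by rw [← hrc f hf, h, map_zero])
    · intro h
      exact hdF0 f hf (by rw [← hrd f hf, h, map_zero])
  have hxRm : xR ∈ maximalIdeal R := Ideal.mul_mem_right _ _ hgm
  -- ## F-32 on the M-side model (✓ pattern of `TwistModel.monomialise_on_twist_model`)
  have hRO' : ∀ r : R, algebraMap R K r ∈ O := fun r => hRO r
  have hRm' : ∀ r : R, r ∈ maximalIdeal R ↔ O.valuation (algebraMap R K r) < 1 := fun r => hRm r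
  obtain ⟨uu, huuM', huuO, R', _, _, _, hinj, hR'O, hR'm, hlow, hup, d, z, α, u, hu, hdimR', hspan, hfact⟩ :=
    exists_localRing_monomial_of_embeddedResolution hEmb (R := R) (K := IntermediateField.adjoin k S) (E := K)
      Subtype.val_injective hexc hdim' O
      hRO' hRm' xR hxR0 hxRm
  -- ## RE-MODEL on the `K`-side: `T = R[uu]`, `B = A'` read in `K`, `A₂ = k[B ∪ uu]`, `locAtCentre T O = locAtCentre A₂ O`
  let T : Subring K := (Algebra.adjoin R (uu : Set K)).toSubring
  have hTO : T ≤ O.toSubring := fun w hw => huuO w hw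
  have hTR : ∀ w ∈ T, w ∈ Set.range (algebraMap R' K) := fun w hw => hlow w hw
  have hRT : ∀ r : R, algebraMap R K r ∈ T := fun r => (Algebra.adjoin R (uu : Set K)).algebraMap_mem r
  have huuO' : ∀ w ∈ (uu : Set K), w ∈ O := fun w hw => huuO w (Algebra.subset_adjoin hw)
  set φ : IntermediateField.adjoin k S →ₐ[k] K := IsScalarTower.toAlgHom k (IntermediateField.adjoin k S) K with hφdef
  have hφ : ∀ y : IntermediateField.adjoin k S, φ y = (y : K) := fun _ => rfl
  set B : Subalgebra k K := A'.map φ with hBdef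
  have hBfg : B.FG := hA'fg.map φ
  have hBO : ∀ x ∈ (B : Set K), x ∈ O := by
    intro x hx
    obtain ⟨y, hy, rfl⟩ := Subalgebra.mem_map.mp hx
    exact ValuationSubring.mem_comap.mp (hA'O' hy)
  set A₂ : Subalgebra k K := Algebra.adjoin k ((B : Set K) ∪ ↑uu) with hA₂def
  have hA₂fg : A₂.FG := fg_adjoin_subalgebra_union B hBfg uu
  have hBA₂ : B ≤ A₂ := fun x hx => Algebra.subset_adjoin (Or.inl hx)
  have huuA₂ : ∀ w ∈ (uu : Set K), w ∈ A₂ := fun w hw => Algebra.subset_adjoin (Or.inr hw)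
  have hA₂Ok : A₂ ≤ Ok := Algebra.adjoin_le (Set.union_subset hBO huuO')
  have hA₂O : A₂.toSubring ≤ O.toSubring := fun x hx => hA₂Ok hx
  -- values in `O ∩ k(S)` are read in `K`
  have hval1 : ∀ y : IntermediateField.adjoin k S, y ∈ O.comap (algebraMap (IntermediateField.adjoin k S) K) →
      ((O.comap (algebraMap (IntermediateField.adjoin k S) K)).valuation y = 1 ↔
        O.valuation (algebraMap (IntermediateField.adjoin k S) K y) = 1) := by
    intro y hy
    have hyO : algebraMap (IntermediateField.adjoin k S) K y ∈ O := ValuationSubring.mem_comap.mp hy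
    have hlt := TwistModel.valuation_comap_lt_one_iff O (IntermediateField.adjoin k S) y hy
    have hle' : (O.comap (algebraMap (IntermediateField.adjoin k S) K)).valuation y ≤ 1 :=
      ((O.comap (algebraMap (IntermediateField.adjoin k S) K)).valuation_le_one_iff y).mpr hy
    have hle : O.valuation (algebraMap (IntermediateField.adjoin k S) K y) ≤ 1 := (O.valuation_le_one_iff _).mpr hyO
    constructor
    · intro h1
      rcases hle.lt_or_eq with h | h
      · have h' := hlt.mpr h
        rw [h1] at h'
        exact absurd h' (lt_irrefl _)
      · exact h
    · intro h1
      rcases hle'.lt_or_eq with h | h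
      · have h' := hlt.mp h
        rw [h1] at h'
        exact absurd h' (lt_irrefl _)
      · exact h
  have hrangeR : Set.range (algebraMap R K) = (locAtCentre B.toSubring O : Set K) := by
    ext x
    constructor
    · rintro ⟨r, rfl⟩
      obtain ⟨y, hy, w, hw, hw1, hr⟩ := (mem_locAtCentre_iff).mp r.2
      have hyB : (y : K) ∈ B := Subalgebra.mem_map.mpr ⟨y, hy, rfl⟩
      have hwB : (w : K) ∈ B := Subalgebra.mem_map.mpr ⟨w, hw, rfl⟩
      have hw1' : O.valuation (w : K) = 1 := (hval1 w (hA'O' hw)).mp hw1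
      refine (mem_locAtCentre_iff).mpr ⟨y, hyB, w, hwB, hw1', ?_⟩
      rw [halgR, hr]
      push_cast
      rfl
    · intro hx
      obtain ⟨y, hy, w, hw, hw1, rfl⟩ := (mem_locAtCentre_iff).mp hx
      obtain ⟨y', hy', rfl⟩ := Subalgebra.mem_map.mp hy
      obtain ⟨w', hw', rfl⟩ := Subalgebra.mem_map.mp hw
      have hw'1 : (O.comap (algebraMap (IntermediateField.adjoin k S) K)).valuation w' = 1 := (hval1 w' (hA'O' hw')).mpr hw1
      refine ⟨⟨y' / w', (mem_locAtCentre_iff).mpr ⟨y', hy', w', hw', hw'1, rfl⟩⟩, ?_⟩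
      rw [halgR]
      push_cast
      rfl
  have hT : T = Subring.closure ((locAtCentre B.toSubring O : Set K) ∪ ↑uu) := by
    change (Algebra.adjoin R (uu : Set K)).toSubring = _
    rw [Algebra.adjoin_eq_ring_closure, hrangeR]
  have hR₂eq : locAtCentre T O = locAtCentre A₂.toSubring O := by
    rw [hT, Summit.ResolutionOfSingularities.ResolutionOfSingularities.Theorems.PfaffLine.locAtCentre_closure_locAtCentre_union, Subalgebra.coe_toSubring, closure_subalgebra_union_eq]
  -- regular data transported to `R₂ := locAtCentre A₂ O` along `R' ≅ range = R₂`
  set R₂ : Subring K := locAtCentre A₂.toSubring O with hR₂def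
  have hrange0 : (algebraMap R' K).range = locAtCentre T O :=
    Summit.ResolutionOfSingularities.ResolutionOfSingularities.Theorems.RadicialJung.CleanModels.range_eq_locAtCentre
      (algebraMap R' K) O T hTR hR'm hup
  have hrange : (algebraMap R' K).range = R₂ := hrange0.trans hR₂eq
  obtain ⟨hreg₂, z₂, u₂, hz₂, hu₂K, hspan₂, hdim₂, hu₂⟩ :=
    Summit.ResolutionOfSingularities.ResolutionOfSingularities.Theorems.RadicialJung.CleanModels.regular_data_of_range_eq
      (algebraMap R' K) hinj R₂ hrange z hspan hdimR' u hu
  haveI := hreg₂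
  have hR₂O : R₂ ≤ O.toSubring := locAtCentre_le hA₂O
  have hTR₂ : T ≤ R₂ := le_of_le_of_eq (le_locAtCentre T O) hR₂eq
  -- ## `S ⊆ B`, hence `t^p ⊆ A₂` and `A^p ⊆ A₂`
  have hSB : ∀ s ∈ S, s ∈ B := by
    intro s hs
    have hsM' : s ∈ IntermediateField.adjoin k S := IntermediateField.subset_adjoin k S hs
    have h1 : (⟨s, hsM'⟩ : IntermediateField.adjoin k S) ∈ A' :=
      hSA' (Algebra.subset_adjoin
        (show (⟨s, hsM'⟩ : IntermediateField.adjoin k S) ∈ (Subtype.val : IntermediateField.adjoin k S → K) ⁻¹' S from hs))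
    exact Subalgebra.mem_map.mpr ⟨⟨s, hsM'⟩, h1, rfl⟩
  have hAp : ∀ a ∈ A, a ^ p ∈ A₂ := by
    intro a ha
    have ha' : a ∈ Algebra.adjoin k (t : Set K) := by rw [ht]; exact ha
    have h1 := TwistModel.pow_mem_adjoin_image_pow p (t : Set K) ha'
    refine (Algebra.adjoin_le ?_ : Algebra.adjoin k ((fun x : K => x ^ p) '' (t : Set K)) ≤ A₂) h1
    intro s hs
    exact hBA₂ (hSB s (by rw [hSdef]; exact Or.inl hs))
  -- ## `d = 3`: ✓ `centre_closed_and_dim_three_of_pow_mem` (the centre of `O` on `A₂` is closed since `A₂[t] ⊇ A` is integral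
  -- over `A₂`, and `dim A₂ = dim A = 3`), compared with `dim R₂ = d` from the regular data
  have htpA₂ : ∀ a ∈ (t : Set K), a ^ p ∈ A₂ := fun a ha => hAp a (by rw [← ht]; exact Algebra.subset_adjoin ha)
  obtain ⟨-, -, hdimR₂'⟩ :=
    centre_closed_and_dim_three_of_pow_mem hp.pos O A hAO hAfg hdimAeq t ht hzd A₂ hA₂O hA₂fg htpA₂
  have hdimR₂ : ringKrullDim R₂ = 3 := hdimR₂'
  have hd3 : d = 3 := by
    have h := hdim₂.symm.trans hdimR₂
    exact_mod_cast h
  subst hd3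
  -- ## `z₂` is a regular system of parameters; `xR = u₂ ∏ z₂^α` in `R₂`
  have hd' : (maximalIdeal R₂).spanFinrank = 3 := by
    have h := IsRegularLocalRing.spanFinrank_maximalIdeal (R := R₂)
    rw [hdim₂] at h
    exact_mod_cast h
  have hzr : IsRsopPart z₂ := isRsopPart_comp_of_rsop hd' z₂ hspan₂ id Function.injective_id
  have hz0 : ∀ i, (z₂ i : K) ≠ 0 := fun i h => hzr.ne_zero i (Subtype.ext h)
  let ψ : R →+* R₂ := (algebraMap R K).codRestrict R₂ (fun r => hTR₂ (hRT r))
  have hψK : ∀ r : R, ((ψ r : R₂) : K) = algebraMap R K r := fun _ => rfl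
  have hfact₂ : ψ xR = u₂ * ∏ i, z₂ i ^ α i := by
    apply Subtype.ext
    rw [hψK, hfact]
    push_cast
    simp only [hu₂K, hz₂]
  -- ## `locAtCentre A₂ O ⊆ M`
  let MR : Subalgebra R K :=
    { (IntermediateField.adjoin k S).toSubalgebra.toSubring with
      algebraMap_mem' := fun r : R => ((r : IntermediateField.adjoin k S)).2 }
  have huuMR : (uu : Set K) ⊆ (MR : Set K) := by
    intro w hw
    obtain ⟨y, rfl⟩ := huuM' hw
    exact y.2
  have hTM' : ∀ x ∈ T, x ∈ IntermediateField.adjoin k S := fun x hx =>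
    (Algebra.adjoin_le huuMR : Algebra.adjoin R (uu : Set K) ≤ MR) hx
  have hR₂M : ∀ r : K, r ∈ locAtCentre A₂.toSubring O → r ∈ M := by
    intro r hr
    have hr' : r ∈ locAtCentre T O := (le_of_eq hR₂eq.symm) hr
    obtain ⟨y, hy, w, hw, -, rfl⟩ := mem_locAtCentre_iff.mp hr'
    exact (hM'M _).mp (div_mem (hTM' y hy) (hTM' w hw))
  -- ## assemble; per `f ∈ F`: `c_f`, `d_f` divide the monomial `u₂ ∏ z₂^α`, so `f = c_f / d_f` is a unit times a Laurent monomial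
  refine ⟨A₂, hA₂O, hA₂fg, hAp, hR₂M, hreg₂, z₂, hspan₂, hdimR₂, hz0, ?_⟩
  intro f hf
  have hsplit_c : xR = rc f * (g * rd f * ∏ f' ∈ F.erase f, (rc f' * rd f')) := by
    rw [hxRdef, ← Finset.mul_prod_erase F (fun f' => rc f' * rd f') hf]
    ring
  have hsplit_d : xR = rd f * (g * rc f * ∏ f' ∈ F.erase f, (rc f' * rd f')) := by
    rw [hxRdef, ← Finset.mul_prod_erase F (fun f' => rc f' * rd f') hf]
    ring
  have hdvd_c : ψ (rc f) ∣ ∏ i, z₂ i ^ α i :=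
    (hu₂.dvd_mul_left).mp ⟨ψ (g * rd f * ∏ f' ∈ F.erase f, (rc f' * rd f')), by rw [← map_mul, ← hsplit_c, hfact₂]⟩
  have hdvd_d : ψ (rd f) ∣ ∏ i, z₂ i ^ α i :=
    (hu₂.dvd_mul_left).mp ⟨ψ (g * rc f * ∏ f' ∈ F.erase f, (rc f' * rd f')), by rw [← map_mul, ← hsplit_d, hfact₂]⟩
  obtain ⟨c₁, β, hcβ⟩ := CossartPiltantMonomial.exists_eq_units_mul_prod_pow_of_dvd (fun i => hzr.prime i) α hdvd_c
  obtain ⟨c₂, γ, hdγ⟩ := CossartPiltantMonomial.exists_eq_units_mul_prod_pow_of_dvd (fun i => hzr.prime i) α hdvd_d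
  have hcK : cF f = ((c₁ : R₂) : K) * ∏ i, (z₂ i : K) ^ β i := by
    have h := congrArg (fun w : R₂ => (w : K)) hcβ
    simp only [hψK, hrc f hf] at h
    rw [h]
    push_cast
    rfl
  have hdK : dF f = ((c₂ : R₂) : K) * ∏ i, (z₂ i : K) ^ γ i := by
    have h := congrArg (fun w : R₂ => (w : K)) hdγ
    simp only [hψK, hrd f hf] at h
    rw [h]
    push_cast
    rfl
  let u' : R₂ := (c₁ * c₂⁻¹ : R₂ˣ)
  have hu' : IsUnit u' := Units.isUnit _
  let e : Fin 3 → ℤ := fun i => (β i : ℤ) - (γ i : ℤ)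
  have hc₂0 : ((c₂ : R₂) : K) ≠ 0 := fun h => by
    have : ((c₂ : R₂) : K) * ((↑(c₂⁻¹ : R₂ˣ) : R₂) : K) = 1 := by
      rw [← Subring.coe_mul, ← Units.val_mul, mul_inv_cancel, Units.val_one, Subring.coe_one]
    rw [h, zero_mul] at this
    exact zero_ne_one this
  have hu'K : (u' : K) = ((c₁ : R₂) : K) * (((c₂ : R₂) : K))⁻¹ := by
    have hinv : ((↑(c₂⁻¹ : R₂ˣ) : R₂) : K) = (((c₂ : R₂) : K))⁻¹ := by
      refine (eq_inv_of_mul_eq_one_right ?_)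
      rw [← Subring.coe_mul, ← Units.val_mul, mul_inv_cancel, Units.val_one, Subring.coe_one]
    change (((c₁ * c₂⁻¹ : R₂ˣ) : R₂) : K) = _
    rw [Units.val_mul, Subring.coe_mul, hinv]
  have hprod : (∏ i, (z₂ i : K) ^ (e i)) = (∏ i, (z₂ i : K) ^ β i) / ∏ i, (z₂ i : K) ^ γ i := by
    rw [← Finset.prod_div_distrib]
    refine Finset.prod_congr rfl fun i _ => ?_
    rw [zpow_sub₀ (hz0 i), zpow_natCast, zpow_natCast]
  refine ⟨(u' : K), e, u'.2, valuation_eq_one_of_isUnit_of_le O hR₂O hu', ?_⟩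
  calc f = cF f / dF f := hFeq f hf
    _ = (u' : K) * ∏ i, (z₂ i : K) ^ (e i) := by
        rw [hcK, hdK, hu'K, hprod, mul_div_mul_comm, div_eq_mul_inv]



open AlgebraicGeometry CategoryTheory in
/-- **PORT 2′ (monomialising model over `k₀ = k^p`).**  Port 2b VERBATIM over the field `k₀ := ↥(frobenius k p).fieldRange` (the
`k`-algebra `A` re-based to `k₀`, over which it is still finitely generated since `k = Σ_s k₀ b_s`), with the single patch of memo §10: the
twist-field identification uses ✓ `TwistModel.adjoin_twist_toSubfield_eq` (constants of `k₀` ARE `p`-th powers) instead of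
`…_of_perfectField`.  Output in `K`-terms: generators `G₂ ⊆ O`, the subring `C = k₀[G₂]`, `T := locAtCentre C O ⊆ M` with a regular
system of parameters `z` (spanning `𝔪_T`) monomialising `F`.  PROVED (= `port_monomialModel_core`, the Port 2b proof copied without
`PerfectField`, applied to the `k₀`-algebra `A`; consumes `hLU`, `hEmb`). [cite: CossartPiltant2019, Thm. 1.1; CossartJannsenSaito2020, Thm. 1.6.3 (F-32)] -/
theorem port_monomialModel' (p : ℕ) [Fact p.Prime] {k : Type} [Field k] [CharP k p]
    {K : Type} [Field K] [Algebra k K] (hLU : LocalUniformization3 ↥(frobenius k p).fieldRange)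
    (hEmb : ∀ (Z : Scheme.{0}) [IsIntegral Z] [IsNoetherian Z], Scheme.IsRegular Z →
      Scheme.IsExcellent Z → ∀ (X : Set Z), IsClosed X → X ≠ Set.univ → topologicalKrullDim X ≤ 2 →
        ∃ (Z' : Scheme.{0}) (π : Z' ⟶ Z), IsProper π ∧ Function.Surjective π.base ∧
          (∃ U : Z.Opens, (U : Set Z) = Xᶜ ∧ IsIso (π ∣_ U)) ∧
          IsStrictNormalCrossingsDivisor Z' (π.base ⁻¹' X))
    (O : ValuationSubring K) (A : Subalgebra k K)
    (hAO : A.toSubring ≤ O.toSubring) (hAfg : A.FG) [IsFractionRing A K] (hdimA : ringKrullDim A ≤ 3)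
    (hdim3 : ringKrullDim (locAtCentre A.toSubring O) = 3)
    (hzd : ∀ (T : Subring K) (hT : T ≤ O.toSubring), A.toSubring ≤ T → (subringCentre T O hT).IsMaximal)
    (g₀ : K) (M : Subfield K) (hM : ∀ x : K, x ∈ M ↔ ∃ c : Fin p → K, ∑ j, c j ^ p * g₀ ^ (j : ℕ) = x)
    {S : Type} [Fintype S] (b : S → k) (hb : IsPSpanningFamily p b)
    (F : Finset K) (hFM : ∀ f ∈ F, f ∈ M) (hF0 : ∀ f ∈ F, f ≠ 0) :
    ∃ (G₂ : Finset K) (C : Subring K), (∀ g ∈ G₂, g ∈ O) ∧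
      C = Subring.closure (Set.range (fun c : k => algebraMap k K c ^ p) ∪ (G₂ : Set K)) ∧
      (∀ a ∈ A, a ^ p ∈ C) ∧ (∀ r : K, r ∈ locAtCentre C O → r ∈ M) ∧
      ∃ (z : Fin 3 → K), (∀ i, z i ∈ locAtCentre C O) ∧ (∀ i, O.valuation (z i) < 1) ∧ (∀ i, z i ≠ 0) ∧
        (∀ r : K, r ∈ locAtCentre C O → O.valuation r < 1 →
          ∃ b : Fin 3 → K, (∀ i, b i ∈ locAtCentre C O) ∧ r = ∑ i, b i * z i) ∧
        ∀ f ∈ F, ∃ (ε : K) (e : Fin 3 → ℤ), ε ∈ locAtCentre C O ∧ O.valuation ε = 1 ∧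
          f = ε * ∏ i, z i ^ e i := by
  classical
  have hp : p.Prime := Fact.out
  haveI : CharP K p := charP_of_injective_algebraMap (algebraMap k K).injective p
  -- ## re-base `A` to the subfield `k₀ = k^p` (over which it is still finitely generated: `k = Σ_s k₀ b_s`)
  set k₀ : Subfield k := (frobenius k p).fieldRange with hk₀def
  letI : Algebra k₀ K := Algebra.compHom K k₀.subtype
  haveI inst1 := IsScalarTower.of_algebraMap_eq (R := k₀) (S := k) (A := K) (fun _ => rfl)
  have halg₀ : ∀ c : k₀, algebraMap k₀ K c = algebraMap k K (c : k) := fun _ => rfl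
  set B : S → K := fun s => algebraMap k K (b s) with hBdef
  let A₀ : Subalgebra k₀ K := A.restrictScalars k₀
  have hmemA₀ : ∀ x : K, x ∈ A₀ ↔ x ∈ A := fun _ => Subalgebra.mem_restrictScalars k₀
  obtain ⟨t, ht⟩ := hAfg
  set t₀ : Finset K := t ∪ Finset.univ.image B with ht₀def
  have hBt₀ : ∀ s, B s ∈ (t₀ : Set K) := fun s => by
    rw [ht₀def, Finset.coe_union]; exact Or.inr (Finset.mem_coe.mpr (Finset.mem_image_of_mem B (Finset.mem_univ s)))
  have htt₀ : ∀ y ∈ (t : Set K), y ∈ (t₀ : Set K) := fun y hy => by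
    rw [ht₀def, Finset.coe_union]; exact Or.inl hy
  have ht₀ : Algebra.adjoin k₀ (t₀ : Set K) = A₀ := by
    apply le_antisymm
    · refine Algebra.adjoin_le ?_
      intro x hx
      rw [ht₀def, Finset.coe_union] at hx
      rcases hx with hx | hx
      · exact (hmemA₀ _).mpr (by rw [← ht]; exact Algebra.subset_adjoin hx)
      · obtain ⟨s, -, rfl⟩ := Finset.mem_image.mp (Finset.mem_coe.mp hx)
        exact (hmemA₀ _).mpr (A.algebraMap_mem (b s))
    · intro x hx
      have hx' : x ∈ Algebra.adjoin k (t : Set K) := by rw [ht]; exact (hmemA₀ x).mp hx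
      have hBad : ∀ s, B s ∈ Algebra.adjoin k₀ (t₀ : Set K) := fun s => Algebra.subset_adjoin (hBt₀ s)
      clear hx
      induction hx' using Algebra.adjoin_induction with
      | mem y hy => exact Algebra.subset_adjoin (htt₀ y hy)
      | algebraMap c =>
        obtain ⟨d, hd⟩ := hb c
        rw [hd, map_sum]
        refine sum_mem fun i _ => ?_
        have hdi : algebraMap k K (d i ^ p) =
            algebraMap k₀ K ⟨d i ^ p, RingHom.mem_fieldRange.mpr ⟨d i, frobenius_def _ _⟩⟩ := by
          rw [halg₀]
        rw [map_mul, hdi]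
        exact mul_mem (Subalgebra.algebraMap_mem _ _) (hBad i)
      | add y z _ _ hy hz => exact add_mem hy hz
      | mul y z _ _ hy hz => exact mul_mem hy hz
  have hA₀fg : A₀.FG := ⟨t₀, ht₀⟩
  haveI hfr₀ : IsFractionRing A₀ K := ‹IsFractionRing A K›
  have hdimA₀ : ringKrullDim A₀ ≤ 3 := hdimA
  have hA₀O : A₀.toSubring ≤ O.toSubring := hAO
  have hdim3₀ : ringKrullDim (locAtCentre A₀.toSubring O) = 3 := hdim3
  have hzd₀ : ∀ (T : Subring K) (hT : T ≤ O.toSubring), A₀.toSubring ≤ T → (subringCentre T O hT).IsMaximal := hzd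
  -- ## the twist-field identification over `k₀` (memo §10 patch: constants of `k₀` ARE `p`-th powers in `K`)
  have htwist : ∀ g₁ : K, (IntermediateField.adjoin k₀ ((fun x : K => x ^ p) '' (t₀ : Set K) ∪ {g₁})).toSubfield =
      Subfield.closure (Set.range (frobenius K p) ∪ {g₁}) := by
    intro g₁
    rw [TwistModel.adjoin_twist_toSubfield_eq p A₀ (t₀ : Set K) ht₀ g₁]
    apply le_antisymm
    · apply Subfield.closure_le.mpr
      rintro x ((hx | hx) | hx)
      · obtain ⟨c, rfl⟩ := hx
        obtain ⟨d, hd⟩ := RingHom.mem_fieldRange.mp c.2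
        refine Subfield.subset_closure (Or.inl ⟨algebraMap k K d, ?_⟩)
        rw [frobenius_def, ← map_pow, ← frobenius_def, hd, halg₀]
      · exact Subfield.subset_closure (Or.inl hx)
      · exact Subfield.subset_closure (Or.inr hx)
    · exact Subfield.closure_mono (Set.union_subset_union_left _ Set.subset_union_right)
  -- ## the core (Port 2b) over `k₀`
  obtain ⟨A₂, hA₂O, hA₂fg, hAp, hR₂M, hreg₂, z₂, hspan₂, hdimR₂, hz0, hfac⟩ :=
    port_monomialModel_core p hLU hEmb O A₀ hA₀O hA₀fg hdimA₀ hdim3₀ hzd₀ t₀ ht₀ htwist g₀ M hM F hFM hF0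
  haveI := hreg₂
  -- ## conversion to `K`-terms
  obtain ⟨G₂, hG₂⟩ := hA₂fg
  have hC : A₂.toSubring = Subring.closure (Set.range (fun c : k => algebraMap k K c ^ p) ∪ (G₂ : Set K)) := by
    rw [← hG₂, Algebra.adjoin_eq_ring_closure]
    congr 1
    ext x
    simp only [Set.mem_union, Set.mem_range]
    constructor
    · rintro (⟨c, rfl⟩ | hx)
      · obtain ⟨d, hd⟩ := RingHom.mem_fieldRange.mp c.2
        refine Or.inl ⟨d, ?_⟩
        rw [← map_pow, ← frobenius_def, hd, halg₀]
      · exact Or.inr hx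
    · rintro (⟨c, rfl⟩ | hx)
      · refine Or.inl ⟨⟨c ^ p, RingHom.mem_fieldRange.mpr ⟨c, frobenius_def _ _⟩⟩, ?_⟩
        rw [halg₀, map_pow]
      · exact Or.inr hx
  have hG₂O : ∀ g ∈ G₂, g ∈ O := fun g hg =>
    hA₂O (show g ∈ A₂ by rw [← hG₂]; exact Algebra.subset_adjoin hg)
  have hApC : ∀ a ∈ A, a ^ p ∈ A₂.toSubring := fun a ha => hAp a ((hmemA₀ a).mpr ha)
  refine ⟨G₂, A₂.toSubring, hG₂O, hC, hApC, hR₂M, fun i => (z₂ i : K), fun i => (z₂ i).2, ?_, hz0, ?_, ?_⟩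
  · intro i
    have hi : z₂ i ∈ maximalIdeal _ := by rw [← hspan₂]; exact Ideal.subset_span ⟨i, rfl⟩
    exact (mem_maximalIdeal_locAtCentre_iff hA₂O _).mp hi
  · intro r hr hvr
    have hm : (⟨r, hr⟩ : locAtCentre A₂.toSubring O) ∈ maximalIdeal _ :=
      (mem_maximalIdeal_locAtCentre_iff hA₂O _).mpr hvr
    rw [← hspan₂, Ideal.mem_span_range_iff_exists_fun] at hm
    obtain ⟨b, hb⟩ := hm
    refine ⟨fun i => (b i : K), fun i => (b i).2, ?_⟩
    have h := congrArg (fun w : locAtCentre A₂.toSubring O => (w : K)) hb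
    simp only at h
    rw [← h]
    push_cast
    rfl
  · intro f hf
    obtain ⟨ε, e, hε, hεv, hfe⟩ := hfac f hf
    exact ⟨ε, e, hε, hεv, hfe⟩

/-! ## §F The base change `T⁺ = T ⊗_{k^p} k = Σ_s b_s T` is regular with the same parameters (RG) -/

/-- **Structure constants.**  The set `{Σ_s c_s B_s : c_s ∈ C}` (`B = b` read in `K`, `b` a `p`-spanning family of `k`, `C ⊇ (k)^p`) is
closed under multiplication: `B_s B_t = Σ_u d_u^p B_u` with `d_u^p ∈ C`. [folklore] -/
theorem span_family_mul {p : ℕ} {k K : Type} [Field k] [Field K] [Algebra k K] {S : Type} [Fintype S]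
    (b : S → k) (hb : IsPSpanningFamily p b) (C : Subring K) (hkC : ∀ c : k, algebraMap k K c ^ p ∈ C)
    {x y : K} (hx : ∃ c : S → K, (∀ i, c i ∈ C) ∧ x = ∑ i, c i * algebraMap k K (b i))
    (hy : ∃ c : S → K, (∀ i, c i ∈ C) ∧ y = ∑ i, c i * algebraMap k K (b i)) :
    ∃ c : S → K, (∀ i, c i ∈ C) ∧ x * y = ∑ i, c i * algebraMap k K (b i) := by
  classical
  obtain ⟨c, hcC, rfl⟩ := hx
  obtain ⟨c', hc'C, rfl⟩ := hy
  have he : ∀ i j : S, ∃ e : S → K, (∀ u, e u ∈ C) ∧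
      algebraMap k K (b i) * algebraMap k K (b j) = ∑ u, e u * algebraMap k K (b u) := by
    intro i j
    obtain ⟨d, hd⟩ := hb (b i * b j)
    refine ⟨fun u => algebraMap k K (d u) ^ p, fun u => hkC (d u), ?_⟩
    rw [← map_mul, hd, map_sum]
    simp only [map_mul, map_pow]
  choose e heC he using he
  refine ⟨fun u => ∑ i, ∑ j, c i * c' j * e i j u, fun u => ?_, ?_⟩
  · exact sum_mem fun i _ => sum_mem fun j _ => mul_mem (mul_mem (hcC i) (hc'C j)) (heC i j u)
  · rw [Finset.sum_mul_sum]
    have h1 : ∀ i j, c i * algebraMap k K (b i) * (c' j * algebraMap k K (b j)) =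
        ∑ u, c i * c' j * e i j u * algebraMap k K (b u) := by
      intro i j
      have : c i * algebraMap k K (b i) * (c' j * algebraMap k K (b j)) =
          c i * c' j * (algebraMap k K (b i) * algebraMap k K (b j)) := by ring
      rw [this, he i j, Finset.mul_sum]
      exact Finset.sum_congr rfl fun u _ => by ring
    have h2 : (∑ u, (∑ i, ∑ j, c i * c' j * e i j u) * algebraMap k K (b u)) =
        ∑ u, ∑ i, ∑ j, c i * c' j * e i j u * algebraMap k K (b u) := by
      refine Finset.sum_congr rfl fun u _ => ?_
      rw [Finset.sum_mul]
      exact Finset.sum_congr rfl fun i _ => Finset.sum_mul _ _ _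
    rw [h2]
    calc ∑ i, ∑ j, c i * algebraMap k K (b i) * (c' j * algebraMap k K (b j))
        = ∑ i, ∑ j, ∑ u, c i * c' j * e i j u * algebraMap k K (b u) :=
          Finset.sum_congr rfl fun i _ => Finset.sum_congr rfl fun j _ => h1 i j
      _ = ∑ i, ∑ u, ∑ j, c i * c' j * e i j u * algebraMap k K (b u) :=
          Finset.sum_congr rfl fun i _ => Finset.sum_comm
      _ = ∑ u, ∑ i, ∑ j, c i * c' j * e i j u * algebraMap k K (b u) := Finset.sum_comm

/-- **Base-change lemma.**  With `C = k^p[G₂]`, `T := locAtCentre C O ⊆ M` with parameters `z` spanning `𝔪_T`, and `A₂ := k[G₂]`: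
`T⁺ := locAtCentre A₂ O = Σ_s B_s T` (Frobenius: denominators have `p`-th powers in `C`), `𝔪_{T⁺} = (z) T⁺` (by RG: the graded
components of an element of value `< 1` have value `< 1`), `dim T⁺ = 3` (closed centre, ✓ `centre_closed_and_dim_three_of_pow_mem`),
hence `T⁺` is REGULAR with the same regular system of parameters.  PROVED. [folklore] -/
theorem basechange_model (p : ℕ) [Fact p.Prime] {k : Type} [Field k] [CharP k p] {K : Type} [Field K] [Algebra k K]
    (O : ValuationSubring K) (A : Subalgebra k K) (hAO : A.toSubring ≤ O.toSubring) (hAfg : A.FG) [IsFractionRing A K]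
    (hdimA : ringKrullDim A ≤ 3) (hdim3 : ringKrullDim (locAtCentre A.toSubring O) = 3)
    (hzd : ∀ (T : Subring K) (hT : T ≤ O.toSubring), A.toSubring ≤ T → (subringCentre T O hT).IsMaximal)
    (t : Finset K) (ht : Algebra.adjoin k (t : Set K) = A)
    (M : Subfield K) {S : Type} [Fintype S] (b : S → k) (hb : IsPSpanningFamily p b)
    (hRG : ∀ c : S → K, (∀ i, c i ∈ M) →
      O.valuation (∑ i : S, c i * algebraMap k K (b i)) = Finset.univ.sup (fun i => O.valuation (c i)))
    (G₂ : Finset K) (hG₂O : ∀ g ∈ G₂, g ∈ O) (C : Subring K)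
    (hC : C = Subring.closure (Set.range (fun c : k => algebraMap k K c ^ p) ∪ (G₂ : Set K)))
    (hApC : ∀ a ∈ A, a ^ p ∈ C) (hCM : ∀ r : K, r ∈ locAtCentre C O → r ∈ M)
    (z : Fin 3 → K) (hzC : ∀ i, z i ∈ locAtCentre C O) (hzv : ∀ i, O.valuation (z i) < 1)
    (hzspan : ∀ r : K, r ∈ locAtCentre C O → O.valuation r < 1 →
      ∃ b : Fin 3 → K, (∀ i, b i ∈ locAtCentre C O) ∧ r = ∑ i, b i * z i) :
    ∃ (A₂ : Subalgebra k K) (hA₂O : A₂.toSubring ≤ O.toSubring), A₂.FG ∧ (∀ a ∈ A, a ^ p ∈ A₂) ∧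
      C ≤ A₂.toSubring ∧
      (∀ r : K, r ∈ locAtCentre A₂.toSubring O →
        ∃ c : S → K, (∀ i, c i ∈ locAtCentre C O) ∧ r = ∑ i : S, c i * algebraMap k K (b i)) ∧
      ∃ (_ : IsRegularLocalRing (locAtCentre A₂.toSubring O)) (zT : Fin 3 → locAtCentre A₂.toSubring O),
        (∀ i, (zT i : K) = z i) ∧
        Ideal.span (Set.range zT) = IsLocalRing.maximalIdeal (locAtCentre A₂.toSubring O) ∧
        ringKrullDim (locAtCentre A₂.toSubring O) = 3 := by
  classical
  have hp : p.Prime := Fact.out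
  haveI : CharP K p := charP_of_injective_algebraMap (algebraMap k K).injective p
  have hk : ∀ c : k, algebraMap k K c ∈ O := fun c => hAO (A.algebraMap_mem c)
  have htA : ∀ a ∈ (t : Set K), a ∈ A := fun a ha => by rw [← ht]; exact Algebra.subset_adjoin ha
  set A₂ : Subalgebra k K := Algebra.adjoin k (G₂ : Set K) with hA₂def
  -- (a) `A₂ ⊆ O`, finitely generated, contains `C` (hence the `p`-th powers of `A`)
  let Oₖ : Subalgebra k K := { O.toSubring with algebraMap_mem' := fun c => hk c }
  have hA₂Ok : A₂ ≤ Oₖ := Algebra.adjoin_le (fun g hg => hG₂O g (Finset.mem_coe.mp hg))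
  have hA₂O : A₂.toSubring ≤ O.toSubring := fun x hx => hA₂Ok hx
  have hA₂fg : A₂.FG := ⟨G₂, rfl⟩
  have hCA₂ : C ≤ A₂.toSubring := by
    rw [hC, Subring.closure_le]
    rintro x (⟨c, rfl⟩ | hx)
    · exact A₂.pow_mem (A₂.algebraMap_mem c) p
    · exact Algebra.subset_adjoin hx
  have hApA₂ : ∀ a ∈ A, a ^ p ∈ A₂ := fun a ha => hCA₂ (hApC a ha)
  have hG₂C : ∀ g ∈ G₂, g ∈ C := fun g hg => by rw [hC]; exact Subring.subset_closure (Or.inr (Finset.mem_coe.mpr hg))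
  have hkC : ∀ c : k, algebraMap k K c ^ p ∈ C := fun c => by rw [hC]; exact Subring.subset_closure (Or.inl ⟨c, rfl⟩)
  -- (e1)+(e2) `A₂ = Σ_s C · B_s`: the `C`-span of the family is a subring containing `G₂` and the constants
  have hPC : ∀ x ∈ C, ∃ c : S → K, (∀ i, c i ∈ C) ∧ x = ∑ i, c i * algebraMap k K (b i) := by
    intro x hx
    obtain ⟨d, hd⟩ := hb 1
    refine ⟨fun u => x * algebraMap k K (d u) ^ p, fun u => mul_mem hx (hkC _), ?_⟩
    calc x = x * algebraMap k K 1 := by rw [map_one, mul_one]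
      _ = ∑ u, x * algebraMap k K (d u) ^ p * algebraMap k K (b u) := by
          rw [hd, map_sum, Finset.mul_sum]
          exact Finset.sum_congr rfl fun u _ => by rw [map_mul, map_pow]; ring
  have hPk : ∀ c₀ : k, ∃ c : S → K, (∀ i, c i ∈ C) ∧ algebraMap k K c₀ = ∑ i, c i * algebraMap k K (b i) := by
    intro c₀
    obtain ⟨d, hd⟩ := hb c₀
    refine ⟨fun u => algebraMap k K (d u) ^ p, fun u => hkC (d u), ?_⟩
    rw [hd, map_sum]
    simp only [map_mul, map_pow]
  have hrepr : ∀ x ∈ A₂, ∃ c : S → K, (∀ i, c i ∈ C) ∧ x = ∑ i : S, c i * algebraMap k K (b i) := by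
    intro x hx
    rw [hA₂def] at hx
    induction hx using Algebra.adjoin_induction with
    | mem x hx => exact hPC x (hG₂C x (Finset.mem_coe.mp hx))
    | algebraMap c => exact hPk c
    | add x y _ _ hx hy =>
      obtain ⟨c, hcC, rfl⟩ := hx
      obtain ⟨c', hc'C, rfl⟩ := hy
      refine ⟨c + c', fun i => add_mem (hcC i) (hc'C i), ?_⟩
      rw [← Finset.sum_add_distrib]
      exact Finset.sum_congr rfl fun i _ => by rw [Pi.add_apply, add_mul]
    | mul x y _ _ hx hy => exact span_family_mul b hb C hkC hx hy
  -- (e3) `T⁺ = Σ B_s · locAtCentre C O` (denominators have `p`-th powers in `C`)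
  have hfrobC : ∀ x ∈ A₂, x ^ p ∈ C := by
    intro x hx
    obtain ⟨c, hcC, rfl⟩ := hrepr x hx
    rw [sum_pow_char]
    exact sum_mem fun i _ => by
      rw [mul_pow]
      exact mul_mem (C.pow_mem (hcC i) p) (hkC (b i))
  have hTspan : ∀ r : K, r ∈ locAtCentre A₂.toSubring O →
      ∃ c : S → K, (∀ i, c i ∈ locAtCentre C O) ∧ r = ∑ i : S, c i * algebraMap k K (b i) := by
    intro r hr
    obtain ⟨y, hy, w, hw, hwv, rfl⟩ := mem_locAtCentre_iff.mp hr
    have hw0 : w ≠ 0 := ne_zero_of_valuation_eq_one hwv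
    have hywA₂ : y * w ^ (p - 1) ∈ A₂ := mul_mem hy (pow_mem hw _)
    obtain ⟨e, heC, he⟩ := hrepr _ hywA₂
    have hwpC : w ^ p ∈ C := hfrobC w hw
    have hwpv : O.valuation (w ^ p) = 1 := by rw [map_pow, hwv, one_pow]
    refine ⟨fun i => e i / w ^ p, fun i => mem_locAtCentre_iff.mpr ⟨e i, heC i, w ^ p, hwpC, hwpv, rfl⟩, ?_⟩
    have hp1 : w ^ p = w ^ (p - 1) * w := by rw [← pow_succ, Nat.sub_add_cancel hp.one_le]
    have key : y / w = (y * w ^ (p - 1)) / w ^ p := by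
      rw [hp1]
      field_simp
    rw [key, he, Finset.sum_div]
    exact Finset.sum_congr rfl fun i _ => by rw [mul_div_right_comm]
  -- (f) `T⁺`: local, Noetherian, `dim = 3`, `𝔪 = (z)`, regular
  haveI hTloc : IsLocalRing (locAtCentre A₂.toSubring O) := isLocalRing_locAtCentre hA₂O
  haveI : IsLocalization.AtPrime (locAtCentre A₂.toSubring O) (subringCentre A₂.toSubring O hA₂O) :=
    isLocalization_locAtCentre hA₂O
  letI : Algebra k A₂.toSubring := inferInstanceAs (Algebra k A₂)
  haveI : Algebra.FiniteType k A₂.toSubring := (A₂.fg_iff_finiteType.mp hA₂fg : Algebra.FiniteType k A₂)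
  haveI hTnoeth : IsNoetherianRing (locAtCentre A₂.toSubring O) :=
    IsLocalization.isNoetherianRing (subringCentre A₂.toSubring O hA₂O).primeCompl (locAtCentre A₂.toSubring O)
      (Algebra.FiniteType.isNoetherianRing k A₂.toSubring)
  have hdimAeq : ringKrullDim A = 3 := ringKrullDim_eq_three_of_locAtCentre O A hAO hdimA hdim3
  obtain ⟨-, -, hdimT⟩ := centre_closed_and_dim_three_of_pow_mem hp.pos O A hAO hAfg hdimAeq t ht hzd A₂ hA₂O hA₂fg
    (fun a ha => hApA₂ a (htA a ha))
  have hTT : locAtCentre C O ≤ locAtCentre A₂.toSubring O := locAtCentre_mono O hCA₂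
  set zT : Fin 3 → locAtCentre A₂.toSubring O := fun i => ⟨z i, hTT (hzC i)⟩ with hzTdef
  have hBA₂ : ∀ s, algebraMap k K (b s) ∈ A₂ := fun s => A₂.algebraMap_mem (b s)
  have hBT : ∀ s, algebraMap k K (b s) ∈ locAtCentre A₂.toSubring O := fun s => le_locAtCentre _ O (hBA₂ s)
  have hspan : Ideal.span (Set.range zT) = maximalIdeal (locAtCentre A₂.toSubring O) := by
    apply le_antisymm
    · rw [Ideal.span_le]
      rintro _ ⟨i, rfl⟩
      exact (mem_maximalIdeal_locAtCentre_iff hA₂O _).mpr (hzv i)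
    · intro r hr
      have hvr : O.valuation (r : K) < 1 := (mem_maximalIdeal_locAtCentre_iff hA₂O r).mp hr
      obtain ⟨c, hcT, hcr⟩ := hTspan _ r.2
      have hcM : ∀ i, c i ∈ M := fun i => hCM _ (hcT i)
      have hsup : Finset.univ.sup (fun i => O.valuation (c i)) < 1 := by rw [← hRG c hcM, ← hcr]; exact hvr
      have hci : ∀ i, O.valuation (c i) < 1 := fun i =>
        lt_of_le_of_lt (Finset.le_sup (f := fun i => O.valuation (c i)) (Finset.mem_univ i)) hsup
      choose bb hbbT hbb using fun i => hzspan (c i) (hcT i) (hci i)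
      have hrsum : r = ∑ i : S, ∑ j : Fin 3,
          ((⟨bb i j, hTT (hbbT i j)⟩ : locAtCentre A₂.toSubring O) * ⟨algebraMap k K (b i), hBT i⟩) * zT j := by
        apply Subtype.ext
        push_cast
        rw [hcr]
        refine Finset.sum_congr rfl fun i _ => ?_
        rw [hbb i, Finset.sum_mul]
        refine Finset.sum_congr rfl fun j _ => ?_
        simp only [hzTdef]
        ring
      rw [hrsum]
      exact Ideal.sum_mem _ fun i _ => Ideal.sum_mem _ fun j _ => Ideal.mul_mem_left _ _ (Ideal.subset_span ⟨j, rfl⟩)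
  have hdimT3 : ringKrullDim (locAtCentre A₂.toSubring O) = ((3 : ℕ) : WithBot ℕ∞) := by rw [hdimT]; norm_cast
  have hreg : IsRegularLocalRing (locAtCentre A₂.toSubring O) := by
    refine IsRegularLocalRing.of_spanFinrank_maximalIdeal_le _ ?_
    rw [hdimT3, ← hspan]
    have hgen : (Ideal.span (Set.range zT)).spanFinrank ≤ 3 := by
      refine (Submodule.spanFinrank_span_le_ncard_of_finite (Set.finite_range _)).trans ?_
      rw [← Set.image_univ]
      refine (Set.ncard_image_le Set.finite_univ).trans ?_
      rw [Set.ncard_univ, Nat.card_eq_fintype_card, Fintype.card_fin]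
    exact_mod_cast hgen
  exact ⟨A₂, hA₂O, hA₂fg, hApA₂, hCA₂, hTspan, hreg, zT, fun i => rfl, hspan, hdimT⟩

/-! ## §G PORT 4′ — the regular chart algebra and a regular parameter in `M` by graded descent -/

/-- **PORT 4′ (regular parameter in the twist field, imperfect base).**  Port 4b with the hypothesis `hA₂M : T ⊆ M` REPLACED by the
graded structure `T⁺ = Σ_s B_s T₀` (`hTspan`, `T₀ ⊆ M`) and RG; same conclusion.  Proof = Port 4b (a)–(e) verbatim, then the
new tail (f)″: the regular parameter `ψ = Π(u_{≥ρ}) ∈ T⁺[u]` has graded components `ψ_i ∈ T₀[u_{≥ρ}] ⊆ S ∩ M`; `v(ψ) = max v(ψ_i) < 1`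
puts every `ψ_i` in `𝔪_S`, and `ψ ∉ 𝔪_S²` forces some `ψ_i ∉ 𝔪_S²`.  PROVED. [folklore] -/
theorem port_regularParameter' (p : ℕ) [Fact p.Prime] {k : Type} [Field k] [CharP k p]
    {K : Type} [Field K] [Algebra k K] (O : ValuationSubring K) (A : Subalgebra k K)
    (hAO : A.toSubring ≤ O.toSubring) (hAfg : A.FG) [IsFractionRing A K] (hdimA : ringKrullDim A ≤ 3)
    (hdim3 : ringKrullDim (locAtCentre A.toSubring O) = 3)
    (hzd : ∀ (T : Subring K) (hT : T ≤ O.toSubring), A.toSubring ≤ T → (subringCentre T O hT).IsMaximal)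
    (M : Subfield K) (A₂ : Subalgebra k K) (hA₂O : A₂.toSubring ≤ O.toSubring) (hA₂fg : A₂.FG)
    (hApA₂ : ∀ a ∈ A, a ^ p ∈ A₂)
    {S : Type} [Fintype S] (b : S → k) (T₀ : Subring K) (hT₀M : ∀ r : K, r ∈ T₀ → r ∈ M)
    (hT₀S : T₀ ≤ locAtCentre A₂.toSubring O)
    (hTspan : ∀ r : K, r ∈ locAtCentre A₂.toSubring O →
      ∃ c : S → K, (∀ i, c i ∈ T₀) ∧ r = ∑ i : S, c i * algebraMap k K (b i))
    (hRG : ∀ c : S → K, (∀ i, c i ∈ M) →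
      O.valuation (∑ i : S, c i * algebraMap k K (b i)) = Finset.univ.sup (fun i => O.valuation (c i)))
    (hreg₂ : IsRegularLocalRing (locAtCentre A₂.toSubring O)) (z : Fin 3 → locAtCentre A₂.toSubring O)
    (hz : Ideal.span (Set.range z) = IsLocalRing.maximalIdeal (locAtCentre A₂.toSubring O))
    (hdimT : ringKrullDim (locAtCentre A₂.toSubring O) = 3)
    (t : Finset K) (ht : Algebra.adjoin k (t : Set K) = A)
    (ρ : ℕ) (hρ : ρ = 1 ∨ ρ = 2) (u : Fin 3 → K) (hu0 : ∀ j, u j ≠ 0)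
    (hupos : ∀ j : Fin 3, (j : ℕ) < ρ → O.valuation (u j) < 1)
    (huzero : ∀ j : Fin 3, ρ ≤ (j : ℕ) → O.valuation (u j) = 1)
    (huM : ∀ j : Fin 3, ρ ≤ (j : ℕ) → u j ∈ M)
    (hzu : ∀ i : Fin 3, ∃ (ε : K) (d : Fin 3 → ℤ), ε ∈ locAtCentre A₂.toSubring O ∧ O.valuation ε = 1 ∧
      (∀ j : Fin 3, (j : ℕ) < ρ → 0 ≤ d j) ∧ (∃ j : Fin 3, (j : ℕ) < ρ ∧ 0 < d j) ∧ ((z i : K)) = ε * ∏ j, u j ^ d j)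
    {ι : Type} [Fintype ι]
    (htu : ∀ a ∈ t, ∃ (ν : ι → K) (d : ι → Fin 3 → ℤ),
      (∀ l, ν l = 0 ∨ (ν l ∈ locAtCentre A₂.toSubring O ∧ O.valuation (ν l) = 1)) ∧
      (∀ l, ∀ j : Fin 3, (j : ℕ) < ρ → 0 ≤ d l j) ∧ a = ∑ l, ν l * ∏ j, u j ^ d l j) :
    ∃ (A'' : Subalgebra k K), A''.toSubring ≤ O.toSubring ∧ A ≤ A'' ∧ A''.FG ∧
      ∃ (_ : IsRegularLocalRing (locAtCentre A''.toSubring O)) (ψ : locAtCentre A''.toSubring O),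
        ψ ∈ IsLocalRing.maximalIdeal (locAtCentre A''.toSubring O) ∧
        ψ ∉ (IsLocalRing.maximalIdeal (locAtCentre A''.toSubring O)) ^ 2 ∧ (ψ : K) ∈ M := by
  classical
  /- (rev 4, res-B-lens-5 g10) PORT 4 PROVED — memo §13 (a)–(f) with ONE simplification: the maximality of `𝔫` (§13 (c1), Zariski) is
  not needed; `P := κ_T[U]_𝔫` at the PRIME `𝔫 = F⁻¹(𝔪)` is a regular local domain whose dimension is pinned to `3 - ρ` by the surjection
  `P ↠ S⧸𝔞` and Krull (`localization_mvPolynomial_regular_of_surjective`). -/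
  have hρ3 : ρ ≤ 3 := by rcases hρ with rfl | rfl <;> norm_num
  obtain ⟨gens₂, hgens₂⟩ := hA₂fg
  have hk : ∀ c : k, algebraMap k K c ∈ A₂ := fun c => A₂.algebraMap_mem c
  have hgensA₂ : ∀ g ∈ gens₂, g ∈ A₂ := fun g hg => by
    rw [← hgens₂]; exact Algebra.subset_adjoin (Finset.mem_coe.mpr hg)
  have htA : ∀ a ∈ t, a ∈ A := fun a ha => by
    rw [← ht]; exact Algebra.subset_adjoin (Finset.mem_coe.mpr ha)
  have huO : ∀ j, u j ∈ O := fun j => (O.valuation_le_one_iff _).mp (by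
    by_cases hj : (j : ℕ) < ρ
    · exact (hupos j hj).le
    · exact (huzero j (not_lt.mp hj)).le)
  have huinvO : ∀ j : Fin 3, ρ ≤ (j : ℕ) → (u j)⁻¹ ∈ O := fun j hj =>
    (O.valuation_le_one_iff _).mp (by rw [map_inv₀, huzero j hj, inv_one])
  -- §13 (a): the chart algebra `A'' = k[gens A₂, u, u_{≥ρ}⁻¹, t]` and its local ring `S = locAtCentre A'' O`
  set Z : Finset (Fin 3) := Finset.univ.filter (fun j => ρ ≤ (j : ℕ)) with hZdef
  have hZ : ∀ j : Fin 3, j ∈ Z ↔ ρ ≤ (j : ℕ) := fun j => by simp [hZdef]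
  set G : Finset K := gens₂ ∪ Finset.univ.image u ∪ Z.image (fun j => (u j)⁻¹) ∪ t with hGdef
  have hGgens : ∀ g ∈ gens₂, g ∈ G := fun g hg => by
    rw [hGdef]; exact Finset.mem_union_left _ (Finset.mem_union_left _ (Finset.mem_union_left _ hg))
  have hGu : ∀ j, u j ∈ G := fun j => by
    rw [hGdef]
    exact Finset.mem_union_left _ (Finset.mem_union_left _ (Finset.mem_union_right _
      (Finset.mem_image.mpr ⟨j, Finset.mem_univ _, rfl⟩)))
  have hGuinv : ∀ j : Fin 3, ρ ≤ (j : ℕ) → (u j)⁻¹ ∈ G := fun j hj => by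
    rw [hGdef]
    exact Finset.mem_union_left _ (Finset.mem_union_right _ (Finset.mem_image.mpr ⟨j, (hZ j).mpr hj, rfl⟩))
  have hGt : ∀ a ∈ t, a ∈ G := fun a ha => by rw [hGdef]; exact Finset.mem_union_right _ ha
  have hGcases : ∀ x ∈ G, x ∈ gens₂ ∨ (∃ j, x = u j) ∨ (∃ j : Fin 3, ρ ≤ (j : ℕ) ∧ x = (u j)⁻¹) ∨ x ∈ t := by
    intro x hx
    rw [hGdef] at hx
    rcases Finset.mem_union.mp hx with hx | hx
    · rcases Finset.mem_union.mp hx with hx | hx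
      · rcases Finset.mem_union.mp hx with hx | hx
        · exact Or.inl hx
        · obtain ⟨j, -, rfl⟩ := Finset.mem_image.mp hx
          exact Or.inr (Or.inl ⟨j, rfl⟩)
      · obtain ⟨j, hj, rfl⟩ := Finset.mem_image.mp hx
        exact Or.inr (Or.inr (Or.inl ⟨j, (hZ j).mp hj, rfl⟩))
    · exact Or.inr (Or.inr (Or.inr hx))
  set A'' : Subalgebra k K := Algebra.adjoin k (G : Set K) with hA''def
  have hGA'' : ∀ x ∈ G, x ∈ A'' := fun x hx => Algebra.subset_adjoin (Finset.mem_coe.mpr hx)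
  let Oₖ : Subalgebra k K :=
    { O.toSubring with algebraMap_mem' := fun c => hA₂O (A₂.algebraMap_mem c) }
  have hGO : (G : Set K) ⊆ (Oₖ : Set K) := by
    intro x hx
    change x ∈ O
    rcases hGcases x (Finset.mem_coe.mp hx) with hx | ⟨j, rfl⟩ | ⟨j, hj, rfl⟩ | hx
    · exact hA₂O (hgensA₂ x hx)
    · exact huO j
    · exact huinvO j hj
    · exact hAO (htA x hx)
  have hA''O : A''.toSubring ≤ O.toSubring := fun x hx => (Algebra.adjoin_le hGO : A'' ≤ Oₖ) hx
  have hAA'' : A ≤ A'' := by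
    rw [← ht]; exact Algebra.adjoin_le fun x hx => hGA'' x (hGt x (Finset.mem_coe.mp hx))
  have hA₂A'' : A₂ ≤ A'' := by
    rw [← hgens₂]; exact Algebra.adjoin_le fun x hx => hGA'' x (hGgens x (Finset.mem_coe.mp hx))
  have hA''fg : A''.FG := ⟨G, hA''def.symm⟩
  have huA'' : ∀ j, u j ∈ A'' := fun j => hGA'' _ (hGu j)
  have huS : ∀ j, u j ∈ locAtCentre A''.toSubring O := fun j => le_locAtCentre _ O (huA'' j)
  have hTS : locAtCentre A₂.toSubring O ≤ locAtCentre A''.toSubring O := locAtCentre_mono O (fun x hx => hA₂A'' hx)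
  haveI hSloc : IsLocalRing (locAtCentre A''.toSubring O) := isLocalRing_locAtCentre hA''O
  haveI : IsLocalization.AtPrime (locAtCentre A''.toSubring O) (subringCentre A''.toSubring O hA''O) :=
    isLocalization_locAtCentre hA''O
  letI : Algebra k A''.toSubring := inferInstanceAs (Algebra k A'')
  haveI : Algebra.FiniteType k A''.toSubring := (A''.fg_iff_finiteType.mp hA''fg : Algebra.FiniteType k A'')
  haveI hSnoeth : IsNoetherianRing (locAtCentre A''.toSubring O) :=
    IsLocalization.isNoetherianRing (subringCentre A''.toSubring O hA''O).primeCompl (locAtCentre A''.toSubring O)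
      (Algebra.FiniteType.isNoetherianRing k A''.toSubring)
  -- `dim S = 3`: the centre is closed (hzd) and `dim A'' = dim A = 3`
  have hdimAeq : ringKrullDim A = 3 := ringKrullDim_eq_three_of_locAtCentre O A hAO hdimA hdim3
  have hdimA'' : ringKrullDim A'' = 3 := by
    rw [Summit.ResolutionOfSingularities.ResolutionOfSingularities.Theorems.RadicialJung.CleanModels.ringKrullDim_eq_of_fg_of_le
      hAfg hA''fg hAA'', hdimAeq]
  have hmaxS : (subringCentre A''.toSubring O hA''O).IsMaximal := hzd A''.toSubring hA''O (fun x hx => hAA'' hx)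
  have hdimS : ringKrullDim (locAtCentre A''.toSubring O) = 3 := by
    rw [Summit.ResolutionOfSingularities.ResolutionOfSingularities.Theorems.RadicialJung.CleanModels.ringKrullDim_locAtCentre_eq_of_isMaximal
      A'' hA''fg O hA''O hmaxS, hdimA'']
  have hdimS3 : ringKrullDim (locAtCentre A''.toSubring O) = ((3 : ℕ) : WithBot ℕ∞) := by rw [hdimS]; norm_cast
  -- §13 (b): `𝔞 := (u_{<ρ})` contains `𝔪_T · S`
  set uS : Fin 3 → locAtCentre A''.toSubring O := fun j => ⟨u j, huS j⟩ with huSdef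
  set uρ : Fin ρ → locAtCentre A''.toSubring O := fun i => uS (Fin.castLE hρ3 i) with huρdef
  have huρ : ∀ i, uρ i ∈ maximalIdeal (locAtCentre A''.toSubring O) := fun i =>
    (mem_maximalIdeal_locAtCentre_iff hA''O _).mpr (hupos (Fin.castLE hρ3 i) (by simp))
  have huS𝔞 : ∀ j : Fin 3, (j : ℕ) < ρ → uS j ∈ Ideal.span (Set.range uρ) := fun j hj =>
    Ideal.subset_span ⟨⟨j, hj⟩, congrArg uS (Fin.ext rfl)⟩
  set ι : locAtCentre A₂.toSubring O →+* locAtCentre A''.toSubring O := Subring.inclusion hTS with hιdef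
  have hιval : ∀ a, ((ι a : locAtCentre A''.toSubring O) : K) = a := fun a => rfl
  have hzS : ∀ i : Fin 3, ι (z i) ∈ Ideal.span (Set.range uρ) := by
    intro i
    obtain ⟨ε, d, hεT, hεv, hdnn, ⟨j₀, hj₀, hdj₀⟩, hzi⟩ := hzu i
    set d' : Fin 3 → ℤ := Function.update d j₀ (d j₀ - 1) with hd'def
    have hd'j₀ : d' j₀ = d j₀ - 1 := by rw [hd'def, Function.update_self]
    have hd'ne : ∀ j, j ≠ j₀ → d' j = d j := fun j hj => by rw [hd'def, Function.update_of_ne hj]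
    have hd'nn : ∀ j : Fin 3, (j : ℕ) < ρ → 0 ≤ d' j := by
      intro j hj
      by_cases hjj : j = j₀
      · rw [hjj, hd'j₀]; omega
      · rw [hd'ne j hjj]; exact hdnn j hj
    have hw'mem : ε * ∏ j, u j ^ d' j ∈ locAtCentre A''.toSubring O := by
      refine mul_mem (hTS hεT) (prod_mem fun j _ => ?_)
      by_cases hj : (j : ℕ) < ρ
      · exact zpow_mem_of_nonneg (huS j) (hd'nn j hj)
      · exact zpow_mem_of_inv_mem (huS j) (inv_mem_locAtCentre (huS j) (huzero j (not_lt.mp hj))) (d' j)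
    have he : ∏ j ∈ Finset.univ.erase j₀, u j ^ d' j = ∏ j ∈ Finset.univ.erase j₀, u j ^ d j :=
      Finset.prod_congr rfl fun j hj => by rw [hd'ne j (Finset.ne_of_mem_erase hj)]
    have hsplit : ε * ∏ j, u j ^ d j = (ε * ∏ j, u j ^ d' j) * u j₀ := by
      rw [← Finset.mul_prod_erase Finset.univ (fun j => u j ^ d j) (Finset.mem_univ j₀),
        ← Finset.mul_prod_erase Finset.univ (fun j => u j ^ d' j) (Finset.mem_univ j₀)]
      show ε * (u j₀ ^ d j₀ * ∏ j ∈ Finset.univ.erase j₀, u j ^ d j) =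
        ε * (u j₀ ^ d' j₀ * ∏ j ∈ Finset.univ.erase j₀, u j ^ d' j) * u j₀
      rw [he, hd'j₀, zpow_sub_one₀ (hu0 j₀)]
      have h0 : (u j₀)⁻¹ * u j₀ = 1 := inv_mul_cancel₀ (hu0 j₀)
      calc ε * (u j₀ ^ d j₀ * ∏ j ∈ Finset.univ.erase j₀, u j ^ d j)
          = ε * (u j₀ ^ d j₀ * ((u j₀)⁻¹ * u j₀) * ∏ j ∈ Finset.univ.erase j₀, u j ^ d j) := by rw [h0, mul_one]
        _ = ε * (u j₀ ^ d j₀ * (u j₀)⁻¹ * ∏ j ∈ Finset.univ.erase j₀, u j ^ d j) * u j₀ := by ring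
    have hιz : ι (z i) = ⟨ε * ∏ j, u j ^ d' j, hw'mem⟩ * uS j₀ := by
      apply Subtype.ext
      show ((z i : K)) = (ε * ∏ j, u j ^ d' j) * u j₀
      rw [hzi, hsplit]
    rw [hιz]
    exact Ideal.mul_mem_left _ _ (huS𝔞 j₀ hj₀)
  -- §13 (c): `E := S ⧸ 𝔞` is local; `F₁ : κ_T → E` (`𝔪_T ↦ 0`), `F : κ_T[U_{≥ρ}] → E`, `𝔫 := F⁻¹ 𝔪_E`, `P := κ_T[U]_𝔫`
  have h𝔞m : Ideal.span (Set.range uρ) ≤ maximalIdeal (locAtCentre A''.toSubring O) := by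
    rw [Ideal.span_le]; rintro _ ⟨i, rfl⟩; exact huρ i
  have h𝔞top : Ideal.span (Set.range uρ) ≠ ⊤ := fun h =>
    (maximalIdeal.isMaximal (locAtCentre A''.toSubring O)).ne_top (top_le_iff.mp (h ▸ h𝔞m))
  haveI : Nontrivial (locAtCentre A''.toSubring O ⧸ Ideal.span (Set.range uρ)) :=
    Ideal.Quotient.nontrivial_iff.mpr h𝔞top
  haveI : IsLocalRing (locAtCentre A''.toSubring O ⧸ Ideal.span (Set.range uρ)) :=
    IsLocalRing.of_surjective' (Ideal.Quotient.mk _) Ideal.Quotient.mk_surjective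
  have hkill : ∀ a ∈ maximalIdeal (locAtCentre A₂.toSubring O),
      ((Ideal.Quotient.mk (Ideal.span (Set.range uρ))).comp ι) a = 0 := by
    have hmap : (maximalIdeal (locAtCentre A₂.toSubring O)).map ι ≤ Ideal.span (Set.range uρ) := by
      rw [← hz, Ideal.map_span, Ideal.span_le]
      rintro _ ⟨_, ⟨i, rfl⟩, rfl⟩
      exact hzS i
    intro a ha
    rw [RingHom.comp_apply, Ideal.Quotient.eq_zero_iff_mem]
    exact hmap (Ideal.mem_map_of_mem ι ha)
  set F₁ : ResidueField (locAtCentre A₂.toSubring O) →+* (locAtCentre A''.toSubring O ⧸ Ideal.span (Set.range uρ)) :=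
    Ideal.Quotient.lift (maximalIdeal (locAtCentre A₂.toSubring O))
      ((Ideal.Quotient.mk (Ideal.span (Set.range uρ))).comp ι) hkill with hF₁def
  have hF₁ : ∀ a, F₁ (residue _ a) = Ideal.Quotient.mk _ (ι a) := fun a => by
    rw [hF₁def]; exact Ideal.Quotient.lift_mk _ _ _
  set zI : Fin (3 - ρ) → Fin 3 := fun i => ⟨ρ + (i : ℕ), by have := i.2; omega⟩ with hzIdef
  have hzIval : ∀ i, ((zI i : Fin 3) : ℕ) = ρ + (i : ℕ) := fun i => rfl
  have hzIρ : ∀ i, ρ ≤ ((zI i : Fin 3) : ℕ) := fun i => by rw [hzIval]; omega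
  set F : MvPolynomial (Fin (3 - ρ)) (ResidueField (locAtCentre A₂.toSubring O)) →+*
      (locAtCentre A''.toSubring O ⧸ Ideal.span (Set.range uρ)) :=
    MvPolynomial.eval₂Hom F₁ (fun i => Ideal.Quotient.mk (Ideal.span (Set.range uρ)) (uS (zI i))) with hFdef
  have hFC : ∀ r, F (MvPolynomial.C r) = F₁ r := fun r => by rw [hFdef]; exact MvPolynomial.eval₂Hom_C _ _ r
  have hFX : ∀ i, F (MvPolynomial.X i) = Ideal.Quotient.mk (Ideal.span (Set.range uρ)) (uS (zI i)) := fun i => by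
    rw [hFdef]; exact MvPolynomial.eval₂Hom_X' _ _ i
  set 𝔫 : Ideal (MvPolynomial (Fin (3 - ρ)) (ResidueField (locAtCentre A₂.toSubring O))) :=
    (maximalIdeal (locAtCentre A''.toSubring O ⧸ Ideal.span (Set.range uρ))).comap F with h𝔫def
  haveI h𝔫prime : 𝔫.IsPrime := Ideal.IsPrime.comap F
  obtain ⟨hunit, h𝔫u⟩ := primeCompl_comap_maximalIdeal F
  -- the normal form on `A''`: `R₀ := T[u] ⊆ S`, `w := ∏_{j ≥ ρ} u_j`, every `x ∈ A''` has `x · w^N ∈ R₀`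
  set R₀ : Subring K := Subring.closure ((locAtCentre A₂.toSubring O : Set K) ∪ Set.range u) with hR₀def
  have hTR₀ : ∀ x ∈ locAtCentre A₂.toSubring O, x ∈ R₀ := fun x hx => by
    rw [hR₀def]; exact Subring.subset_closure (Or.inl hx)
  have huR₀ : ∀ j, u j ∈ R₀ := fun j => by rw [hR₀def]; exact Subring.subset_closure (Or.inr ⟨j, rfl⟩)
  have hR₀S : R₀ ≤ locAtCentre A''.toSubring O := by
    rw [hR₀def, Subring.closure_le]
    rintro x (hx | ⟨j, rfl⟩)
    · exact hTS hx
    · exact huS j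
  set w : K := ∏ j ∈ Z, u j with hwdef
  have hwv : O.valuation w = 1 := by
    rw [hwdef, map_prod]; exact Finset.prod_eq_one fun j hj => huzero j ((hZ j).mp hj)
  have hwR₀ : w ∈ R₀ := by rw [hwdef]; exact prod_mem fun j _ => huR₀ j
  have huinv : ∀ j ∈ Z, NF R₀ w (u j)⁻¹ := by
    intro j hj
    refine ⟨1, ?_⟩
    rw [pow_one, hwdef, ← Finset.mul_prod_erase Z u hj, inv_mul_cancel_left₀ (hu0 j)]
    exact prod_mem fun i _ => huR₀ i
  have hNF : ∀ x ∈ A'', NF R₀ w x := by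
    intro x hx
    rw [hA''def] at hx
    induction hx using Algebra.adjoin_induction with
    | mem x hx =>
      rcases hGcases x (Finset.mem_coe.mp hx) with hx | ⟨j, rfl⟩ | ⟨j, hj, rfl⟩ | hx
      · exact NF.of_mem (hTR₀ x (le_locAtCentre _ O (hgensA₂ x hx)))
      · exact NF.of_mem (huR₀ j)
      · exact huinv j ((hZ j).mpr hj)
      · obtain ⟨ν, d, hν, hd, rfl⟩ := htu x hx
        refine NF.sum _ _ hwR₀ fun l _ => NF.mul ?_ (NF.prod _ _ fun j _ => ?_)
        · rcases hν l with h0 | ⟨hνT, -⟩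
          · rw [h0]; exact NF.zero
          · exact NF.of_mem (hTR₀ _ hνT)
        · by_cases hj : (j : ℕ) < ρ
          · exact (NF.of_mem (huR₀ j)).zpow_of_nonneg (hd l j hj)
          · exact (NF.of_mem (huR₀ j)).zpow (huinv j ((hZ j).mpr (not_lt.mp hj))) (d l j)
    | algebraMap c => exact NF.of_mem (hTR₀ _ (le_locAtCentre _ O (hk c)))
    | add x y hx hy ihx ihy => exact ihx.add hwR₀ ihy
    | mul x y hx hy ihx ihy => exact ihx.mul ihy
  -- (c2) normal form of the fractions `s = y / x ∈ S` and the preimages under `F`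
  have hloc : ∀ s : locAtCentre A''.toSubring O, ∃ b c : locAtCentre A''.toSubring O,
      b ∈ {s : locAtCentre A''.toSubring O | (s : K) ∈ R₀} ∧ c ∈ {s : locAtCentre A''.toSubring O | (s : K) ∈ R₀} ∧
      IsUnit (Ideal.Quotient.mk (Ideal.span (Set.range uρ)) c) ∧ s * c - b ∈ Ideal.span (Set.range uρ) := by
    intro s
    obtain ⟨y, hy, x, hx, hxv, hs⟩ := (mem_locAtCentre_iff).mp s.2
    obtain ⟨N₁, hN₁⟩ := hNF y hy
    obtain ⟨N₂, hN₂⟩ := hNF x hx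
    have hb : y * w ^ N₁ * w ^ N₂ ∈ R₀ := R₀.mul_mem hN₁ (R₀.pow_mem hwR₀ N₂)
    have hc : x * w ^ N₂ * w ^ N₁ ∈ R₀ := R₀.mul_mem hN₂ (R₀.pow_mem hwR₀ N₁)
    refine ⟨⟨_, hR₀S hb⟩, ⟨_, hR₀S hc⟩, hb, hc, ?_, ?_⟩
    · refine IsUnit.map _ (notMem_maximalIdeal.mp fun hm => ?_)
      have hlt : O.valuation (x * w ^ N₂ * w ^ N₁) < 1 := (mem_maximalIdeal_locAtCentre_iff hA''O _).mp hm
      rw [map_mul, map_mul, map_pow, map_pow, hxv, hwv, one_pow, one_pow, mul_one, mul_one] at hlt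
      exact lt_irrefl _ hlt
    · have h0 : x ≠ 0 := ne_zero_of_valuation_eq_one hxv
      have hzero : s * ⟨_, hR₀S hc⟩ - ⟨_, hR₀S hb⟩ = (0 : locAtCentre A''.toSubring O) := by
        apply Subtype.ext
        show (s : K) * (x * w ^ N₂ * w ^ N₁) - y * w ^ N₁ * w ^ N₂ = 0
        rw [hs, sub_eq_zero]
        calc y / x * (x * w ^ N₂ * w ^ N₁) = (y / x * x) * (w ^ N₂ * w ^ N₁) := by ring
          _ = y * w ^ N₁ * w ^ N₂ := by rw [div_mul_cancel₀ y h0]; ring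
      rw [hzero]; exact Ideal.zero_mem _
  have hF : ∀ b ∈ {s : locAtCentre A''.toSubring O | (s : K) ∈ R₀},
      Ideal.Quotient.mk (Ideal.span (Set.range uρ)) b ∈ F.range := by
    have key : ∀ x ∈ R₀, ∃ hx : x ∈ locAtCentre A''.toSubring O,
        Ideal.Quotient.mk (Ideal.span (Set.range uρ)) ⟨x, hx⟩ ∈ F.range := by
      intro x hx
      rw [hR₀def] at hx
      induction hx using Subring.closure_induction with
      | mem x hx =>
        rcases hx with hx | ⟨j, rfl⟩
        · refine ⟨hTS hx, RingHom.mem_range.mpr ⟨MvPolynomial.C (residue _ ⟨x, hx⟩), ?_⟩⟩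
          rw [hFC, hF₁]
          rfl
        · by_cases hj : (j : ℕ) < ρ
          · refine ⟨huS j, RingHom.mem_range.mpr ⟨0, ?_⟩⟩
            rw [map_zero]
            exact (Ideal.Quotient.eq_zero_iff_mem.mpr (huS𝔞 j hj)).symm
          · have hj3 : (j : ℕ) - ρ < 3 - ρ := by have := j.2; omega
            refine ⟨huS j, RingHom.mem_range.mpr ⟨MvPolynomial.X ⟨(j : ℕ) - ρ, hj3⟩, ?_⟩⟩
            rw [hFX]
            have hjj : zI ⟨(j : ℕ) - ρ, hj3⟩ = j := Fin.ext (by rw [hzIval]; simp only; omega)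
            rw [hjj]
      | zero => exact ⟨Subring.zero_mem _, RingHom.mem_range.mpr ⟨0, by rw [map_zero]; exact (map_zero _).symm⟩⟩
      | one => exact ⟨Subring.one_mem _, RingHom.mem_range.mpr ⟨1, by rw [map_one]; exact (map_one _).symm⟩⟩
      | add x y hx hy ihx ihy =>
        obtain ⟨hxS, hx'⟩ := ihx
        obtain ⟨hyS, hy'⟩ := ihy
        obtain ⟨qx, hqx⟩ := RingHom.mem_range.mp hx'
        obtain ⟨qy, hqy⟩ := RingHom.mem_range.mp hy'
        exact ⟨add_mem hxS hyS, RingHom.mem_range.mpr ⟨qx + qy, by rw [map_add, hqx, hqy, ← map_add]; rfl⟩⟩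
      | neg x hx ih =>
        obtain ⟨hxS, hx'⟩ := ih
        obtain ⟨qx, hqx⟩ := RingHom.mem_range.mp hx'
        exact ⟨neg_mem hxS, RingHom.mem_range.mpr ⟨-qx, by rw [map_neg, hqx, ← map_neg]; rfl⟩⟩
      | mul x y hx hy ihx ihy =>
        obtain ⟨hxS, hx'⟩ := ihx
        obtain ⟨hyS, hy'⟩ := ihy
        obtain ⟨qx, hqx⟩ := RingHom.mem_range.mp hx'
        obtain ⟨qy, hqy⟩ := RingHom.mem_range.mp hy'
        exact ⟨mul_mem hxS hyS, RingHom.mem_range.mpr ⟨qx * qy, by rw [map_mul, hqx, hqy, ← map_mul]; rfl⟩⟩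
    intro b hb
    obtain ⟨hbS, h⟩ := key (b : K) hb
    exact h
  have hf : Function.Surjective (IsLocalization.lift (S := Localization.AtPrime 𝔫) hunit) :=
    lift_surjective_of_normal_form (P := Localization.AtPrime 𝔫) _ _ hloc F hF 𝔫 hunit h𝔫u
  -- §13 (d): `P` is a regular local domain of dimension `3 - ρ` (pinned by the surjection)
  have hEdim : ((3 - ρ : ℕ) : WithBot ℕ∞) ≤ ringKrullDim (locAtCentre A''.toSubring O ⧸ Ideal.span (Set.range uρ)) :=
    natCast_sub_le_ringKrullDim_quotient_span (n := 3) hdimS3 uρ huρ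
  obtain ⟨hPreg, hPdom, hdimP⟩ :=
    localization_mvPolynomial_regular_of_surjective (ResidueField (locAtCentre A₂.toSubring O)) (3 - ρ) 𝔫 _ hf hEdim
  -- §13 (e): the criterion — `S` is REGULAR and lifts of regular parameters of `P` are regular parameters of `S`
  obtain ⟨hregS, -, -, hlift1, hlift2⟩ :=
    regular_of_regular_quotient (n := 3) (ρ := ρ) hdimS3 hρ3 uρ huρ hdimP (IsLocalization.lift hunit) hf
  -- §13 (f): a generator `q ∈ 𝔫` mapping to a regular parameter of `P`, its lift `ψ ∈ T[u_{≥ρ}] ⊆ S`, and `ψ ∈ M`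
  have hdimP0 : ringKrullDim (Localization.AtPrime 𝔫) ≠ 0 := by
    rw [hdimP]
    have h : (3 - ρ : ℕ) ≠ 0 := by omega
    exact_mod_cast h
  obtain ⟨q, hq𝔫, hq1, hq2⟩ := exists_generator_map_not_mem_sq hdimP0 (algebraMap _ (Localization.AtPrime 𝔫))
    (𝔫 : Set (MvPolynomial (Fin (3 - ρ)) (ResidueField (locAtCentre A₂.toSubring O))))
    (by rw [Ideal.span_eq]; exact Localization.AtPrime.map_eq_maximalIdeal)
  have hres : ∀ e : Fin (3 - ρ) →₀ ℕ, ∃ c : locAtCentre A₂.toSubring O, residue _ c = q.coeff e := fun e =>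
    Ideal.Quotient.mk_surjective (q.coeff e)
  choose lam hlam using hres
  set ψ : locAtCentre A''.toSubring O := ∑ e ∈ q.support, ι (lam e) * ∏ i, uS (zI i) ^ (e i) with hψdef
  have hψF : Ideal.Quotient.mk (Ideal.span (Set.range uρ)) ψ = F q := by
    rw [hψdef, map_sum, hFdef, MvPolynomial.coe_eval₂Hom, MvPolynomial.eval₂_eq']
    refine Finset.sum_congr rfl fun e _ => ?_
    rw [map_mul, map_prod, ← hlam e, hF₁]
    simp only [map_pow]
  have hψπ : Ideal.Quotient.mk (Ideal.span (Set.range uρ)) ψ =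
      IsLocalization.lift (S := Localization.AtPrime 𝔫) hunit (algebraMap _ (Localization.AtPrime 𝔫) q) := by
    rw [IsLocalization.lift_eq]; exact hψF
  -- §13 (f)″ GRADED DESCENT (new in PORT 4′): the components of `ψ ∈ T⁺[u_{≥ρ}] = Σ_s B_s T₀[u_{≥ρ}]`
  have hlamspan : ∀ e, ∃ c : S → K, (∀ i, c i ∈ T₀) ∧
      ((lam e : locAtCentre A₂.toSubring O) : K) = ∑ i : S, c i * algebraMap k K (b i) := fun e => hTspan _ (lam e).2
  choose cc hccT₀ hcc using hlamspan
  have hT₀S' : ∀ r, r ∈ T₀ → r ∈ locAtCentre A''.toSubring O := fun r hr => hTS (hT₀S hr)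
  have hBS : ∀ s, algebraMap k K (b s) ∈ locAtCentre A''.toSubring O := fun s => hTS (le_locAtCentre _ O (hk (b s)))
  set ψc : S → locAtCentre A''.toSubring O := fun i =>
    ∑ e ∈ q.support, (⟨cc e i, hT₀S' _ (hccT₀ e i)⟩ : locAtCentre A''.toSubring O) * ∏ j, uS (zI j) ^ (e j) with hψcdef
  have hψK : ((ψ : locAtCentre A''.toSubring O) : K) =
      ∑ e ∈ q.support, ((lam e : locAtCentre A₂.toSubring O) : K) * ∏ j, u (zI j) ^ (e j) := by
    rw [hψdef]; push_cast; rfl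
  have hψcK : ∀ i, ((ψc i : locAtCentre A''.toSubring O) : K) = ∑ e ∈ q.support, cc e i * ∏ j, u (zI j) ^ (e j) := by
    intro i; rw [hψcdef]; push_cast; rfl
  have hψsumK : ((ψ : locAtCentre A''.toSubring O) : K) =
      ∑ i : S, ((ψc i : locAtCentre A''.toSubring O) : K) * algebraMap k K (b i) := by
    rw [hψK]
    simp_rw [hψcK, hcc, Finset.sum_mul]
    rw [Finset.sum_comm]
    refine Finset.sum_congr rfl fun i _ => Finset.sum_congr rfl fun e _ => ?_
    ring
  have hψS : ψ = ∑ i : S, ψc i * (⟨algebraMap k K (b i), hBS i⟩ : locAtCentre A''.toSubring O) := by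
    apply Subtype.ext
    rw [hψsumK]; push_cast; rfl
  have hψcM : ∀ i, ((ψc i : locAtCentre A''.toSubring O) : K) ∈ M := fun i => by
    rw [hψcK]
    exact sum_mem fun e _ => mul_mem (hT₀M _ (hccT₀ e i)) (prod_mem fun j _ => pow_mem (huM _ (hzIρ j)) _)
  have hψ1 : ψ ∈ maximalIdeal (locAtCentre A''.toSubring O) := hlift1 ψ _ hψπ hq1
  have hψ2 : ψ ∉ (maximalIdeal (locAtCentre A''.toSubring O)) ^ 2 := hlift2 ψ _ hψπ hq2
  have hvψ : O.valuation ((ψ : locAtCentre A''.toSubring O) : K) < 1 := (mem_maximalIdeal_locAtCentre_iff hA''O ψ).mp hψ1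
  have hsup : Finset.univ.sup (fun i => O.valuation ((ψc i : locAtCentre A''.toSubring O) : K)) < 1 := by
    rw [← hRG _ hψcM, ← hψsumK]; exact hvψ
  have hψc1 : ∀ i, ψc i ∈ maximalIdeal (locAtCentre A''.toSubring O) := fun i =>
    (mem_maximalIdeal_locAtCentre_iff hA''O _).mpr (lt_of_le_of_lt
      (Finset.le_sup (f := fun i => O.valuation ((ψc i : locAtCentre A''.toSubring O) : K)) (Finset.mem_univ i)) hsup)
  have hψc2 : ∃ i, ψc i ∉ (maximalIdeal (locAtCentre A''.toSubring O)) ^ 2 := by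
    by_contra hall
    push Not at hall
    exact hψ2 (by rw [hψS]; exact Ideal.sum_mem _ fun i _ => Ideal.mul_mem_right _ _ (hall i))
  obtain ⟨i₁, hi₁⟩ := hψc2
  exact ⟨A'', hA''O, hAA'', hA''fg, hregS, ψc i₁, hψc1 i₁, hi₁, hψcM i₁⟩

/-! ## §H THE COMPOSITION (kernel-checked): PORTS 1′, 2′, §F, 3 (verbatim), 4′ and the exit lemma give THEOREM T′_fin's slice;
T′₁'s slice is the corollary `S := Fin p`, `b i := θ^i`. -/

section Composition

open AlgebraicGeometry CategoryTheory

/-- **THEOREM T′_fin's slice from the ports** — modulo F-02 in LU³ form (`hLU3`, applied to the field `k^p`) and F-32 (`hEmb`).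
SORRY-FREE (composition and every port); data flow = the file header.  `hreg`, `hnd` unused (as in T). [folklore] -/
theorem cleanLU3DefectPRankTwoSepFin_of_ports (p : ℕ) [Fact p.Prime]
    (hLU3 : ∀ (k : Type) [Field k], LocalUniformization3 k)
    (hEmb : ∀ (Z : Scheme.{0}) [IsIntegral Z] [IsNoetherian Z], Scheme.IsRegular Z →
      Scheme.IsExcellent Z → ∀ (X : Set Z), IsClosed X → X ≠ Set.univ → topologicalKrullDim X ≤ 2 →
        ∃ (Z' : Scheme.{0}) (π : Z' ⟶ Z), IsProper π ∧ Function.Surjective π.base ∧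
          (∃ U : Z.Opens, (U : Set Z) = Xᶜ ∧ IsIso (π ∣_ U)) ∧
          IsStrictNormalCrossingsDivisor Z' (π.base ⁻¹' X)) :
    CleanLU3DefectPRankTwoSepFinAt p := by
  intro k _ _ K _ _ O A hAO hAfg hFrac hdimA hreg hdim3 hzd g₀ hg₀ hdefect htd hnd hP2 hsep S _ b hb hPI
  classical
  haveI := hFrac
  have hp : p.Prime := Fact.out
  haveI : CharP K p := charP_of_injective_algebraMap (algebraMap k K).injective p
  have hk : ∀ c : k, algebraMap k K c ∈ O := fun c => hAO (A.algebraMap_mem c)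
  -- `[K : k·K^p] = p³` (§A)
  have hdimAeq : ringKrullDim A = 3 := ringKrullDim_eq_three_of_locAtCentre O A hAO hdimA hdim3
  have hdeg : Module.finrank (Subfield.closure (Set.range (algebraMap k K) ∪ Set.range (frobenius K p))) K = p ^ 3 :=
    PDegreeSep.pDegreeThreeOfSepGenerated p k K A hAfg hFrac hdimAeq hsep
  -- `v B_s = 1` (residual `p`-independence)
  have hBv : ∀ s, O.valuation (algebraMap k K (b s)) = 1 :=
    valuation_eq_one_of_residuallyPIndependentFamily O (fun s => algebraMap k K (b s)) hPI
  -- §1′ graded data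
  obtain ⟨M, hM, hg₀M, hpM, hV, hRG, x, y, hx, hy, hvx, hvy, hP, t, ht, cf, hcfM, hsum, hcfO⟩ :=
    port_gradedData' p O A hAO hAfg g₀ hg₀ hdefect hP2 hdeg b hb hPI
  -- the finite set to monomialise: `x^p`, `y^p` and the non-zero graded coefficients of the generators
  set F : Finset K := (insert (x ^ p) (insert (y ^ p)
    ((t ×ˢ (Finset.univ : Finset (S × (Fin p × Fin p)))).image (fun q => cf q.1 q.2)))).filter (fun f => f ≠ 0)
    with hFdef
  have hFM : ∀ f ∈ F, f ∈ M := by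
    intro f hf
    rw [hFdef, Finset.mem_filter, Finset.mem_insert, Finset.mem_insert, Finset.mem_image] at hf
    rcases hf with ⟨rfl | rfl | ⟨q, hq, rfl⟩, -⟩
    · exact hpM x
    · exact hpM y
    · exact hcfM q.1 (Finset.mem_product.mp hq).1 q.2
  have hF0 : ∀ f ∈ F, f ≠ 0 := fun f hf => (Finset.mem_filter.mp hf).2
  have hxpF : x ^ p ∈ F := Finset.mem_filter.mpr ⟨by simp, pow_ne_zero _ hx⟩
  have hypF : y ^ p ∈ F := Finset.mem_filter.mpr ⟨by simp, pow_ne_zero _ hy⟩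
  have hcfF : ∀ a ∈ t, ∀ l, cf a l ≠ 0 → cf a l ∈ F := by
    intro a ha l hne
    refine Finset.mem_filter.mpr ⟨Finset.mem_insert_of_mem (Finset.mem_insert_of_mem ?_), hne⟩
    exact Finset.mem_image.mpr ⟨(a, l), Finset.mem_product.mpr ⟨ha, Finset.mem_univ _⟩, rfl⟩
  -- §2′ the monomialising `k^p`-model inside `M`
  obtain ⟨G₂, C, hG₂O, hC, hApC, hCM, z, hzC, hzv, hz0, hzspan, hmono⟩ :=
    port_monomialModel' p (hLU3 _) hEmb O A hAO hAfg hdimA hdim3 hzd g₀ M hM b hb F hFM hF0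
  -- §F the base change `T⁺ = locAtCentre k[G₂] O`, regular with parameters `z`
  obtain ⟨A₂, hA₂O, hA₂fg, hApA₂, hCA₂, hTspan, hreg₂, zT, hzT, hzspanT, hdimT⟩ :=
    basechange_model p O A hAO hAfg hdimA hdim3 hzd t ht M b hb hRG G₂ hG₂O C hC hApC hCM z hzC hzv hzspan
  haveI := hreg₂
  have hTT : locAtCentre C O ≤ locAtCentre A₂.toSubring O := locAtCentre_mono O hCA₂
  have hBA₂ : ∀ s, algebraMap k K (b s) ∈ A₂ := fun s => A₂.algebraMap_mem (b s)
  have hBT : ∀ s, algebraMap k K (b s) ∈ locAtCentre A₂.toSubring O := fun s => le_locAtCentre _ O (hBA₂ s)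
  choose! ε ex hεT hεv hfeq using hmono
  have hzM : ∀ i, z i ∈ M := fun i => hCM _ (hzC i)
  have hzV : ∀ i, ∃ w : K, w ≠ 0 ∧ O.valuation (z i) = O.valuation (w ^ p) := fun i => hV _ (hzM i) (hz0 i)
  have hxA : x ^ p = ε (x ^ p) * ∏ i, z i ^ ex (x ^ p) i := hfeq _ hxpF
  have hyB : y ^ p = ε (y ^ p) * ∏ i, z i ^ ex (y ^ p) i := hfeq _ hypF
  -- exponent data of the non-zero graded pieces (the `B_s` factor is a unit and is dropped)
  set pieces : Finset (K × (S × (Fin p × Fin p))) := (t ×ˢ Finset.univ).filter (fun q => cf q.1 q.2 ≠ 0) with hpieces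
  set E : Finset ((Fin 3 → ℤ) × (Fin p × Fin p)) := pieces.image (fun q => (ex (cf q.1 q.2), q.2.2)) with hEdef
  have hE : ∀ e ∈ E, O.valuation ((∏ i, z i ^ e.1 i) * (x ^ (e.2.1 : ℕ) * y ^ (e.2.2 : ℕ))) ≤ 1 := by
    intro e he
    obtain ⟨q, hq, rfl⟩ := Finset.mem_image.mp he
    obtain ⟨hq1, hq2⟩ := Finset.mem_filter.mp hq
    have hat : q.1 ∈ t := (Finset.mem_product.mp hq1).1
    have hF' : cf q.1 q.2 ∈ F := hcfF q.1 hat q.2 hq2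
    have hval : O.valuation (cf q.1 q.2 * (algebraMap k K (b q.2.1) * (x ^ (q.2.2.1 : ℕ) * y ^ (q.2.2.2 : ℕ)))) ≤ 1 :=
      (O.valuation_le_one_iff _).mpr (hcfO q.1 hat q.2)
    rw [hfeq _ hF', map_mul, map_mul, map_mul, hεv _ hF', hBv, one_mul, one_mul, ← map_mul] at hval
    simpa using hval
  -- §3 the toric chart (VERBATIM)
  obtain ⟨ρ, hρ, c, a, b', u, ha, hb', hu, hupos, huzero, hzu, hEu⟩ :=
    port_toricChart p O A hAO hAfg hdimA hdim3 htd hx hy hP z hz0 hzv hzV (ε (x ^ p)) (ε (y ^ p))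
      (hεv _ hxpF) (hεv _ hypF) (ex (x ^ p)) (ex (y ^ p)) hxA hyB E hE
  -- (PB0): the value-zero chart monomials involve no `x`, `y`, hence lie in `M`
  have hab0 : ∀ j : Fin 3, ρ ≤ (j : ℕ) → a j = 0 ∧ b' j = 0 := by
    intro j hj
    obtain ⟨W, hW0, hW⟩ := exists_valuation_prod_zpow_eq O z hzV (c j)
    exact exponents_eq_zero_of_valuation_eq_one O hP (ha j) (hb' j) hW0 hW (by rw [← hu j]; exact huzero j hj)
  have huM : ∀ j : Fin 3, ρ ≤ (j : ℕ) → u j ∈ M := by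
    intro j hj
    obtain ⟨ha0, hb0⟩ := hab0 j hj
    rw [hu j, ha0, hb0, pow_zero, pow_zero, mul_one, mul_one]
    exact prod_mem fun i _ => zpow_mem (hzM i) _
  have hu0 : ∀ j, u j ≠ 0 := by
    intro j
    rw [hu j]
    exact mul_ne_zero (Finset.prod_ne_zero_iff.mpr fun i _ => zpow_ne_zero _ (hz0 i))
      (mul_ne_zero (pow_ne_zero _ hx) (pow_ne_zero _ hy))
  -- the unit factors `α^i β^j` are units of `T⁺`
  have hunit : ∀ (ia ib : ℤ), ε (x ^ p) ^ ia * ε (y ^ p) ^ ib ∈ locAtCentre A₂.toSubring O ∧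
      O.valuation (ε (x ^ p) ^ ia * ε (y ^ p) ^ ib) = 1 := fun ia ib =>
    ⟨mul_mem (zpow_mem_locAtCentre (hTT (hεT _ hxpF)) (hεv _ hxpF) ia)
        (zpow_mem_locAtCentre (hTT (hεT _ hypF)) (hεv _ hypF) ib),
      by rw [map_mul, map_zpow₀, map_zpow₀, hεv _ hxpF, hεv _ hypF, one_zpow, one_zpow, one_mul]⟩
  have hzu' : ∀ i : Fin 3, ∃ (ε' : K) (d : Fin 3 → ℤ), ε' ∈ locAtCentre A₂.toSubring O ∧ O.valuation ε' = 1 ∧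
      (∀ j : Fin 3, (j : ℕ) < ρ → 0 ≤ d j) ∧ (∃ j : Fin 3, (j : ℕ) < ρ ∧ 0 < d j) ∧
      ((zT i : K)) = ε' * ∏ j, u j ^ d j := by
    intro i
    obtain ⟨d, ia, ib, hd, hdpos, hzi⟩ := hzu i
    refine ⟨_, d, (hunit ia ib).1, (hunit ia ib).2, hd, hdpos, ?_⟩
    rw [hzT i, hzi]
  -- the generators of `A` as unit-weighted sums of chart monomials with `d_{<ρ} ≥ 0`
  choose! dE iaE ibE hdE hkerE hmonE using hEu
  have htu' : ∀ a₀ ∈ t, ∃ (ν : S × (Fin p × Fin p) → K) (d : S × (Fin p × Fin p) → Fin 3 → ℤ),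
      (∀ l, ν l = 0 ∨ (ν l ∈ locAtCentre A₂.toSubring O ∧ O.valuation (ν l) = 1)) ∧
      (∀ l, ∀ j : Fin 3, (j : ℕ) < ρ → 0 ≤ d l j) ∧ a₀ = ∑ l, ν l * ∏ j, u j ^ d l j := by
    intro a₀ ha₀
    have hmemE : ∀ l, cf a₀ l ≠ 0 → (ex (cf a₀ l), l.2) ∈ E := fun l hne =>
      Finset.mem_image.mpr ⟨(a₀, l), Finset.mem_filter.mpr ⟨Finset.mem_product.mpr ⟨ha₀, Finset.mem_univ _⟩, hne⟩, rfl⟩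
    refine ⟨fun l => if cf a₀ l = 0 then 0 else
        ε (cf a₀ l) * (ε (x ^ p) ^ iaE (ex (cf a₀ l), l.2) * ε (y ^ p) ^ ibE (ex (cf a₀ l), l.2) *
          algebraMap k K (b l.1)),
      fun l => if cf a₀ l = 0 then 0 else dE (ex (cf a₀ l), l.2), ?_, ?_, ?_⟩
    · intro l
      by_cases h0 : cf a₀ l = 0
      · exact Or.inl (by simp [h0])
      · refine Or.inr ?_
        simp only [h0, if_false]
        have hF' := hcfF a₀ ha₀ l h0
        exact ⟨mul_mem (hTT (hεT _ hF')) (mul_mem (hunit _ _).1 (hBT l.1)),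
          by rw [map_mul, map_mul, hεv _ hF', (hunit _ _).2, hBv, one_mul, one_mul]⟩
    · intro l j hj
      by_cases h0 : cf a₀ l = 0
      · simp [h0]
      · simp only [h0, if_false]
        exact hdE _ (hmemE l h0) j hj
    · conv_lhs => rw [← hsum a₀ ha₀]
      refine Finset.sum_congr rfl fun l _ => ?_
      by_cases h0 : cf a₀ l = 0
      · simp [h0]
      · simp only [h0, if_false]
        have hF' := hcfF a₀ ha₀ l h0
        have hmon := hmonE _ (hmemE l h0)
        simp only at hmon
        calc cf a₀ l * (algebraMap k K (b l.1) * (x ^ (l.2.1 : ℕ) * y ^ (l.2.2 : ℕ)))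
            = (ε (cf a₀ l) * ∏ i, z i ^ ex (cf a₀ l) i) * (algebraMap k K (b l.1) * (x ^ (l.2.1 : ℕ) * y ^ (l.2.2 : ℕ))) := by
              rw [← hfeq _ hF']
          _ = ε (cf a₀ l) * algebraMap k K (b l.1) * ((∏ i, z i ^ ex (cf a₀ l) i) * (x ^ (l.2.1 : ℕ) * y ^ (l.2.2 : ℕ))) := by
              ring
          _ = ε (cf a₀ l) * (ε (x ^ p) ^ iaE (ex (cf a₀ l), l.2) * ε (y ^ p) ^ ibE (ex (cf a₀ l), l.2) *
                algebraMap k K (b l.1)) * ∏ j, u j ^ dE (ex (cf a₀ l), l.2) j := by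
              rw [hmon]; ring
  -- §G the regular chart algebra and its regular parameter in `M` (graded descent)
  obtain ⟨A'', hA''O, hAA'', hA''fg, hreg'', ψ, hψ1, hψ2, hψM⟩ :=
    port_regularParameter' p O A hAO hAfg hdimA hdim3 hzd M A₂ hA₂O hA₂fg hApA₂ b
      (locAtCentre C O) hCM hTT hTspan hRG hreg₂ zT hzspanT hdimT t ht ρ hρ u hu0 hupos huzero huM hzu' htu'
  -- exit: clean form (3) (VERBATIM)
  obtain ⟨cM, hcM⟩ := (hM _).mp hψM
  exact cleanLUConcl_of_parameter O A A'' hA''O hAA'' hA''fg hreg'' g₀ ψ hψ1 hψ2 cM hcM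

/-- The same with F-02 consumed in its main-theorem form `CossartPiltant2019` (✓ `CossartPiltant2019.lu3`). [folklore] -/
theorem cleanLU3DefectPRankTwoSepFin_of_cossartPiltant2019 (p : ℕ) [Fact p.Prime]
    (hCP : CossartPiltant2019.{0})
    (hEmb : ∀ (Z : Scheme.{0}) [IsIntegral Z] [IsNoetherian Z], Scheme.IsRegular Z →
      Scheme.IsExcellent Z → ∀ (X : Set Z), IsClosed X → X ≠ Set.univ → topologicalKrullDim X ≤ 2 →
        ∃ (Z' : Scheme.{0}) (π : Z' ⟶ Z), IsProper π ∧ Function.Surjective π.base ∧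
          (∃ U : Z.Opens, (U : Set Z) = Xᶜ ∧ IsIso (π ∣_ U)) ∧
          IsStrictNormalCrossingsDivisor Z' (π.base ⁻¹' X)) :
    CleanLU3DefectPRankTwoSepFinAt p :=
  cleanLU3DefectPRankTwoSepFin_of_ports p (fun k _ => hCP.lu3 k) hEmb

/-- **T′₁ ⊂ T′_fin**: the `p`-rank-one slice is the case `S := Fin p`, `b i := θ^i` of the finite-`p`-rank slice. [folklore] -/
theorem cleanLU3DefectPRankTwoSepRkOne_of_sepFin (p : ℕ) [Fact p.Prime]
    (hFin : CleanLU3DefectPRankTwoSepFinAt p) : CleanLU3DefectPRankTwoSepRkOneAt p := by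
  intro k _ _ K _ _ O A hAO hAfg hFrac hdimA hreg hdim3 hzd g₀ hg₀ hdefect htd hnd hP2 hsep θ hθ hPI
  refine hFin k K O A hAO hAfg hFrac hdimA hreg hdim3 hzd g₀ hg₀ hdefect htd hnd hP2 hsep (Fin p)
    (fun i => θ ^ (i : ℕ)) (fun c => hθ c) ?_
  intro w hw hw1
  simpa only [map_pow] using hPI w hw hw1

/-- **T′_fin ⊇ T up to (SEP-K)** (statement-level sanity of the new slice — the degenerate instance of §B′; not used elsewhere): over a PERFECT
field the one-element family `b = 1` is `p`-spanning (`c = (c^{1/p})^p`) and trivially residually `p`-independent, so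
`CleanLU3DefectPRankTwoSepFinAt p` yields the conclusion of T's slice ✓ `CleanLU3DefectPRankTwoAt p` under the single extra binder
`SepGenerated k K` (automatic for `K` finitely generated over a perfect field, Hartshorne I.4.8A — not formalised here). [folklore] -/
theorem cleanLU3DefectPRankTwo_sep_of_sepFin (p : ℕ) [Fact p.Prime] (hFin : CleanLU3DefectPRankTwoSepFinAt p) :
    ∀ (k : Type) [Field k] [CharP k p] [PerfectField k] (K : Type) [Field K] [Algebra k K]
    (O : ValuationSubring K) (A : Subalgebra k K), A.toSubring ≤ O.toSubring → A.FG → IsFractionRing A K →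
    ringKrullDim A ≤ 3 → IsRegularLocalRing (locAtCentre A.toSubring O) →
    ringKrullDim (locAtCentre A.toSubring O) = 3 →
    (∀ (T : Subring K) (hT : T ≤ O.toSubring), A.toSubring ≤ T → (subringCentre T O hT).IsMaximal) →
    ∀ g₀ : K, (∀ c : K, c ^ p ≠ g₀) →
    (∀ f₀ : K, ∃ f₁ : K, O.valuation (g₀ - f₁ ^ p) < O.valuation (g₀ - f₀ ^ p)) →
    (∀ hk : ∀ c : k, algebraMap k K c ∈ O, transcendenceDefect k O hk ≠ 0) →
    ¬ (∃ π : K, π ≠ 0 ∧ (∀ x : K, O.valuation x < 1 → O.valuation x ≤ O.valuation π) ∧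
      (∀ x : K, x ≠ 0 → ∃ n : ℕ, O.valuation π ^ n ≤ O.valuation x)) →
    PRankTwoAt p O → SepGenerated k K →
    CleanLUConcl p k K O A g₀ := by
  intro k _ _ _ K _ _ O A hAO hAfg hFrac hdimA hreg hdim3 hzd g₀ hg₀ hdefect htd hnd hP2 hsep
  have hp : p.Prime := Fact.out
  haveI : ExpChar k p := ExpChar.prime hp
  haveI : PerfectRing k p := PerfectField.toPerfectRing p
  refine hFin k K O A hAO hAfg hFrac hdimA hreg hdim3 hzd g₀ hg₀ hdefect htd hnd hP2 hsep Unit (fun _ => (1 : k)) ?_ ?_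
  · intro c
    obtain ⟨d, hd⟩ := surjective_frobenius k p c
    refine ⟨fun _ => d, ?_⟩
    rw [Fintype.sum_unique, mul_one, ← hd, frobenius_def]
  · rintro w - ⟨s, hs⟩
    rw [Fintype.sum_unique, map_one, mul_one, map_pow, Subsingleton.elim (default : Unit) s, hs, one_pow]

/-- **THEOREM T′₁'s slice** (`p`-rank one), now a corollary of T′_fin; same statement as `Lens5_TPrime.lean` rev 1. [folklore] -/
theorem cleanLU3DefectPRankTwoSepRkOne_of_cossartPiltant2019 (p : ℕ) [Fact p.Prime]
    (hCP : CossartPiltant2019.{0})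
    (hEmb : ∀ (Z : Scheme.{0}) [IsIntegral Z] [IsNoetherian Z], Scheme.IsRegular Z →
      Scheme.IsExcellent Z → ∀ (X : Set Z), IsClosed X → X ≠ Set.univ → topologicalKrullDim X ≤ 2 →
        ∃ (Z' : Scheme.{0}) (π : Z' ⟶ Z), IsProper π ∧ Function.Surjective π.base ∧
          (∃ U : Z.Opens, (U : Set Z) = Xᶜ ∧ IsIso (π ∣_ U)) ∧
          IsStrictNormalCrossingsDivisor Z' (π.base ⁻¹' X)) :
    CleanLU3DefectPRankTwoSepRkOneAt p :=
  cleanLU3DefectPRankTwoSepRkOne_of_sepFin p (cleanLU3DefectPRankTwoSepFin_of_cossartPiltant2019 p hCP hEmb)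

end Composition

end Summit.ResolutionOfSingularities.ResolutionOfSingularities.Cruxes.DescentPerfectToAll.CpSibling.TPrime

end
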